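import Literature.NumberTheory.Transcendental.Waldschmidt1980SizeHyp
import Literature.NumberTheory.Transcendental.Waldschmidt1980SizesB
import Literature.NumberTheory.Transcendental.PadicCW77Main
import Literature.NumberTheory.Transcendental.Waldschmidt1980KStep
import Literature.NumberTheory.Transcendental.PadicCW77Assembly
import Mathlib.NumberTheory.Height.NumberField
import Mathlib.Analysis.Complex.ExponentialBounds
import Literature.Barriers.ABC.BakerMethodBoundsStewartTijdemanGenericProofs
import Literature.NumberTheory.Transcendental.Waldschmidt1980EndgameCW
import Literature.NumberTheory.Transcendental.PadicLiouvilleInequality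
import Literature.NumberTheory.Transcendental.StewartYuPadicDescentSetup
import Literature.NumberTheory.Transcendental.StewartYuPadicW80Parameters
import HarnessLib

/-!
# The `p`-adic Cijsouw–Waldschmidt/Waldschmidt 2-descent, II: sizes, budgets, numerics, the envelope — THEOREM A (`PadicCW77.TheoremAShape` HOLDS: a `p`-adic lower bound for linear forms in logarithms of principal units with constant `c₁^m m^{c₂ m}`) (re-homed cell library `abc-stewartyu`)

**Part II of V** of the VERBATIM re-homing of the cell library `Summits/ABC/StewartYu/*` (cell `abc-stewartyu`: the kernel `p`-adic Baker
bound for logarithms of rational primes and its abc consequences) into `Literature/` by the Hodge foundations lane (prover p20,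
generation 39).  Provenance convention (docstrings byte-for-byte; `[folklore]` kept and supplemented by a
`[cite: … (source FOLLOWED …; the cell's adaptation, NOT a printed statement)]` tag because the gate no longer admits `[folklore]`
alone on a public theorem), the renaming convention (trailing prime on the helpers inside `…PadicCW77.Setup` / `…CW77.Setup`) and
the source list are stated in full in the header of Part Ia, `Literature/NumberTheory/Transcendental/StewartYuPadicDescentSetup.lean`;
namespace `Summit.ABC.StewartYu` → `Literature.NumberTheory.Transcendental.StewartYu`; imports from `Literature/` and Mathlib only;
one `section PartK` per source module; no `sorry`, no new axiom, NO named fact (D-0026).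

THIS FILE (13 source modules, every declaration but one: `PadicW80Sizes{,B,C}`, `PadicW80Budgets`, `PadicW80ParE/F`, `DescentSizesQ`,
`PadicCW77Sizes`, `PadicCW77Junctions`, `PadicW80Numeric{,B}`, `PadicW80ParEnvelope`, `ABC/Theorems/PadicPrincipalCoreST86TheoremA`):
the archimedean SIZES of the signed cores (transferred through the flattening), the budgets and the numerical inequalities of
Waldschmidt's endgame, the junction of the half step with the invariant of the descent, the envelope `C(m) ≤ c₁^m m^{c₂ m}`, the
parameter packs for EVERY set-up (`packs_exist`) — and **THEOREM A**: `StewartYu.theoremAShape_holds` /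
`StewartYu.theoremAShapeLe_one_holds` (cap `c₂ ≤ 1`, `c₁ = 2⁷⁰`, `r = 0`), with the EXACT-name discharge
**`Literature.NumberTheory.Transcendental.PadicCW77.TheoremAShape_holds`** of the named statement of `PadicCW77Assembly.lean`: for
every odd prime `p`, principal units `αⱼ ≡ 1 (mod p)` of `ℚ` that are multiplicatively independent and 2-Kummer-free, heights
`h(αⱼ) ≤ Vⱼ`, `log p ≤ Vⱼ ≤ V_max`, exponents `|bⱼ| ≤ e^W`, `b ≠ 0`:
`ord_p(∏ αⱼ^{bⱼ} − 1) · log p ≤ C(m) (∏ Vⱼ)(W + log(2V_max)) log(2V_max) / (log p)^{r(m)}` with `C(m) ≤ c₁^m m^{c₂ m}`, `c₂ ≤ 10`.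
Omitted declaration (1): `Summit.ABC.ABC.Theorems.padicPrincipalCoreST86_theoremA_proof` of the TheoremA module — the route-typed
restatement `… : Summit.ABC.ABC.Theses.PadicPrincipalCoreST86.TheoremA` (a Summits `Theses` Prop, not importable here; its content
is `StewartYu.theoremAShape_holds`).
[Waldschmidt1980] [CijsouwWaldschmidt1977] [Yu1989] [Yu1990]

WHAT THIS IS NOT: not Yu's theorem for algebraic `αⱼ` (rational principal units only); no dependence optimisation.
-/

noncomputable section

/-!
## Part 1 — port of `Summits/ABC/StewartYu/PadicW80Sizes.lean`

# Cell abc-stewartyu, WP-A4/J2: the archimedean sizes at the `p`-adic parameter record, I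

`Summits/ABC/StewartYu/PadicW80Sizes.lean` — cell `abc-stewartyu` (HOME
`run/shared/lean/pub/abc-stewartyu/`, seat p3; theorems only, no named fact), on top of p1's
parameter record `Literature.NumberTheory.Transcendental.StewartYu.PadicW80Par` (`PadicW80Par{,B,C,D}.lean`: `Up, 𝔘p, 𝔅p, Tp,
hparp, Lbp, S₀p, Lp, Lθp, J₀p, Xptp, Vallp, Lallp, tJp`) and p2's record-free height link
`CW77.Setup.SizeHyp S V Vθ W` (`Waldschmidt1980SizeHyp.lean`).

This file and `PadicW80SizesB/C.lean` re-derive, for a sign-free `S : CW77.Setup` under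
`hy : S.SizeHyp P.Vs P.Vel P.Wb`, the ARCHIMEDEAN size estimates of Waldschmidt 1980 §3.3–3.4 at the
`p`-adic parameters (moderate powers `≤ e^{𝔘/256}` / `≤ 𝔅`; height factors `≤ exp(c·𝔘/(2c_L'))`);
proofs as in the tree's `Waldschmidt1980Sizes(B).lean` with p1's parameter lemmas substituted.

Everything is [folklore] book-keeping on [cite: Waldschmidt1980, §3.3–3.4 (pp. 268–270)].
-/

section Part1

open _root_.Finset _root_.Real
open Literature.NumberTheory.Transcendental
open Literature.NumberTheory.Transcendental.Baker1975
open Literature.NumberTheory.Transcendental.Baker1975.Ch3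
open Literature.NumberTheory.Transcendental.CW77

namespace Literature.NumberTheory.Transcendental.StewartYu

namespace PadicW80Par

variable {d : ℕ} (P : PadicW80Par d)

/-! ### Moderate powers of the parameters -/

/-- Products of quantities `≤ 𝔅ⁱ`. [folklore]
[cite: Waldschmidt1980, §3.3 Lemma 3.2 (p. 266) (source FOLLOWED: the archimedean size estimates, transferred through the flattening; the cell’s adaptation, NOT a printed statement)] -/
theorem mul_le_𝔅_pow_p {a b : ℝ} {i j : ℕ} (ha : a ≤ P.𝔅p ^ i) (hb : b ≤ P.𝔅p ^ j) (hb0 : 0 ≤ b) :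
    a * b ≤ P.𝔅p ^ (i + j) := by
  rw [pow_add]
  have h𝔅 := P.𝔅_pos
  calc a * b ≤ P.𝔅p ^ i * b := mul_le_mul_of_nonneg_right ha hb0
    _ ≤ P.𝔅p ^ i * P.𝔅p ^ j := mul_le_mul_of_nonneg_left hb (by positivity)

/-- `2⁹⁰ m W⋆ ≤ 𝔘`. [folklore]
[cite: Waldschmidt1980, §3.3 Lemma 3.2 (p. 266) (source FOLLOWED: the archimedean size estimates, transferred through the flattening; the cell’s adaptation, NOT a printed statement)] -/
theorem mW_le_𝔘_p : (2 : ℝ) ^ 90 * (mRp d * P.Wstarp) ≤ P.𝔘p := by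
  have h := P.𝔘_ge
  have hG := P.one_le_G; have hV := P.one_le_prodV; have hVθ := P.one_le_Vθ; have hW := P.one_le_Wstar
  have hm2 : mRp d ≤ 2 ^ (d + 1) := by
    unfold mRp
    have : ((d : ℝ) + 1) = ((d + 1 : ℕ) : ℝ) := by push_cast; ring
    rw [this]; exact_mod_cast (Nat.lt_two_pow_self).le
  have hd := P.hd
  have hpow : (2 : ℝ) ^ 90 * mRp d ≤ 2 ^ (49 * (d + 1)) := by
    calc (2 : ℝ) ^ 90 * mRp d ≤ 2 ^ 90 * 2 ^ (d + 1) := by gcongr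
      _ = 2 ^ (91 + d) := by rw [← pow_add]; ring_nf
      _ ≤ 2 ^ (49 * (d + 1)) := pow_le_pow_right₀ (by norm_num) (by omega)
  have hVV : 1 ≤ (∏ j, P.Vs j) * P.Vel := by nlinarith
  calc (2 : ℝ) ^ 90 * (mRp d * P.Wstarp) = (2 ^ 90 * mRp d) * P.Wstarp := by ring
    _ ≤ 2 ^ (49 * (d + 1)) * P.Wstarp := by gcongr
    _ = 2 ^ (49 * (d + 1)) * 1 * 1 * P.Wstarp := by ring
    _ ≤ 2 ^ (49 * (d + 1)) * P.Gp * ((∏ j, P.Vs j) * P.Vel) * P.Wstarp := by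
        have h49 : (0 : ℝ) ≤ 2 ^ (49 * (d + 1)) := pow_nonneg zero_le_two _
        have hG0 : 0 ≤ P.Gp := by linarith
        exact mul_le_mul_of_nonneg_right
          (mul_le_mul (mul_le_mul_of_nonneg_left hG h49) hVV zero_le_one (mul_nonneg h49 hG0)) (by linarith)
    _ ≤ P.𝔘p := h

/-- `T^T ≤ exp(𝔘/256)`. [folklore]
[cite: Waldschmidt1980, §3.3 Lemma 3.2 (p. 266) (source FOLLOWED: the archimedean size estimates, transferred through the flattening; the cell’s adaptation, NOT a printed statement)] -/
theorem T_pow_T_le_p : (P.Tp : ℝ) ^ P.Tp ≤ Real.exp (P.𝔘p / 256) := by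
  have hT := P.T_pos
  rw [← Real.exp_log hT, ← Real.exp_nat_mul, Real.exp_le_exp]
  have h1 := P.log_T_le; have h2 := P.TWstar_le; have hU := P.𝔘_pos
  calc (P.Tp : ℝ) * Real.log P.Tp ≤ P.Tp * (10 * P.Wstarp) := mul_le_mul_of_nonneg_left h1 hT.le
    _ = 10 * (P.Tp * P.Wstarp) := by ring
    _ ≤ 10 * (P.𝔘p / cTp) := by gcongr
    _ ≤ P.𝔘p / 256 := by unfold cTp; nlinarith

/-- `T^k ≤ exp(𝔘/256)` for `k ≤ T`. [folklore]
[cite: Waldschmidt1980, §3.3 Lemma 3.2 (p. 266) (source FOLLOWED: the archimedean size estimates, transferred through the flattening; the cell’s adaptation, NOT a printed statement)] -/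
theorem T_pow_le_p {k : ℕ} (hk : k ≤ P.Tp) : (P.Tp : ℝ) ^ k ≤ Real.exp (P.𝔘p / 256) := by
  have h1 : (1 : ℝ) ≤ P.Tp := by exact_mod_cast P.one_le_T
  exact (pow_le_pow_right₀ h1 hk).trans P.T_pow_T_le_p

/-- `2^{h L_b} ≤ exp(𝔘/256)`. [folklore]
[cite: Waldschmidt1980, §3.3 Lemma 3.2 (p. 266) (source FOLLOWED: the archimedean size estimates, transferred through the flattening; the cell’s adaptation, NOT a printed statement)] -/
theorem two_pow_hLb_le_p : (2 : ℝ) ^ (P.hparp * P.Lbp) ≤ Real.exp (P.𝔘p / 256) := by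
  have h2 : (2 : ℝ) = Real.exp (Real.log 2) := (Real.exp_log two_pos).symm
  rw [h2, ← Real.exp_nat_mul, Real.exp_le_exp]
  push_cast
  have h1 := P.hparLb_le; have hW := P.Wstar_le_𝔘; have hU := P.𝔘_pos
  have hl2 : Real.log 2 ≤ 1 := by linarith [Real.log_two_lt_d9]
  have hl0 : 0 ≤ Real.log 2 := Real.log_nonneg one_le_two
  have h0 : (0 : ℝ) ≤ P.hparp * P.Lbp := by positivity
  calc ((P.hparp : ℝ) * P.Lbp) * Real.log 2 ≤ (P.hparp * P.Lbp) * 1 := mul_le_mul_of_nonneg_left hl2 h0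
    _ ≤ P.𝔘p / cLp + 3 * P.Wstarp := by linarith
    _ ≤ P.𝔘p / 256 := by unfold cLp; nlinarith

/-- `exp(𝔘/256)⁴ = 𝔅`. [folklore]
[cite: Waldschmidt1980, §3.3 Lemma 3.2 (p. 266) (source FOLLOWED: the archimedean size estimates, transferred through the flattening; the cell’s adaptation, NOT a printed statement)] -/
theorem exp_quarter_pow_four_p : Real.exp (P.𝔘p / 256) ^ 4 = P.𝔅p := by
  unfold 𝔅p; rw [← Real.exp_nat_mul]; ring_nf

/-- **`(e(x+h)/h)^{h L_b} ≤ exp(𝔘/256)`** for `x ≤ Xpt`. [cite: Waldschmidt1980, (3.13)–(3.14) (p. 265)] -/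
theorem ratio_pow_le_p {x : ℕ} (hx : (x : ℝ) ≤ P.Xptp) :
    (Real.exp 1 * ((x : ℝ) + P.hparp) / P.hparp) ^ (P.hparp * P.Lbp) ≤ Real.exp (P.𝔘p / 256) := by
  have hh := P.hpar_pos
  have hbase : 1 ≤ Real.exp 1 * ((x : ℝ) + P.hparp) / P.hparp := by
    rw [le_div_iff₀ hh]
    have := Real.exp_one_gt_two; have := Nat.cast_nonneg (α := ℝ) x
    nlinarith
  have hpos : 0 < Real.exp 1 * ((x : ℝ) + P.hparp) / P.hparp := by linarith
  rw [← Real.exp_log hpos, ← Real.exp_nat_mul, Real.exp_le_exp]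
  have h1 : Real.log (Real.exp 1 * ((x : ℝ) + P.hparp) / P.hparp) =
      1 + Real.log (((x : ℝ) + P.hparp) / P.hparp) := by
    rw [mul_div_assoc, Real.log_mul (Real.exp_pos 1).ne' (by positivity), Real.log_exp]
  rw [h1]
  have h2 : Real.log (((x : ℝ) + P.hparp) / P.hparp) ≤ 6 * P.Gp := by
    refine le_trans (Real.log_le_log (by positivity) ?_) P.log_Xpt_div_le
    exact div_le_div_of_nonneg_right (by linarith) hh.le
  have hG := P.one_le_G
  have h3 := P.hparLbG_le; have hW := P.Wstar_le_𝔘; have hGU := P.G_le_𝔘; have hU := P.𝔘_pos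
  have h0 : (0 : ℝ) ≤ P.hparp * P.Lbp := by positivity
  push_cast
  calc ((P.hparp : ℝ) * P.Lbp) * (1 + Real.log (((x : ℝ) + P.hparp) / P.hparp))
      ≤ (P.hparp * P.Lbp) * (7 * P.Gp) := mul_le_mul_of_nonneg_left (by linarith) h0
    _ = 7 * (P.hparp * P.Lbp * P.Gp) := by ring
    _ ≤ 7 * (P.𝔘p / cLp + (P.Wstarp + P.Gp)) := by gcongr
    _ ≤ P.𝔘p / 256 := by unfold cLp; nlinarith

/-- **`ν(x, h)^k ≤ 𝔅`** for `x ≤ Xpt`, `k ≤ T`. [cite: Waldschmidt1980, §3.4 (3.21) (p. 269)] -/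
theorem nuBound_pow_le_𝔅_p {x k : ℕ} (hx : (x : ℝ) ≤ P.Xptp) (hk : k ≤ P.Tp) :
    ((nuBound x P.hparp : ℕ) : ℝ) ^ k ≤ P.𝔅p := by
  have hν1 : (1 : ℝ) ≤ nuBound x P.hparp := by exact_mod_cast nuBound_pos x P.hparp
  refine (pow_le_pow_right₀ hν1 hk).trans (P.le_𝔅_of_log_le ?_)
  rw [Real.log_pow]
  have h1 := Waldschmidt1980.W80Par.log_nuBound_le_one_le (x := x) P.one_le_hpar
  have hh := P.hpar_pos
  have h2 : Real.log (((x : ℝ) + P.hparp) / P.hparp) ≤ 6 * P.Gp := by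
    refine le_trans (Real.log_le_log (by positivity) ?_) P.log_Xpt_div_le
    exact div_le_div_of_nonneg_right (by linarith) hh.le
  have hG := P.one_le_G
  have h3 : Real.log (nuBound x P.hparp) ≤ P.hparp * (60 * P.Gp) := by
    refine h1.trans (mul_le_mul_of_nonneg_left ?_ hh.le)
    linarith
  have hT := P.T_pos; have hTW := P.TWstar_le; have hGW := P.G_le_two_Wstar; have hhG := P.hparG_le
  have hU := P.𝔘_pos
  calc (P.Tp : ℝ) * Real.log (nuBound x P.hparp) ≤ P.Tp * (P.hparp * (60 * P.Gp)) :=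
        mul_le_mul_of_nonneg_left h3 hT.le
    _ = 60 * P.Tp * (P.hparp * P.Gp) := by ring
    _ ≤ 60 * P.Tp * (P.Wstarp + P.Gp) := by gcongr
    _ ≤ 60 * P.Tp * (3 * P.Wstarp) := by gcongr; linarith
    _ = 180 * (P.Tp * P.Wstarp) := by ring
    _ ≤ 180 * (P.𝔘p / cTp) := by gcongr
    _ ≤ P.𝔘p / 64 := by unfold cTp; nlinarith

/-! ### The linear-form constant `Γ = 2 U e^W` and the ranges against `U` -/

/-- `log(2 U e^W) ≤ 11 W⋆ + 1`. [folklore]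
[cite: Waldschmidt1980, §3.3 Lemma 3.2 (p. 266) (source FOLLOWED: the archimedean size estimates, transferred through the flattening; the cell’s adaptation, NOT a printed statement)] -/
theorem log_Γ_le_p : Real.log (2 * P.Up * Real.exp P.Wb) ≤ 11 * P.Wstarp + 1 := by
  have hU := P.U_pos
  rw [Real.log_mul (by positivity) (Real.exp_pos _).ne', Real.log_mul (by norm_num) hU.ne', Real.log_exp]
  have h1 := P.log_U_le; have h2 := P.W_le_Wstar
  have h3 : Real.log 2 ≤ 1 := by have := Real.log_two_lt_d9; linarith
  linarith

/-- `1 ≤ 2 U e^W`. [folklore]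
[cite: Waldschmidt1980, §3.3 Lemma 3.2 (p. 266) (source FOLLOWED: the archimedean size estimates, transferred through the flattening; the cell’s adaptation, NOT a printed statement)] -/
theorem one_le_Γ_p : (1 : ℝ) ≤ 2 * P.Up * Real.exp P.Wb := by
  have hW : 1 ≤ Real.exp P.Wb := Real.one_le_exp (by linarith [P.hW])
  have hU : 1 ≤ P.Up := by
    have := P.U_div_ge'; have hW1 := P.one_le_Wstar
    have h2 : (1 : ℝ) ≤ 2 ^ (49 * (d + 1)) := one_le_pow₀ (by norm_num)
    have h3 : P.Up / (2 ^ (d + 1) * P.Wstarp) ≤ P.Up := div_le_self P.U_pos.le (by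
      have : (1 : ℝ) ≤ 2 ^ (d + 1) := one_le_pow₀ (by norm_num)
      nlinarith)
    linarith
  nlinarith

/-- `Lⱼ ≤ U`. [cite: Waldschmidt1980, (3.4) (p. 264)] -/
theorem Lp_le_U (j : Fin d) : (P.Lp j : ℝ) ≤ P.Up := by
  have hU := P.U_pos
  have hden : 1 ≤ cLp' * mRp d * 2 ^ (d + 2) * P.S₀p * P.Vs j := by
    have hm := two_le_mR P; have hS : (2 : ℝ) ≤ P.S₀p := by exact_mod_cast P.two_le_S₀
    have hV := P.hV j
    have h4 : (1 : ℝ) ≤ 2 ^ (d + 2) := one_le_pow₀ (by norm_num)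
    unfold cLp'
    have h5 : (1 : ℝ) ≤ 2 ^ 12 * mRp d := by nlinarith
    calc (1 : ℝ) ≤ 2 ^ 12 * mRp d := h5
      _ ≤ 2 ^ 12 * mRp d * 2 ^ (d + 2) := le_mul_of_one_le_right (by positivity) h4
      _ ≤ 2 ^ 12 * mRp d * 2 ^ (d + 2) * P.S₀p := le_mul_of_one_le_right (by positivity) (by linarith)
      _ ≤ 2 ^ 12 * mRp d * 2 ^ (d + 2) * P.S₀p * P.Vs j := le_mul_of_one_le_right (by positivity) hV
  unfold Lp
  calc (⌊P.Up / (cLp' * mRp d * 2 ^ (d + 2) * P.S₀p * P.Vs j)⌋₊ : ℝ)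
      ≤ P.Up / (cLp' * mRp d * 2 ^ (d + 2) * P.S₀p * P.Vs j) := Nat.floor_le (by positivity)
    _ ≤ P.Up := div_le_self hU.le hden

/-- `L_θ ≤ U`. [cite: Waldschmidt1980, (3.4) (p. 264)] -/
theorem Lθp_le_U : (P.Lθp : ℝ) ≤ P.Up := by
  have hU := P.U_pos
  have hden : 1 ≤ cLp' * mRp d * 2 ^ (d + 2) * P.S₀p * P.Vel := by
    have hm := two_le_mR P; have hS : (2 : ℝ) ≤ P.S₀p := by exact_mod_cast P.two_le_S₀
    have hV := P.one_le_Vθ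
    have h4 : (1 : ℝ) ≤ 2 ^ (d + 2) := one_le_pow₀ (by norm_num)
    unfold cLp'
    have h5 : (1 : ℝ) ≤ 2 ^ 12 * mRp d := by nlinarith
    calc (1 : ℝ) ≤ 2 ^ 12 * mRp d := h5
      _ ≤ 2 ^ 12 * mRp d * 2 ^ (d + 2) := le_mul_of_one_le_right (by positivity) h4
      _ ≤ 2 ^ 12 * mRp d * 2 ^ (d + 2) * P.S₀p := le_mul_of_one_le_right (by positivity) (by linarith)
      _ ≤ 2 ^ 12 * mRp d * 2 ^ (d + 2) * P.S₀p * P.Vel := le_mul_of_one_le_right (by positivity) hV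
  exact P.Lθ_le.trans (div_le_self hU.le hden)

/-- `Lallᵢ ≤ U`. [cite: Waldschmidt1980, (3.4) (p. 264)] -/
theorem Lallp_le_U (i : Fin (d + 1)) : (P.Lallp i : ℝ) ≤ P.Up := by
  refine Fin.lastCases ?_ (fun j => ?_) i
  · rw [P.Lall_last]; exact P.Lθp_le_U
  · rw [P.Lall_castSucc]; exact P.Lp_le_U j

/-- `∑ᵢ Lallᵢ Vallᵢ = ∑ⱼ LⱼVⱼ + L_θ V_θ`. [folklore]
[cite: Waldschmidt1980, §3.3 Lemma 3.2 (p. 266) (source FOLLOWED: the archimedean size estimates, transferred through the flattening; the cell’s adaptation, NOT a printed statement)] -/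
theorem sum_Lallp_Vallp : ∑ i, (P.Lallp i : ℝ) * P.Vallp i = (∑ j, (P.Lp j : ℝ) * P.Vs j) + P.Lθp * P.Vel := by
  rw [Fin.sum_univ_castSucc]; simp

/-- **`S₀ ∑ᵢ Lallᵢ Vallᵢ ≤ 𝔘/(2c_L')`** ((3.11) at the `p`-adic parameters). [cite: Waldschmidt1980, (3.11) (p. 265)] -/
theorem S₀p_sum_LV_le : (P.S₀p : ℝ) * ∑ i, (P.Lallp i : ℝ) * P.Vallp i ≤ P.𝔘p / (2 * cLp') := by
  rw [P.sum_Lallp_Vallp]; exact P.S₀LV_le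

/-- **`∑ eᵢ Vallᵢ ≤ c 𝔘/(2c_L')`** when `eᵢ ≤ c Lallᵢ S₀`. [cite: Waldschmidt1980, (3.11) (p. 265)] -/
theorem sum_eVp_le {e : Fin (d + 1) → ℕ} {c : ℕ} (he : ∀ i, e i ≤ c * P.Lallp i * P.S₀p) :
    ∑ i, (e i : ℝ) * P.Vallp i ≤ c * (P.𝔘p / (2 * cLp')) := by
  have h1 : ∑ i, (e i : ℝ) * P.Vallp i ≤ c * (P.S₀p * ∑ i, (P.Lallp i : ℝ) * P.Vallp i) := by
    rw [mul_sum, mul_sum]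
    refine sum_le_sum fun i _ => ?_
    have : (e i : ℝ) ≤ c * P.Lallp i * P.S₀p := by exact_mod_cast he i
    have hV := (P.Vall_pos i).le
    calc (e i : ℝ) * P.Vallp i ≤ (c * P.Lallp i * P.S₀p) * P.Vallp i := mul_le_mul_of_nonneg_right this hV
      _ = c * (P.S₀p * ((P.Lallp i : ℝ) * P.Vallp i)) := by ring
  exact h1.trans (mul_le_mul_of_nonneg_left P.S₀p_sum_LV_le (Nat.cast_nonneg _))

end PadicW80Par

end Literature.NumberTheory.Transcendental.StewartYu

namespace Literature.NumberTheory.Transcendental.CW77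

namespace Setup

open Literature.NumberTheory.Transcendental.StewartYu
open Literature.NumberTheory.Transcendental.StewartYu.PadicW80Par (cLp' cTp mRp)

variable {S : Setup} {P : PadicW80Par S.d} (hy : S.SizeHyp P.Vs P.Vel P.Wb)
include hy

/-! ### Coefficients -/

/-- **`|b_θ|^k ≤ 𝔅`** for `k ≤ T` (`k W ≤ T W⋆ ≤ 𝔘/c_T`). [cite: Waldschmidt1980, §3.3 (p. 268)] -/
theorem SizeHyp.natAbs_bθ_pow_le_p' {k : ℕ} (hk : k ≤ P.Tp) : ((S.bθ.natAbs ^ k : ℕ) : ℝ) ≤ P.𝔅p := by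
  refine (hy.natAbs_bθ_pow_le_exp k).trans (P.exp_le_𝔅 ?_)
  have hTW := P.TWstar_le; have hW := P.W_le_Wstar; have hT := P.T_pos; have hU := P.𝔘_pos
  have hW1 := P.hW
  have hk' : (k : ℝ) ≤ P.Tp := by exact_mod_cast hk
  calc (k : ℝ) * P.Wb ≤ P.Tp * P.Wstarp := mul_le_mul hk' hW (by linarith) hT.le
    _ ≤ P.𝔘p / cTp := hTW
    _ ≤ P.𝔘p / 64 := by unfold cTp; rw [div_le_div_iff₀ (by norm_num) (by norm_num)]; nlinarith

/-! ### The linear-form factor `qA` on the boxes of the `p`-adic ranges -/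

/-- `|γⱼ(u)| ≤ 2 U e^W` on the box of level `J`. [cite: Waldschmidt1980, §3.3 (p. 268)] -/
theorem SizeHyp.abs_γ_le_p' {J : ℕ} {u : Idx S.d P.hparp P.Lbp}
    (hu : u ∈ S.box (h := P.hparp) (Lb := P.Lbp) P.Lp P.Lθp J) (j : Fin S.d) :
    |(S.γ u j : ℝ)| ≤ 2 * P.Up * Real.exp P.Wb := by
  rw [S.mem_box] at hu
  unfold γ
  push_cast
  have h1 : (u.2.1 j : ℝ) ≤ P.Up := by
    have : (u.2.1 j : ℝ) ≤ P.Lp j := by exact_mod_cast (hu.1 j).trans (Nat.div_le_self _ _)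
    exact this.trans (P.Lp_le_U j)
  have h2 : (u.2.2 : ℝ) ≤ P.Up := by
    have : (u.2.2 : ℝ) ≤ P.Lθp := by exact_mod_cast hu.2.trans (Nat.div_le_self _ _)
    exact this.trans P.Lθp_le_U
  have hW : 1 ≤ Real.exp P.Wb := Real.one_le_exp (by linarith [P.hW])
  have hU := P.U_pos
  calc |(u.2.1 j : ℝ) + (u.2.2 : ℝ) * (S.β j : ℝ)| ≤ |(u.2.1 j : ℝ)| + |(u.2.2 : ℝ) * (S.β j : ℝ)| :=
        abs_add_le _ _
    _ = (u.2.1 j : ℝ) + (u.2.2 : ℝ) * |(S.β j : ℝ)| := by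
        rw [abs_mul, Nat.abs_cast, Nat.abs_cast]
    _ ≤ P.Up + P.Up * Real.exp P.Wb := add_le_add h1 (mul_le_mul h2 (hy.abs_β_le j) (abs_nonneg _) hU.le)
    _ ≤ 2 * P.Up * Real.exp P.Wb := by nlinarith

/-- **`|qA(u, τ')| ≤ 𝔅`** on the box of the `p`-adic ranges, `|τ'| ≤ T`.
[cite: Waldschmidt1980, §3.3 (proof of Lemma 3.3, p. 268)] -/
theorem SizeHyp.abs_qA_le_p' {J : ℕ} {u : Idx S.d P.hparp P.Lbp}
    (hu : u ∈ S.box (h := P.hparp) (Lb := P.Lbp) P.Lp P.Lθp J)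
    {τ' : Fin S.d → ℕ} (hτ : ∑ j, τ' j ≤ P.Tp) : |(S.qA u τ' : ℝ)| ≤ P.𝔅p := by
  set Γ := 2 * P.Up * Real.exp P.Wb with hΓ
  have hΓ1 : 1 ≤ Γ := P.one_le_Γ_p
  have h1 : |(S.qA u τ' : ℝ)| ≤ Γ ^ P.Tp := by
    unfold qA; push_cast
    rw [abs_prod]
    calc ∏ j, |(S.γ u j : ℝ) ^ τ' j| = ∏ j, |(S.γ u j : ℝ)| ^ τ' j := prod_congr rfl fun j _ => abs_pow _ _
      _ ≤ ∏ j, Γ ^ τ' j := prod_le_prod (fun j _ => by positivity)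
          fun j _ => pow_le_pow_left₀ (abs_nonneg _) (hy.abs_γ_le_p' hu j) _
      _ = Γ ^ ∑ j, τ' j := (prod_pow_eq_pow_sum _ _ _)
      _ ≤ Γ ^ P.Tp := pow_le_pow_right₀ hΓ1 hτ
  refine h1.trans (P.le_𝔅_of_log_le ?_)
  rw [Real.log_pow]
  have hT := P.T_pos; have hTW := P.TWstar_le; have hTU := P.T_le_𝔘; have hW := P.one_le_Wstar
  calc (P.Tp : ℝ) * Real.log Γ ≤ P.Tp * (11 * P.Wstarp + 1) := mul_le_mul_of_nonneg_left P.log_Γ_le_p hT.le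
    _ = 11 * (P.Tp * P.Wstarp) + P.Tp := by ring
    _ ≤ 11 * (P.𝔘p / cTp) + P.𝔘p / cTp := by gcongr
    _ ≤ P.𝔘p / 64 := by unfold cTp; have := P.𝔘_pos; nlinarith

/-! ### Height factors at the `p`-adic ranges -/

/-- **`∏ H(allᵢ)^{eᵢ} ≤ exp(c 𝔘/(2c_L'))`** when `eᵢ ≤ c Lallᵢ S₀`. [cite: Waldschmidt1980, (3.11) (p. 265)] -/
theorem SizeHyp.prod_hgt_pow_le_p' {e : Fin (S.d + 1) → ℕ} {c : ℕ} (he : ∀ i, e i ≤ c * P.Lallp i * P.S₀p) :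
    ∏ i, hgt (S.all i) ^ e i ≤ Real.exp (c * (P.𝔘p / (2 * cLp'))) := by
  calc ∏ i, hgt (S.all i) ^ e i ≤ ∏ i, Real.exp (e i * P.Vallp i) :=
        prod_le_prod (fun i _ => pow_nonneg (hgt_pos _).le _) fun i _ => hy.hgt_pow_le i (e i)
    _ = Real.exp (∑ i, (e i : ℝ) * P.Vallp i) := (Real.exp_sum _ _).symm
    _ ≤ Real.exp (c * (P.𝔘p / (2 * cLp'))) := Real.exp_le_exp.mpr (P.sum_eVp_le he)

/-- **The denominators `∏ den(αⱼ)^{eⱼ} · den θ^{e_θ} ≤ exp(c 𝔘/(2c_L'))`** when `eⱼ ≤ c Lⱼ S₀`,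
`e_θ ≤ c L_θ S₀`. [cite: Waldschmidt1980, (3.11) (p. 265)] -/
theorem SizeHyp.den_prod_le_p' {e : Fin S.d → ℕ} {eθ : ℕ} {c : ℕ} (he : ∀ j, e j ≤ c * P.Lp j * P.S₀p)
    (heθ : eθ ≤ c * P.Lθp * P.S₀p) :
    (((∏ j, (S.α j).den ^ e j) * S.θ.den ^ eθ : ℕ) : ℝ) ≤ Real.exp (c * (P.𝔘p / (2 * cLp'))) := by
  set e' : Fin (S.d + 1) → ℕ := Fin.snoc e eθ with he'
  have hall : (((∏ j, (S.α j).den ^ e j) * S.θ.den ^ eθ : ℕ) : ℝ) = ∏ i, ((S.all i).den : ℝ) ^ e' i := by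
    push_cast
    rw [Fin.prod_univ_castSucc]
    unfold all
    simp only [he', Fin.snoc_castSucc, Fin.snoc_last]
  rw [hall]
  have he'' : ∀ i, e' i ≤ c * P.Lallp i * P.S₀p := by
    intro i
    refine Fin.lastCases ?_ (fun j => ?_) i
    · simp only [he', Fin.snoc_last, PadicW80Par.Lall_last]; exact heθ
    · simp only [he', Fin.snoc_castSucc, PadicW80Par.Lall_castSucc]; exact he j
  refine le_trans ?_ (hy.prod_hgt_pow_le_p' he'')
  refine prod_le_prod (fun i _ => by positivity) fun i _ => ?_
  exact pow_le_pow_left₀ (by positivity) (den_le_hgt _) _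

omit hy in
/-- The exponents on the box of level `J` at a point `s ≤ 2^J · c · S₀` are `≤ c Lallᵢ S₀`. [folklore]
[cite: Waldschmidt1980, §3.3 Lemma 3.2 (p. 266) (source FOLLOWED: the archimedean size estimates, transferred through the flattening; the cell’s adaptation, NOT a printed statement)] -/
theorem expn_le_of_mem_box_p' {J c : ℕ} {u : Idx S.d P.hparp P.Lbp}
    (hu : u ∈ S.box (h := P.hparp) (Lb := P.Lbp) P.Lp P.Lθp J) {s : ℕ} (hs : s ≤ 2 ^ J * (c * P.S₀p))
    (i : Fin (S.d + 1)) : S.expn u s i ≤ c * P.Lallp i * P.S₀p := by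
  rw [S.mem_box] at hu
  have hdiv : ∀ (lam Lq : ℕ), lam ≤ Lq / 2 ^ J → lam * s ≤ c * Lq * P.S₀p := by
    intro lam Lq hl
    calc lam * s ≤ (Lq / 2 ^ J) * (2 ^ J * (c * P.S₀p)) := Nat.mul_le_mul hl hs
      _ = ((Lq / 2 ^ J) * 2 ^ J) * (c * P.S₀p) := by ring
      _ ≤ Lq * (c * P.S₀p) := Nat.mul_le_mul_right _ (Nat.div_mul_le_self Lq (2 ^ J))
      _ = c * Lq * P.S₀p := by ring
  refine Fin.lastCases ?_ (fun j => ?_) i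
  · rw [S.expn_last, PadicW80Par.Lall_last]; exact hdiv _ _ hu.2
  · rw [S.expn_castSucc, PadicW80Par.Lall_castSucc]; exact hdiv _ _ (hu.1 j)

/-- **`|qE(u, s)| ≤ exp(c 𝔘/(2c_L'))`** on the box of level `J`, `s ≤ 2^J c S₀`.
[cite: Waldschmidt1980, §3.4 (3.21) (p. 269)] -/
theorem SizeHyp.abs_qE_le_p' {J c : ℕ} {u : Idx S.d P.hparp P.Lbp}
    (hu : u ∈ S.box (h := P.hparp) (Lb := P.Lbp) P.Lp P.Lθp J)
    {s : ℕ} (hs : s ≤ 2 ^ J * (c * P.S₀p)) : |(S.qE u s : ℝ)| ≤ Real.exp (c * (P.𝔘p / (2 * cLp'))) := by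
  have he := S.expn_le_of_mem_box_p' (P := P) hu hs
  unfold qE; push_cast
  rw [abs_of_nonneg (by
    refine mul_nonneg (prod_nonneg fun j _ => pow_nonneg ?_ _) (pow_nonneg ?_ _)
    · exact_mod_cast (S.α_pos j).le
    · exact_mod_cast S.θ_pos.le)]
  have hall : (∏ j, (S.α j : ℝ) ^ (u.2.1 j * s)) * (S.θ : ℝ) ^ (u.2.2 * s) =
      ∏ i, ((S.all i : ℚ) : ℝ) ^ S.expn u s i := by
    rw [Fin.prod_univ_castSucc]
    unfold all
    simp only [S.expn_castSucc, S.expn_last, Fin.snoc_castSucc, Fin.snoc_last]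
  rw [hall]
  have key := hy.prod_hgt_pow_le_p' he
  refine le_trans ?_ key
  refine prod_le_prod (fun i _ => pow_nonneg (by exact_mod_cast (S.all_pos i).le) _) fun i _ => ?_
  exact pow_le_pow_left₀ (by exact_mod_cast (S.all_pos i).le) (self_le_hgt _) _

/-- **`|qEh(u, s)| ≤ exp(c 𝔘/(2c_L'))`** on the box of level `J`, `s ≤ 2^J c S₀` (the half-point
factor). [cite: Waldschmidt1980, §3.4 (3.22) (p. 270)] -/
theorem SizeHyp.abs_qEh_le_p' {J c : ℕ} {u : Idx S.d P.hparp P.Lbp}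
    (hu : u ∈ S.box (h := P.hparp) (Lb := P.Lbp) P.Lp P.Lθp J)
    {s : ℕ} (hs : s ≤ 2 ^ J * (c * P.S₀p)) : |(S.qEh u s : ℝ)| ≤ Real.exp (c * (P.𝔘p / (2 * cLp'))) := by
  have he := S.expn_le_of_mem_box_p' (P := P) hu hs
  unfold qEh; push_cast
  rw [abs_of_nonneg (prod_nonneg fun i _ => pow_nonneg (by exact_mod_cast (S.all_pos i).le) _)]
  have he'' : ∀ i, S.expn u s i / 2 ≤ c * P.Lallp i * P.S₀p := fun i => (Nat.div_le_self _ _).trans (he i)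
  have := hy.prod_hgt_pow_le_p' he''
  refine le_trans ?_ this
  refine prod_le_prod (fun i _ => pow_nonneg (by exact_mod_cast (S.all_pos i).le) _) fun i _ => ?_
  exact pow_le_pow_left₀ (by exact_mod_cast (S.all_pos i).le) (self_le_hgt _) _

end Setup

end Literature.NumberTheory.Transcendental.CW77

end Part1

/-!
## Part 2 — port of `Summits/ABC/StewartYu/PadicW80SizesB.lean`

# Cell abc-stewartyu, WP-A4/J2: the archimedean sizes at the `p`-adic parameter record, II

`Summits/ABC/StewartYu/PadicW80SizesB.lean` — continuation of `PadicW80Sizes.lean` (cell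
`abc-stewartyu`, seat p3; theorems only): for `S : CW77.Setup` at p1's parameters
`S₀p, Lp, Lθp, J₀p, Xptp`: `scale_le_T_p'` (`2^{J₀−J} ≤ T`), `scale_mul_le_Xptp'` (the evaluation points
are `≤ X`), `abs_qΔ_le_p'` (`|qΔ| ≤ 𝔅`, Baker's `Δ`-polynomials at `x ≤ X`, `τ₀ ≤ T`),
`card_box_le_𝔅_p'` (`#box_J ≤ 𝔅`).  The proofs are those of `Waldschmidt1980SizesB.lean`.

Everything is [folklore] book-keeping on [cite: Waldschmidt1980, §3.2 (p. 266), §3.4 (p. 269)].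
-/

section Part2

open _root_.Finset _root_.Real
open Literature.NumberTheory.Transcendental
open Literature.NumberTheory.Transcendental.Baker1975
open Literature.NumberTheory.Transcendental.Baker1975.Ch3
open Literature.NumberTheory.Transcendental.CW77

namespace Literature.NumberTheory.Transcendental.CW77

namespace Setup

open Literature.NumberTheory.Transcendental.StewartYu
open Literature.NumberTheory.Transcendental.StewartYu.PadicW80Par (cLp' cTp cLp mRp mR_pos two_le_mR)

variable {S : Setup} {P : PadicW80Par S.d}

/-! ### The scale and the `Δ`-polynomials at the `p`-adic depth `J₀ᵖ` -/

/-- `scale(J₀ᵖ, J) = 2^{J₀ᵖ−J} ≤ 2 L_θᵖ ≤ T`. [cite: Waldschmidt1980, §3.4 (p. 269)] -/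
theorem scale_le_T_p' (P : PadicW80Par S.d) (J : ℕ) : scale P.J₀p J ≤ P.Tp := by
  unfold scale
  have h1 : 2 ^ (P.J₀p - J) ≤ 2 ^ P.J₀p := Nat.pow_le_pow_right two_pos (Nat.sub_le _ _)
  have h2 := P.two_pow_le
  have h3 : 2 * P.Lθp ≤ P.Tp := by
    have h := P.T_ge_Lθ
    have hm := two_le_mR P; have hV := P.one_le_Vθ
    have hL : (0 : ℝ) ≤ P.Lθp := Nat.cast_nonneg _
    have : (2 : ℝ) * P.Lθp ≤ 2 ^ 11 * mRp S.d ^ 2 * P.Vel * P.Lθp := by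
      have h4 : (2 : ℝ) ≤ 2 ^ 11 * mRp S.d ^ 2 * P.Vel := by nlinarith
      nlinarith
    exact_mod_cast this.trans h
  omega

/-- **The evaluation points are `≤ Xᵖ`**: `scale(J₀ᵖ,J) · s ≤ Xᵖ = 66 · 2^{d+1} L_θᵖ S₀ᵖ` for
`J ≤ J₀ᵖ` and `s ≤ 2^{d+1+J} S₀ᵖ`. [cite: Waldschmidt1980, §3.4 (p. 269)] -/
theorem scale_mul_le_Xptp' (P : PadicW80Par S.d) {J s : ℕ} (hJ : J ≤ P.J₀p)
    (hs : s ≤ 2 ^ (S.d + 1 + J) * P.S₀p) : ((scale P.J₀p J * s : ℕ) : ℝ) ≤ P.Xptp := by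
  have h1 : scale P.J₀p J * s ≤ 2 ^ (S.d + 1) * (2 * P.Lθp) * P.S₀p := by
    unfold scale
    calc 2 ^ (P.J₀p - J) * s ≤ 2 ^ (P.J₀p - J) * (2 ^ (S.d + 1 + J) * P.S₀p) := Nat.mul_le_mul_left _ hs
      _ = 2 ^ (S.d + 1) * 2 ^ P.J₀p * P.S₀p := by
          rw [show S.d + 1 + J = J + (S.d + 1) by ring, pow_add, ← Nat.mul_assoc, ← Nat.mul_assoc,
            ← pow_add, Nat.sub_add_cancel hJ]; ring
      _ ≤ 2 ^ (S.d + 1) * (2 * P.Lθp) * P.S₀p :=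
          Nat.mul_le_mul_right _ (Nat.mul_le_mul_left _ P.two_pow_le)
  have h2 : ((2 ^ (S.d + 1) * (2 * P.Lθp) * P.S₀p : ℕ) : ℝ) ≤ P.Xptp := by
    unfold PadicW80Par.Xptp; push_cast
    have : (0 : ℝ) ≤ 2 ^ (S.d + 1) * P.Lθp * P.S₀p := by positivity
    nlinarith
  exact le_trans (by exact_mod_cast h1) h2

/-- **`|qΔ| ≤ 𝔅`** at the `p`-adic depth: the rational values of the `Δ`-factors at the points
`x = 2^{J₀ᵖ−J} s ≤ Xᵖ`, `τ₀ ≤ T`. [cite: Waldschmidt1980, §3.4 (p. 269)] [cite: BakerTNT1975, Ch. 3 §2 Lemma 1] -/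
theorem abs_qΔ_le_p' (P : PadicW80Par S.d) {J : ℕ} (hJ : J ≤ P.J₀p) (u : Idx S.d P.hparp P.Lbp)
    {τ₀ s : ℕ} (hs : s ≤ 2 ^ (S.d + 1 + J) * P.S₀p) (hτ : τ₀ ≤ P.Tp) :
    |(S.qΔ (h := P.hparp) P.J₀p J u τ₀ s : ℝ)| ≤ P.𝔅p := by
  set x := scale P.J₀p J * s with hxdef
  have hxX : (x : ℝ) ≤ P.Xptp := S.scale_mul_le_Xptp' P hJ hs
  set a : ℕ := (u.1.1 : ℕ) with ha
  set b : ℕ := (u.1.2 : ℕ) with hb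
  have hR1 := P.one_le_hpar
  have hspec := (hdNat_spec (b := b) (le_of_lt u.1.1.isLt) x τ₀).2
  have hνpos : (0 : ℝ) < ((nuBound x P.hparp) ^ τ₀ : ℕ) := by exact_mod_cast Nat.pow_pos (nuBound_pos _ _)
  have h1 : |(S.qΔ (h := P.hparp) P.J₀p J u τ₀ s : ℝ)| ≤
      (τ₀.factorial : ℝ) * (scale P.J₀p J : ℝ) ^ τ₀ *
        (2 ^ (a + b * P.hparp) * ((x + a).choose a * (x + P.hparp).choose P.hparp ^ b : ℕ) : ℝ) := by
    unfold qΔ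
    rw [← hxdef]
    push_cast
    rw [abs_of_nonneg (by positivity), div_le_iff₀ (by push_cast at hνpos; exact_mod_cast hνpos)]
    have hE : ((hdNat (b := b) (le_of_lt u.1.1.isLt) x τ₀ : ℕ) : ℝ) ≤
        ((2 ^ (a + b * P.hparp) * nuBound x P.hparp ^ τ₀ *
          ((x + a).choose a * (x + P.hparp).choose P.hparp ^ b) : ℕ) : ℝ) := by
      exact_mod_cast hspec
    push_cast at hE ⊢
    have h0 : (0 : ℝ) ≤ (τ₀.factorial : ℝ) * (scale P.J₀p J : ℝ) ^ τ₀ := by positivity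
    calc (τ₀.factorial : ℝ) * (scale P.J₀p J : ℝ) ^ τ₀ * (hdNat (b := b) (le_of_lt u.1.1.isLt) x τ₀ : ℝ)
        ≤ (τ₀.factorial : ℝ) * (scale P.J₀p J : ℝ) ^ τ₀ *
          (2 ^ (a + b * P.hparp) * (nuBound x P.hparp : ℝ) ^ τ₀ *
            (((x + a).choose a : ℝ) * ((x + P.hparp).choose P.hparp : ℝ) ^ b)) :=
          mul_le_mul_of_nonneg_left hE h0
      _ = (τ₀.factorial : ℝ) * (scale P.J₀p J : ℝ) ^ τ₀ *
          (2 ^ (a + b * P.hparp) * (((x + a).choose a : ℝ) * ((x + P.hparp).choose P.hparp : ℝ) ^ b)) *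
            (nuBound x P.hparp : ℝ) ^ τ₀ := by
          ring
  -- the four factors, each `≤ exp(𝔘/256)`
  have hT1 : (1 : ℝ) ≤ P.Tp := by exact_mod_cast P.one_le_T
  have hf1 : (τ₀.factorial : ℝ) ≤ Real.exp (P.𝔘p / 256) := by
    have h2 : (τ₀.factorial : ℝ) ≤ (τ₀ : ℝ) ^ τ₀ := by exact_mod_cast Nat.factorial_le_pow τ₀
    have h3 : (τ₀ : ℝ) ^ τ₀ ≤ (P.Tp : ℝ) ^ τ₀ := pow_le_pow_left₀ (Nat.cast_nonneg _) (by exact_mod_cast hτ) _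
    exact h2.trans (h3.trans (P.T_pow_le_p hτ))
  have hf2 : (scale P.J₀p J : ℝ) ^ τ₀ ≤ Real.exp (P.𝔘p / 256) := by
    have h2 : (scale P.J₀p J : ℝ) ≤ P.Tp := by exact_mod_cast S.scale_le_T_p' P J
    exact (pow_le_pow_left₀ (Nat.cast_nonneg _) h2 _).trans (P.T_pow_le_p hτ)
  have hab : a + b * P.hparp ≤ P.hparp * P.Lbp := by
    have ha' : a < P.hparp := u.1.1.isLt
    have hb' : b < P.Lbp := u.1.2.isLt
    calc a + b * P.hparp ≤ P.hparp + b * P.hparp := by omega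
      _ = (b + 1) * P.hparp := by ring
      _ ≤ P.Lbp * P.hparp := Nat.mul_le_mul_right _ hb'
      _ = P.hparp * P.Lbp := Nat.mul_comm _ _
  have hf3 : (2 : ℝ) ^ (a + b * P.hparp) ≤ Real.exp (P.𝔘p / 256) :=
    (pow_le_pow_right₀ (by norm_num) hab).trans P.two_pow_hLb_le_p
  have hf4 : (((x + a).choose a * (x + P.hparp).choose P.hparp ^ b : ℕ) : ℝ) ≤ Real.exp (P.𝔘p / 256) := by
    have hC : ((x + a).choose a : ℝ) ≤ (x + P.hparp).choose P.hparp := by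
      have : (x + a).choose a ≤ (x + P.hparp).choose P.hparp := by
        have e1 : (x + a).choose a = (x + a).choose x := (Nat.choose_symm_add (a := x) (b := a)).symm
        have e2 : (x + P.hparp).choose P.hparp = (x + P.hparp).choose x :=
          (Nat.choose_symm_add (a := x) (b := P.hparp)).symm
        rw [e1, e2]
        exact Nat.choose_le_choose x (by have := u.1.1.isLt; omega)
      exact_mod_cast this
    have hCe := choose_le_exp_mul_div_pow (x := x) hR1
    have hbase : 1 ≤ Real.exp 1 * ((x : ℝ) + P.hparp) / P.hparp := by
      rw [le_div_iff₀ P.hpar_pos]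
      have := Real.exp_one_gt_two; have := Nat.cast_nonneg (α := ℝ) x
      nlinarith
    push_cast
    calc ((x + a).choose a : ℝ) * ((x + P.hparp).choose P.hparp : ℝ) ^ b
        ≤ ((x + P.hparp).choose P.hparp : ℝ) ^ (b + 1) := by
          rw [pow_succ]; nlinarith [pow_nonneg (Nat.cast_nonneg (α := ℝ) ((x + P.hparp).choose P.hparp)) b]
      _ ≤ ((Real.exp 1 * (x + P.hparp) / P.hparp) ^ P.hparp) ^ (b + 1) := pow_le_pow_left₀ (Nat.cast_nonneg _) hCe _
      _ = (Real.exp 1 * ((x : ℝ) + P.hparp) / P.hparp) ^ (P.hparp * (b + 1)) := by rw [← pow_mul]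
      _ ≤ (Real.exp 1 * ((x : ℝ) + P.hparp) / P.hparp) ^ (P.hparp * P.Lbp) := by
          refine pow_le_pow_right₀ hbase (Nat.mul_le_mul_left _ ?_)
          exact u.1.2.isLt
      _ ≤ Real.exp (P.𝔘p / 256) := P.ratio_pow_le_p hxX
  refine h1.trans ?_
  have hE := Real.exp_pos (P.𝔘p / 256)
  calc (τ₀.factorial : ℝ) * (scale P.J₀p J : ℝ) ^ τ₀ *
        (2 ^ (a + b * P.hparp) * ((x + a).choose a * (x + P.hparp).choose P.hparp ^ b : ℕ) : ℝ)
      ≤ Real.exp (P.𝔘p / 256) * Real.exp (P.𝔘p / 256) * (Real.exp (P.𝔘p / 256) * Real.exp (P.𝔘p / 256)) := by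
        refine mul_le_mul (mul_le_mul hf1 hf2 (by positivity) hE.le)
          (mul_le_mul hf3 hf4 (by positivity) hE.le) (by positivity) (by positivity)
    _ = Real.exp (P.𝔘p / 256) ^ 4 := by ring
    _ = P.𝔅p := P.exp_quarter_pow_four_p

/-! ### The number of unknowns -/

/-- **`#box_J ≤ 𝔅`** for the `p`-adic ranges: `#box_J ≤ h L_b ∏ (Lallᵖᵢ + 1) ≤ (2U)^{d+2}`.
[cite: Waldschmidt1980, §3.2 (p. 266)] -/
theorem card_box_le_𝔅_p' (P : PadicW80Par S.d) (J : ℕ) :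
    ((S.box (h := P.hparp) (Lb := P.Lbp) P.Lp P.Lθp J).card : ℝ) ≤ P.𝔅p := by
  rw [S.card_box]
  push_cast
  have hU := P.U_pos
  have hU1 : (1 : ℝ) ≤ P.Up := by
    have h2 := P.𝔘_ge'
    have h5 : P.𝔘p ≤ P.Up := by
      rw [P.U_eq]; have : (1 : ℝ) ≤ 2 ^ (S.d + 1) := one_le_pow₀ (by norm_num)
      nlinarith [P.𝔘_pos]
    linarith [show (1 : ℝ) ≤ 2 ^ 98 by norm_num]
  have hY : ∀ i, ((P.Lallp i / 2 ^ J : ℕ) : ℝ) + 1 ≤ 2 * P.Up := by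
    intro i
    have h1 : ((P.Lallp i / 2 ^ J : ℕ) : ℝ) ≤ P.Lallp i := by exact_mod_cast Nat.div_le_self _ _
    have h2 := P.Lallp_le_U i
    linarith
  have hhLb : (P.hparp : ℝ) * P.Lbp ≤ 2 * P.Up := by
    have h1 := P.hparLb_le; have h2 := P.Wstar_le_𝔘; have h3 := P.𝔘_pos
    have h5 : P.𝔘p ≤ P.Up := by
      rw [P.U_eq]; have : (1:ℝ) ≤ 2 ^ (S.d + 1) := one_le_pow₀ (by norm_num)
      nlinarith
    have : P.𝔘p / cLp + 3 * P.Wstarp ≤ 2 * P.𝔘p := by unfold cLp; nlinarith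
    linarith
  have hprod : (∏ j, (((P.Lp j / 2 ^ J : ℕ) : ℝ) + 1)) ≤ (2 * P.Up) ^ S.d := by
    calc (∏ j, (((P.Lp j / 2 ^ J : ℕ) : ℝ) + 1)) ≤ ∏ _j : Fin S.d, (2 * P.Up) :=
          prod_le_prod (fun j _ => by positivity) fun j _ => by simpa using hY (Fin.castSucc j)
      _ = (2 * P.Up) ^ S.d := by simp
  have hθ : (((P.Lθp / 2 ^ J : ℕ) : ℝ) + 1) ≤ 2 * P.Up := by simpa using hY (Fin.last S.d)
  have htot : (P.hparp : ℝ) * P.Lbp * ((∏ j, (((P.Lp j / 2 ^ J : ℕ) : ℝ) + 1)) * (((P.Lθp / 2 ^ J : ℕ) : ℝ) + 1)) ≤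
      (2 * P.Up) ^ (S.d + 2) := by
    calc (P.hparp : ℝ) * P.Lbp * ((∏ j, (((P.Lp j / 2 ^ J : ℕ) : ℝ) + 1)) * (((P.Lθp / 2 ^ J : ℕ) : ℝ) + 1))
        ≤ (2 * P.Up) * ((2 * P.Up) ^ S.d * (2 * P.Up)) := by
          refine mul_le_mul hhLb (mul_le_mul hprod hθ (by positivity) (by positivity)) (by positivity) (by positivity)
      _ = (2 * P.Up) ^ (S.d + 2) := by ring
  refine htot.trans (P.le_𝔅_of_log_le ?_)
  rw [Real.log_pow, Real.log_mul (by norm_num) hU.ne']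
  have hlog := P.log_U_le
  have hl2 : Real.log 2 ≤ 1 := by linarith [Real.log_two_lt_d9]
  have hmW := P.mW_le_𝔘_p; have hW := P.one_le_Wstar; have h𝔘 := P.𝔘_pos
  have hm : ((S.d + 2 : ℕ) : ℝ) ≤ 2 * mRp S.d := by
    have hd1 : (1 : ℝ) ≤ S.d := by exact_mod_cast P.hd
    unfold mRp; push_cast; linarith
  calc ((S.d + 2 : ℕ) : ℝ) * (Real.log 2 + Real.log P.Up) ≤ (2 * mRp S.d) * (1 + 10 * P.Wstarp) := by
        refine mul_le_mul hm (by linarith) ?_ (by have := PadicW80Par.mR_pos P; linarith)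
        have : 0 ≤ Real.log P.Up := Real.log_nonneg hU1
        have : 0 ≤ Real.log 2 := Real.log_nonneg one_le_two
        linarith
    _ ≤ (2 * mRp S.d) * (11 * P.Wstarp) := by
        refine mul_le_mul_of_nonneg_left (by linarith) (by have := PadicW80Par.mR_pos P; linarith)
    _ = 22 * (mRp S.d * P.Wstarp) := by ring
    _ ≤ P.𝔘p / 64 := by nlinarith

end Setup

end Literature.NumberTheory.Transcendental.CW77

end Part2

/-!
## Part 3 — port of `Summits/ABC/StewartYu/PadicW80SizesC.lean`

# Cell abc-stewartyu, WP-A4/J2: the archimedean sizes at the `p`-adic parameter record, III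

`Summits/ABC/StewartYu/PadicW80SizesC.lean` — continuation of `PadicW80Sizes(B).lean` (cell
`abc-stewartyu`, seat p3; theorems only): for `S : CW77.Setup` under `hy : S.SizeHyp P.Vs P.Vel P.Wb`
at p1's parameters,

* `abs_Dclear_qTerm_le_p'` — Siegel's coefficient bound `|D(s,τ)·qTerm₀(u,τ,s)| ≤ 𝔅⁴E(2)` on the
  box of level `0`, `s < S₀`, `|τ| < T` (`E(c) = exp(c·𝔘/(2c_L'))`);
* `abs_qTerm_le_p'` — the archimedean half of the `p`-adic Liouville step:
  `|qTerm_J(u,τ,s)| ≤ 𝔅²E(2^{k+1})` on the box of level `J ≤ J₀`, `|τ| ≤ T`, `s < 2^{k+1+J}S₀`;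
* `DclearJ_le_p'` (`D_J(s,τ) ≤ 𝔅²E(2^{k+1})`), `abs_rHalf_le_p'`, `Dhalf_le_p'` (`≤ 𝔅²E(2)` at the
  half points `s < 2^{J+1}S₀` of level `J < J₀`).

The proofs are those of `Waldschmidt1980SizesB.lean`.  Everything is [folklore] book-keeping on
[cite: Waldschmidt1980, Lemma 3.2 (pp. 266–267), §3.4 (3.21)–(3.22) (pp. 269–270)].
-/

section Part3

open _root_.Finset _root_.Real
open Literature.NumberTheory.Transcendental
open Literature.NumberTheory.Transcendental.Baker1975
open Literature.NumberTheory.Transcendental.Baker1975.Ch3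
open Literature.NumberTheory.Transcendental.CW77

namespace Literature.NumberTheory.Transcendental.CW77

namespace Setup

open Literature.NumberTheory.Transcendental.StewartYu
open Literature.NumberTheory.Transcendental.StewartYu.PadicW80Par (cLp' cTp cLp mRp)

variable {S : Setup} {P : PadicW80Par S.d} (hy : S.SizeHyp P.Vs P.Vel P.Wb)
include hy

/-- **The bound `Amax = 𝔅⁴ E(2)` of Siegel's step** at the `p`-adic parameters:
`|D(s,τ) · qTerm| ≤ 𝔅⁴ exp(2𝔘/(2c_L'))` on the box of level `0`, `s < S₀ᵖ`, `|τ| < T`.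
[cite: Waldschmidt1980, Lemma 3.2 (pp. 266–267)] -/
theorem SizeHyp.abs_Dclear_qTerm_le_p' {s : ℕ} (hs : s < P.S₀p) {τ : Tau S.d} (hτ : tauNorm τ < P.Tp)
    {u : Idx S.d P.hparp P.Lbp} (hu : u ∈ S.box (h := P.hparp) (Lb := P.Lbp) P.Lp P.Lθp 0) :
    |((S.Dclear (h := P.hparp) P.J₀p P.Lp P.Lθp s τ : ℕ) : ℝ) *
        (S.qTerm (h := P.hparp) P.J₀p 0 u τ s : ℝ)| ≤
      P.𝔅p ^ 4 * Real.exp (2 * (P.𝔘p / (2 * cLp'))) := by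
  have hτ1 : τ.1 ≤ P.Tp := by unfold tauNorm at hτ; omega
  have hτ2 : ∑ j, τ.2 j ≤ P.Tp := by unfold tauNorm at hτ; omega
  have hs' : s ≤ 2 ^ (S.d + 1 + 0) * P.S₀p := by
    have : P.S₀p ≤ 2 ^ (S.d + 1 + 0) * P.S₀p := Nat.le_mul_of_pos_left _ (Nat.pow_pos two_pos)
    omega
  have hs1 : s ≤ 2 ^ 0 * (1 * P.S₀p) := by simp; omega
  have hx : ((scale P.J₀p 0 * s : ℕ) : ℝ) ≤ P.Xptp := S.scale_mul_le_Xptp' P (Nat.zero_le _) hs'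
  have h𝔅 := P.𝔅_pos
  -- the denominator `≤ 𝔅² E₁`
  have hD : ((S.Dclear (h := P.hparp) P.J₀p P.Lp P.Lθp s τ : ℕ) : ℝ) ≤
      P.𝔅p ^ 2 * Real.exp (1 * (P.𝔘p / (2 * cLp'))) := by
    unfold Dclear
    rw [Nat.cast_mul, Nat.cast_mul]
    have h1 : ((nuBound (scale P.J₀p 0 * s) P.hparp ^ τ.1 : ℕ) : ℝ) ≤ P.𝔅p ^ 1 := by
      rw [Nat.cast_pow, pow_one]; exact P.nuBound_pow_le_𝔅_p hx hτ1
    have h2 : ((S.bθ.natAbs ^ (∑ j, τ.2 j) : ℕ) : ℝ) ≤ P.𝔅p ^ 1 := by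
      rw [pow_one]; exact hy.natAbs_bθ_pow_le_p' hτ2
    have h3 : (((∏ j, (S.α j).den ^ (P.Lp j * s)) * S.θ.den ^ (P.Lθp * s) : ℕ) : ℝ) ≤
        Real.exp (1 * (P.𝔘p / (2 * cLp'))) := by
      have key := hy.den_prod_le_p' (c := 1) (e := fun j => P.Lp j * s) (eθ := P.Lθp * s)
        (fun j => by rw [one_mul]; exact Nat.mul_le_mul_left _ hs.le)
        (by rw [one_mul]; exact Nat.mul_le_mul_left _ hs.le)
      push_cast at key ⊢
      exact key
    have h12 := P.mul_le_𝔅_pow_p h1 h2 (Nat.cast_nonneg _)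
    exact mul_le_mul h12 h3 (Nat.cast_nonneg _) (by positivity)
  -- the term `≤ 𝔅² E₁`
  have hQ : |(S.qTerm (h := P.hparp) P.J₀p 0 u τ s : ℝ)| ≤ P.𝔅p ^ 2 * Real.exp (1 * (P.𝔘p / (2 * cLp'))) := by
    unfold qTerm; push_cast
    rw [abs_mul, abs_mul]
    have h1 : |(S.qΔ (h := P.hparp) P.J₀p 0 u τ.1 s : ℝ)| ≤ P.𝔅p ^ 1 := by
      rw [pow_one]; exact S.abs_qΔ_le_p' P (Nat.zero_le _) u hs' hτ1
    have h2 : |(S.qA u τ.2 : ℝ)| ≤ P.𝔅p ^ 1 := by rw [pow_one]; exact hy.abs_qA_le_p' hu hτ2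
    have h3 : |(S.qE u s : ℝ)| ≤ Real.exp ((1 : ℕ) * (P.𝔘p / (2 * cLp'))) := hy.abs_qE_le_p' hu hs1
    rw [Nat.cast_one] at h3
    have h12 := P.mul_le_𝔅_pow_p h1 h2 (abs_nonneg _)
    exact mul_le_mul h12 h3 (abs_nonneg _) (by positivity)
  rw [abs_mul, Nat.abs_cast]
  calc ((S.Dclear (h := P.hparp) P.J₀p P.Lp P.Lθp s τ : ℕ) : ℝ) * |(S.qTerm (h := P.hparp) P.J₀p 0 u τ s : ℝ)|
      ≤ (P.𝔅p ^ 2 * Real.exp (1 * (P.𝔘p / (2 * cLp')))) * (P.𝔅p ^ 2 * Real.exp (1 * (P.𝔘p / (2 * cLp')))) :=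
        mul_le_mul hD hQ (abs_nonneg _) (by positivity)
    _ = P.𝔅p ^ 4 * Real.exp (2 * (P.𝔘p / (2 * cLp'))) := by
        rw [show (2 : ℝ) * (P.𝔘p / (2 * cLp')) = 1 * (P.𝔘p / (2 * cLp')) + 1 * (P.𝔘p / (2 * cLp')) by ring,
          Real.exp_add]; ring

/-- **`|qTerm_J(u,τ,s)| ≤ 𝔅² E(2^{k+1})`** — the archimedean size of one term of `φ_{J,τ}(s)` at an
integer point of the `k`-th inner step: box of level `J ≤ J₀ᵖ`, `|τ| ≤ T`, `s < 2^{k+1+J} S₀ᵖ`,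
`k ≤ d` (`|qΔ| ≤ 𝔅`, `|qA| ≤ 𝔅`, `|qE| ≤ E(2^{k+1})`).  This is the archimedean half of the
`p`-adic Liouville estimate (product formula). [cite: Waldschmidt1980, §3.4 (3.21) (p. 269)]
[cite: Yu1990, §3 (p. 40)] -/
theorem SizeHyp.abs_qTerm_le_p' {J k : ℕ} (hJ : J ≤ P.J₀p) (hk : k ≤ S.d) {u : Idx S.d P.hparp P.Lbp}
    (hu : u ∈ S.box (h := P.hparp) (Lb := P.Lbp) P.Lp P.Lθp J) {τ : Tau S.d} (hτ : tauNorm τ ≤ P.Tp)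
    {s : ℕ} (hs : s < 2 ^ (k + 1 + J) * P.S₀p) :
    |(S.qTerm (h := P.hparp) P.J₀p J u τ s : ℝ)| ≤
      P.𝔅p ^ 2 * Real.exp ((2 ^ (k + 1) : ℕ) * (P.𝔘p / (2 * cLp'))) := by
  have hτ1 : τ.1 ≤ P.Tp := by unfold tauNorm at hτ; omega
  have hτ2 : ∑ j, τ.2 j ≤ P.Tp := by unfold tauNorm at hτ; omega
  have hs' : s ≤ 2 ^ (S.d + 1 + J) * P.S₀p := by
    have : 2 ^ (k + 1 + J) * P.S₀p ≤ 2 ^ (S.d + 1 + J) * P.S₀p :=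
      Nat.mul_le_mul_right _ (Nat.pow_le_pow_right two_pos (by omega))
    omega
  have hs2 : s ≤ 2 ^ J * (2 ^ (k + 1) * P.S₀p) := by
    rw [← Nat.mul_assoc, ← pow_add, Nat.add_comm J (k + 1)]; exact hs.le
  unfold qTerm; push_cast
  rw [abs_mul, abs_mul]
  have h1 : |(S.qΔ (h := P.hparp) P.J₀p J u τ.1 s : ℝ)| ≤ P.𝔅p ^ 1 := by
    rw [pow_one]; exact S.abs_qΔ_le_p' P hJ u hs' hτ1
  have h2 : |(S.qA u τ.2 : ℝ)| ≤ P.𝔅p ^ 1 := by rw [pow_one]; exact hy.abs_qA_le_p' hu hτ2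
  have h3 : |(S.qE u s : ℝ)| ≤ Real.exp ((2 ^ (k + 1) : ℕ) * (P.𝔘p / (2 * cLp'))) := hy.abs_qE_le_p' hu hs2
  push_cast at h3
  have h12 := P.mul_le_𝔅_pow_p h1 h2 (abs_nonneg _)
  exact mul_le_mul h12 h3 (abs_nonneg _) (by positivity)

/-- **`D_J(s,τ) ≤ 𝔅² E(2^{k+1})`** at level `J ≤ J₀ᵖ` for the integer points `s < 2^{k+1+J} S₀ᵖ`
(`k ≤ d`), `|τ| ≤ T`. [cite: Waldschmidt1980, §3.4 (3.21) (p. 269)] -/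
theorem SizeHyp.DclearJ_le_p' {J k : ℕ} (hJ : J ≤ P.J₀p) (hk : k ≤ S.d) {τ : Tau S.d} (hτ : tauNorm τ ≤ P.Tp)
    {s : ℕ} (hs : s < 2 ^ (k + 1 + J) * P.S₀p) :
    ((S.DclearJ (h := P.hparp) P.J₀p J P.Lp P.Lθp s τ : ℕ) : ℝ) ≤
      P.𝔅p ^ 2 * Real.exp ((2 ^ (k + 1) : ℕ) * (P.𝔘p / (2 * cLp'))) := by
  have hτ1 : τ.1 ≤ P.Tp := by unfold tauNorm at hτ; omega
  have hτ2 : ∑ j, τ.2 j ≤ P.Tp := by unfold tauNorm at hτ; omega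
  have hs' : s ≤ 2 ^ (S.d + 1 + J) * P.S₀p := by
    have : 2 ^ (k + 1 + J) * P.S₀p ≤ 2 ^ (S.d + 1 + J) * P.S₀p :=
      Nat.mul_le_mul_right _ (Nat.pow_le_pow_right two_pos (by omega))
    omega
  have hx : ((scale P.J₀p J * s : ℕ) : ℝ) ≤ P.Xptp := S.scale_mul_le_Xptp' P hJ hs'
  unfold DclearJ
  rw [Nat.cast_mul, Nat.cast_mul]
  have h1 : ((nuBound (scale P.J₀p J * s) P.hparp ^ τ.1 : ℕ) : ℝ) ≤ P.𝔅p ^ 1 := by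
    rw [Nat.cast_pow, pow_one]; exact P.nuBound_pow_le_𝔅_p hx hτ1
  have h2 : ((S.bθ.natAbs ^ (∑ j, τ.2 j) : ℕ) : ℝ) ≤ P.𝔅p ^ 1 := by
    rw [pow_one]; exact hy.natAbs_bθ_pow_le_p' hτ2
  have hdiv : ∀ Lq : ℕ, Lq / 2 ^ J * s ≤ 2 ^ (k + 1) * Lq * P.S₀p := by
    intro Lq
    calc Lq / 2 ^ J * s ≤ (Lq / 2 ^ J) * (2 ^ (k + 1 + J) * P.S₀p) := Nat.mul_le_mul_left _ hs.le
      _ = 2 ^ (k + 1) * ((Lq / 2 ^ J) * 2 ^ J) * P.S₀p := by rw [pow_add]; ring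
      _ ≤ 2 ^ (k + 1) * Lq * P.S₀p := by
          have := Nat.div_mul_le_self Lq (2 ^ J)
          exact Nat.mul_le_mul_right _ (Nat.mul_le_mul_left _ this)
  have h3 : (((∏ j, (S.α j).den ^ (P.Lp j / 2 ^ J * s)) * S.θ.den ^ (P.Lθp / 2 ^ J * s) : ℕ) : ℝ) ≤
      Real.exp ((2 ^ (k + 1) : ℕ) * (P.𝔘p / (2 * cLp'))) :=
    hy.den_prod_le_p' (c := 2 ^ (k + 1)) (fun j => hdiv (P.Lp j)) (hdiv P.Lθp)
  have h12 := P.mul_le_𝔅_pow_p h1 h2 (Nat.cast_nonneg _)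
  exact mul_le_mul h12 h3 (Nat.cast_nonneg _) (by positivity)

/-- **`|rHalf| ≤ 𝔅² E(2)`** on the box of level `J < J₀ᵖ`, `|τ| ≤ T`, `s < 2^{J+1} S₀ᵖ`.
[cite: Waldschmidt1980, §3.4 (3.22) (p. 270)] -/
theorem SizeHyp.abs_rHalf_le_p' {J : ℕ} (hJ : J < P.J₀p) {u : Idx S.d P.hparp P.Lbp}
    (hu : u ∈ S.box (h := P.hparp) (Lb := P.Lbp) P.Lp P.Lθp J) {τ : Tau S.d} (hτ : tauNorm τ ≤ P.Tp)
    {s : ℕ} (hs : s < 2 ^ (J + 1) * P.S₀p) :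
    |(S.rHalf (h := P.hparp) P.J₀p J u τ s : ℝ)| ≤ P.𝔅p ^ 2 * Real.exp (2 * (P.𝔘p / (2 * cLp'))) := by
  have hτ1 : τ.1 ≤ P.Tp := by unfold tauNorm at hτ; omega
  have hτ2 : ∑ j, τ.2 j ≤ P.Tp := by unfold tauNorm at hτ; omega
  have hs' : s ≤ 2 ^ (S.d + 1 + (J + 1)) * P.S₀p := by
    have : 2 ^ (J + 1) * P.S₀p ≤ 2 ^ (S.d + 1 + (J + 1)) * P.S₀p :=
      Nat.mul_le_mul_right _ (Nat.pow_le_pow_right two_pos (by omega))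
    omega
  have hs2 : s ≤ 2 ^ J * (2 * P.S₀p) := by rw [← Nat.mul_assoc, ← pow_succ]; exact hs.le
  unfold rHalf; push_cast
  rw [abs_mul, abs_mul]
  have h1 : |(S.qΔ (h := P.hparp) P.J₀p (J + 1) u τ.1 s : ℝ)| ≤ P.𝔅p ^ 1 := by
    rw [pow_one]; exact S.abs_qΔ_le_p' P hJ u hs' hτ1
  have h2 : |(S.qA u τ.2 : ℝ)| ≤ P.𝔅p ^ 1 := by rw [pow_one]; exact hy.abs_qA_le_p' hu hτ2
  have h3 : |(S.qEh u s : ℝ)| ≤ Real.exp ((2 : ℕ) * (P.𝔘p / (2 * cLp'))) := hy.abs_qEh_le_p' hu hs2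
  rw [Nat.cast_ofNat] at h3
  have h12 := P.mul_le_𝔅_pow_p h1 h2 (abs_nonneg _)
  exact mul_le_mul h12 h3 (abs_nonneg _) (by positivity)

/-- **`Dhalf ≤ 𝔅² E(2)`** for `J < J₀ᵖ`, `|τ| ≤ T`, `s < 2^{J+1} S₀ᵖ`.
[cite: Waldschmidt1980, §3.4 (3.22) (p. 270)] -/
theorem SizeHyp.Dhalf_le_p' {J : ℕ} (hJ : J < P.J₀p) {τ : Tau S.d} (hτ : tauNorm τ ≤ P.Tp)
    {s : ℕ} (hs : s < 2 ^ (J + 1) * P.S₀p) :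
    ((S.Dhalf (h := P.hparp) P.J₀p J P.Lp P.Lθp s τ : ℕ) : ℝ) ≤
      P.𝔅p ^ 2 * Real.exp (2 * (P.𝔘p / (2 * cLp'))) := by
  have hτ1 : τ.1 ≤ P.Tp := by unfold tauNorm at hτ; omega
  have hτ2 : ∑ j, τ.2 j ≤ P.Tp := by unfold tauNorm at hτ; omega
  have hs' : s ≤ 2 ^ (S.d + 1 + (J + 1)) * P.S₀p := by
    have : 2 ^ (J + 1) * P.S₀p ≤ 2 ^ (S.d + 1 + (J + 1)) * P.S₀p :=
      Nat.mul_le_mul_right _ (Nat.pow_le_pow_right two_pos (by omega))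
    omega
  have hx : ((scale P.J₀p (J + 1) * s : ℕ) : ℝ) ≤ P.Xptp := S.scale_mul_le_Xptp' P hJ hs'
  unfold Dhalf
  rw [Nat.cast_mul, Nat.cast_mul]
  have h1 : ((nuBound (scale P.J₀p (J + 1) * s) P.hparp ^ τ.1 : ℕ) : ℝ) ≤ P.𝔅p ^ 1 := by
    rw [Nat.cast_pow, pow_one]; exact P.nuBound_pow_le_𝔅_p hx hτ1
  have h2 : ((S.bθ.natAbs ^ (∑ j, τ.2 j) : ℕ) : ℝ) ≤ P.𝔅p ^ 1 := by
    rw [pow_one]; exact hy.natAbs_bθ_pow_le_p' hτ2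
  have hdiv : ∀ Lq : ℕ, Lq / 2 ^ J * s ≤ 2 * Lq * P.S₀p := by
    intro Lq
    calc Lq / 2 ^ J * s ≤ (Lq / 2 ^ J) * (2 ^ (J + 1) * P.S₀p) := Nat.mul_le_mul_left _ hs.le
      _ = 2 * ((Lq / 2 ^ J) * 2 ^ J) * P.S₀p := by rw [pow_succ]; ring
      _ ≤ 2 * Lq * P.S₀p := by
          have := Nat.div_mul_le_self Lq (2 ^ J)
          exact Nat.mul_le_mul_right _ (Nat.mul_le_mul_left _ this)
  have h3 : (((∏ j, (S.α j).den ^ (P.Lp j / 2 ^ J * s)) * S.θ.den ^ (P.Lθp / 2 ^ J * s) : ℕ) : ℝ) ≤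
      Real.exp (2 * (P.𝔘p / (2 * cLp'))) := by
    have := hy.den_prod_le_p' (c := 2) (fun j => hdiv (P.Lp j)) (hdiv P.Lθp)
    push_cast at this ⊢
    exact this
  have h12 := P.mul_le_𝔅_pow_p h1 h2 (Nat.cast_nonneg _)
  exact mul_le_mul h12 h3 (Nat.cast_nonneg _) (by positivity)

end Setup

end Literature.NumberTheory.Transcendental.CW77

end Part3

/-!
## Part 4 — port of `Summits/ABC/StewartYu/PadicW80Budgets.lean`

# Cell abc-stewartyu, junction J2: the closed-form sizes of the `p`-adic machine and the two WP-A4 budgets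

`Summits/ABC/StewartYu/PadicW80Budgets.lean` — cell `abc-stewartyu` (HOME
`run/shared/lean/pub/abc-stewartyu/`, seat p3; closed-form definitions + theorems over p1's record
`PadicW80Par` only, no named fact).

Closed forms (`E(c) = exp(c·𝔘/(2c_L'))`, `𝔅 = e^{𝔘/64}`): `Efacp`, `PrVp = 2𝔅⁵E(2)`,
`DmaxK k = 𝔅²E(2^{k+1})`, `MmaxK k = 𝔅·PrV·DmaxK k`, `DmaxHp = 𝔅²E(2)`, `MmaxHp = 𝔅·PrV·DmaxHp`, with
their logarithms (`log_PrVp`, `log_DmaxK_mul_MmaxK`, `log_DmaxHp`, `log_MmaxHp`) and the two WP-A4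
BUDGETS `log(DmaxK·MmaxK) ≤ 𝔘/4 + 2ᵏ𝔘/16` (`logDM_le_budget`) and, for the half step,
`2^{d+1}·log(4·DmaxH²·MmaxH·Hprod³) − log DmaxH ≤ (7/16)·2ᵈ𝔘` (`bhalf_le_budget`, for
`1 ≤ Hprod ≤ exp(∑V + V_θ)`).

Everything is [folklore].
-/

section Part4

open _root_.Finset

namespace Literature.NumberTheory.Transcendental.StewartYu

namespace PadicW80Par

variable {d : ℕ} (P : PadicW80Par d)

/-! ### Closed forms -/

/-- The height unit `E(c) = exp(c · 𝔘/(2c_L'))`. [folklore]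
[cite: Waldschmidt1980, §3.5 (p. 274) (source FOLLOWED: the endgame budgets; the cell’s p-adic adaptation, NOT a printed statement)] -/
def Efacp (c : ℝ) : ℝ := Real.exp (c * (P.𝔘p / (2 * cLp')))

/-- The coefficient bound `PrV = 2 𝔅⁵ E(2)` (`≥ ⌈#box₀·𝔅⁴E(2)⌉`). [folklore]
[cite: Waldschmidt1980, §3.5 (p. 274) (source FOLLOWED: the endgame budgets; the cell’s p-adic adaptation, NOT a printed statement)] -/
def PrVp : ℝ := 2 * P.𝔅p ^ 5 * P.Efacp 2

/-- `Dmax_k = 𝔅² E(2^{k+1})` (the clearing denominators of the `k`-th inner step). [folklore]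
[cite: Waldschmidt1980, §3.5 (p. 274) (source FOLLOWED: the endgame budgets; the cell’s p-adic adaptation, NOT a printed statement)] -/
def DmaxK (k : ℕ) : ℝ := P.𝔅p ^ 2 * P.Efacp ((2 ^ (k + 1) : ℕ) : ℝ)

/-- `Mmax_k = 𝔅 · PrV · Dmax_k` (the archimedean size of the cores of the `k`-th inner step). [folklore]
[cite: Waldschmidt1980, §3.5 (p. 274) (source FOLLOWED: the endgame budgets; the cell’s p-adic adaptation, NOT a printed statement)] -/
def MmaxK (k : ℕ) : ℝ := P.𝔅p * P.PrVp * P.DmaxK k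

/-- `DmaxH = 𝔅² E(2)` (half points). [folklore]
[cite: Waldschmidt1980, §3.5 (p. 274) (source FOLLOWED: the endgame budgets; the cell’s p-adic adaptation, NOT a printed statement)] -/
def DmaxHp : ℝ := P.𝔅p ^ 2 * P.Efacp 2

/-- `MmaxH = 𝔅 · PrV · DmaxH` (half points). [folklore]
[cite: Waldschmidt1980, §3.5 (p. 274) (source FOLLOWED: the endgame budgets; the cell’s p-adic adaptation, NOT a printed statement)] -/
def MmaxHp : ℝ := P.𝔅p * P.PrVp * P.DmaxHp

/-- `0 < E(c)`. [folklore]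
[cite: Waldschmidt1980, §3.5 (p. 274) (source FOLLOWED: the endgame budgets; the cell’s p-adic adaptation, NOT a printed statement)] -/
theorem Efacp_pos (c : ℝ) : 0 < P.Efacp c := Real.exp_pos _

/-- `1 ≤ E(c)` for `c ≥ 0`. [folklore]
[cite: Waldschmidt1980, §3.5 (p. 274) (source FOLLOWED: the endgame budgets; the cell’s p-adic adaptation, NOT a printed statement)] -/
theorem one_le_Efacp {c : ℝ} (hc : 0 ≤ c) : 1 ≤ P.Efacp c := by
  unfold Efacp; exact Real.one_le_exp (by have := P.𝔘_pos; unfold cLp'; positivity)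

/-- `0 < DmaxK`. [folklore]
[cite: Waldschmidt1980, §3.5 (p. 274) (source FOLLOWED: the endgame budgets; the cell’s p-adic adaptation, NOT a printed statement)] -/
theorem DmaxK_pos (k : ℕ) : 0 < P.DmaxK k := by
  unfold DmaxK; have := P.𝔅_pos; have := P.Efacp_pos ((2 ^ (k + 1) : ℕ) : ℝ); positivity

/-- `1 ≤ PrV`. [folklore]
[cite: Waldschmidt1980, §3.5 (p. 274) (source FOLLOWED: the endgame budgets; the cell’s p-adic adaptation, NOT a printed statement)] -/
theorem one_le_PrVp : 1 ≤ P.PrVp := by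
  unfold PrVp
  have h1 : 1 ≤ P.𝔅p ^ 5 := one_le_pow₀ P.one_le_𝔅
  have h2 := P.one_le_Efacp (show (0 : ℝ) ≤ 2 by norm_num)
  nlinarith

/-- `0 < MmaxK`. [folklore]
[cite: Waldschmidt1980, §3.5 (p. 274) (source FOLLOWED: the endgame budgets; the cell’s p-adic adaptation, NOT a printed statement)] -/
theorem MmaxK_pos (k : ℕ) : 0 < P.MmaxK k := by
  unfold MmaxK; have := P.𝔅_pos; have := P.one_le_PrVp; have := P.DmaxK_pos k; positivity

/-- `1 ≤ DmaxH`. [folklore]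
[cite: Waldschmidt1980, §3.5 (p. 274) (source FOLLOWED: the endgame budgets; the cell’s p-adic adaptation, NOT a printed statement)] -/
theorem one_le_DmaxHp : 1 ≤ P.DmaxHp := by
  unfold DmaxHp
  exact one_le_mul_of_one_le_of_one_le (one_le_pow₀ P.one_le_𝔅) (P.one_le_Efacp (by norm_num))

/-- `1 ≤ MmaxH`. [folklore]
[cite: Waldschmidt1980, §3.5 (p. 274) (source FOLLOWED: the endgame budgets; the cell’s p-adic adaptation, NOT a printed statement)] -/
theorem one_le_MmaxHp : 1 ≤ P.MmaxHp := by
  unfold MmaxHp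
  exact one_le_mul_of_one_le_of_one_le (one_le_mul_of_one_le_of_one_le P.one_le_𝔅 P.one_le_PrVp)
    P.one_le_DmaxHp

/-- `log PrV = log 2 + 5·𝔘/64 + 2·𝔘/(2c_L')`. [folklore]
[cite: Waldschmidt1980, §3.5 (p. 274) (source FOLLOWED: the endgame budgets; the cell’s p-adic adaptation, NOT a printed statement)] -/
theorem log_PrVp : Real.log P.PrVp = Real.log 2 + 5 * (P.𝔘p / 64) + 2 * (P.𝔘p / (2 * cLp')) := by
  unfold PrVp Efacp 𝔅p
  rw [Real.log_mul (by positivity) (Real.exp_pos _).ne', Real.log_mul (by norm_num) (by positivity),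
    Real.log_pow, Real.log_exp, Real.log_exp]; push_cast; ring

/-- `log(Dmax_k · Mmax_k) = log 2 + 10·𝔘/64 + (2 + 2^{k+2})·𝔘/(2c_L')`. [folklore]
[cite: Waldschmidt1980, §3.5 (p. 274) (source FOLLOWED: the endgame budgets; the cell’s p-adic adaptation, NOT a printed statement)] -/
theorem log_DmaxK_mul_MmaxK (k : ℕ) : Real.log (P.DmaxK k * P.MmaxK k) =
    Real.log 2 + 10 * (P.𝔘p / 64) + (2 + (2 : ℝ) ^ (k + 2)) * (P.𝔘p / (2 * cLp')) := by
  have h𝔅 := P.𝔅_pos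
  have e : P.DmaxK k * P.MmaxK k = 2 * (P.𝔅p ^ 10 * (P.Efacp 2 * P.Efacp ((2 ^ (k + 1) : ℕ) : ℝ) ^ 2)) := by
    unfold MmaxK PrVp DmaxK; ring
  rw [e, Real.log_mul (by norm_num) (by have := P.Efacp_pos 2; have := P.Efacp_pos ((2 ^ (k + 1) : ℕ) : ℝ); positivity),
    Real.log_mul (by positivity) (by have := P.Efacp_pos 2; have := P.Efacp_pos ((2 ^ (k + 1) : ℕ) : ℝ); positivity),
    Real.log_mul (P.Efacp_pos 2).ne' (by have := P.Efacp_pos ((2 ^ (k + 1) : ℕ) : ℝ); positivity),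
    Real.log_pow, Real.log_pow]
  unfold Efacp 𝔅p
  rw [Real.log_exp, Real.log_exp, Real.log_exp]; push_cast; ring

/-- `log DmaxH = 2·𝔘/64 + 2·𝔘/(2c_L')`. [folklore]
[cite: Waldschmidt1980, §3.5 (p. 274) (source FOLLOWED: the endgame budgets; the cell’s p-adic adaptation, NOT a printed statement)] -/
theorem log_DmaxHp : Real.log P.DmaxHp = 2 * (P.𝔘p / 64) + 2 * (P.𝔘p / (2 * cLp')) := by
  unfold DmaxHp Efacp 𝔅p
  rw [Real.log_mul (by positivity) (Real.exp_pos _).ne', Real.log_pow, Real.log_exp, Real.log_exp]; ring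

/-- `log MmaxH = log 2 + 8·𝔘/64 + 4·𝔘/(2c_L')`. [folklore]
[cite: Waldschmidt1980, §3.5 (p. 274) (source FOLLOWED: the endgame budgets; the cell’s p-adic adaptation, NOT a printed statement)] -/
theorem log_MmaxHp : Real.log P.MmaxHp = Real.log 2 + 8 * (P.𝔘p / 64) + 4 * (P.𝔘p / (2 * cLp')) := by
  have h𝔅 := P.𝔅_pos
  have e : P.MmaxHp = 2 * (P.𝔅p ^ 8 * (P.Efacp 2 * P.Efacp 2)) := by unfold MmaxHp PrVp DmaxHp; ring
  rw [e, Real.log_mul (by norm_num) (by have := P.Efacp_pos 2; positivity),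
    Real.log_mul (by positivity) (by have := P.Efacp_pos 2; positivity),
    Real.log_mul (P.Efacp_pos 2).ne' (P.Efacp_pos 2).ne', Real.log_pow]
  unfold Efacp 𝔅p
  rw [Real.log_exp, Real.log_exp]; push_cast; ring

/-! ### The two WP-A4 budgets -/

/-- **Budget of the inner steps**: `log(Dmax_k · Mmax_k) ≤ 𝔘/4 + 2ᵏ𝔘/16`. [folklore]
[cite: Waldschmidt1980, §3.5 (p. 274) (source FOLLOWED: the endgame budgets; the cell’s p-adic adaptation, NOT a printed statement)] -/
theorem logDM_le_budget (k : ℕ) : Real.log (P.DmaxK k * P.MmaxK k) ≤ P.𝔘p / 4 + 2 ^ k * P.𝔘p / 16 := by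
  rw [P.log_DmaxK_mul_MmaxK]
  have hU := P.𝔘_ge'; have hl2 : Real.log 2 ≤ 1 := by linarith [Real.log_two_lt_d9]
  have h2k : (1 : ℝ) ≤ 2 ^ k := one_le_pow₀ (by norm_num)
  have e4 : (2 : ℝ) ^ (k + 2) = 4 * 2 ^ k := by rw [pow_add]; ring
  rw [e4]; unfold cLp'
  nlinarith [show (2 : ℝ) ^ 98 ≥ 2 ^ 20 by norm_num]

/-- **Budget of the half step**: with `∏H(allᵢ) ≤ exp(∑Vall)` (and `∑Vall ≤ 𝔘/2⁹⁰`),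
`2^{d+1}·log(4·DmaxH²·MmaxH·Hprod³) − log DmaxH ≤ (7/16)·2ᵈ·𝔘`. [folklore]
[cite: Waldschmidt1980, §3.5 (p. 274) (source FOLLOWED: the endgame budgets; the cell’s p-adic adaptation, NOT a printed statement)] -/
theorem bhalf_le_budget {Hprod : ℝ} (hH1 : 1 ≤ Hprod) (hH : Hprod ≤ Real.exp ((∑ j, P.Vs j) + P.Vel)) :
    (2 : ℝ) ^ (d + 1) * Real.log (4 * P.DmaxHp ^ 2 * P.MmaxHp * Hprod ^ 3) - Real.log P.DmaxHp ≤
      7 / 16 * (2 ^ d * P.𝔘p) := by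
  have hD1 := P.one_le_DmaxHp; have hM1 := P.one_le_MmaxHp
  have hlogD : 0 ≤ Real.log P.DmaxHp := Real.log_nonneg hD1
  have hlogH : Real.log Hprod ≤ (∑ j, P.Vs j) + P.Vel := by
    have := Real.log_le_log (by linarith) hH; rwa [Real.log_exp] at this
  have hlogH0 : 0 ≤ Real.log Hprod := Real.log_nonneg hH1
  have hsum := P.sumV_le_𝔘
  have e : Real.log (4 * P.DmaxHp ^ 2 * P.MmaxHp * Hprod ^ 3) =
      Real.log 4 + 2 * Real.log P.DmaxHp + Real.log P.MmaxHp + 3 * Real.log Hprod := by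
    rw [Real.log_mul (by positivity) (by positivity), Real.log_mul (by positivity) (by positivity),
      Real.log_mul (by norm_num) (by positivity), Real.log_pow, Real.log_pow]; push_cast; ring
  rw [e, P.log_MmaxHp]
  rw [P.log_DmaxHp] at hlogD ⊢
  have hl2 : Real.log 2 ≤ 1 := by linarith [Real.log_two_lt_d9]
  have hl4 : Real.log 4 ≤ 2 := by
    rw [show (4 : ℝ) = 2 ^ 2 by norm_num, Real.log_pow]; push_cast; linarith
  have hU := P.𝔘_ge'; have h2d : (1 : ℝ) ≤ 2 ^ d := one_le_pow₀ (by norm_num)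
  unfold cLp' at hlogD ⊢
  -- the bracket is `≤ 0.19·𝔘`, times `2^{d+1}` gives `0.38·2^d·𝔘 ≤ (7/16)·2^d·𝔘`
  have hbr : Real.log 4 + 2 * (2 * (P.𝔘p / 64) + 2 * (P.𝔘p / (2 * 2 ^ 12))) +
      (Real.log 2 + 8 * (P.𝔘p / 64) + 4 * (P.𝔘p / (2 * 2 ^ 12))) + 3 * Real.log Hprod ≤ 7 / 32 * P.𝔘p := by
    nlinarith [show (2 : ℝ) ^ 98 ≥ 2 ^ 95 by norm_num]
  have h2d0 : (0 : ℝ) ≤ 2 ^ (d + 1) := by positivity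
  calc (2 : ℝ) ^ (d + 1) * (Real.log 4 + 2 * (2 * (P.𝔘p / 64) + 2 * (P.𝔘p / (2 * 2 ^ 12))) +
        (Real.log 2 + 8 * (P.𝔘p / 64) + 4 * (P.𝔘p / (2 * 2 ^ 12))) + 3 * Real.log Hprod) -
        (2 * (P.𝔘p / 64) + 2 * (P.𝔘p / (2 * 2 ^ 12)))
      ≤ 2 ^ (d + 1) * (7 / 32 * P.𝔘p) - 0 := by
        gcongr
    _ = 7 / 16 * (2 ^ d * P.𝔘p) := by rw [pow_succ]; ring

end PadicW80Par

end Literature.NumberTheory.Transcendental.StewartYu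

end Part4

/-!
## Part 5 — port of `Summits/ABC/StewartYu/PadicW80ParE.lean`

# The `p`-adic Waldschmidt parameter record — part E (sequel of `PadicW80ParD`)

Support file (plain definitions and theorems; no named facts): continuation of the twin of
`Waldschmidt1980Params/ParamsB/Sizes/Numeric/Main` on the record `PadicW80Par`
(design, HOME/p1/WP-A4-table.md: `V_max` inside the logarithms `W⋆, G` and an ARBITRARY eliminated size
`1 ≤ V_el ≤ V_max` in `U` — p2's FLAG F-p2-3; `c_S = 2¹⁵` — the `p`-adic zeros-per-`𝔘` ratio; all names carry a
suffix `p` to keep them apart from the archimedean record `W80Par`). [cite: Waldschmidt1980, §3.2–3.5 (pp. 264–274)]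
-/

section Part5

open _root_.Finset _root_.Real
open Literature.NumberTheory.Transcendental Literature.NumberTheory.Transcendental.Waldschmidt1980

namespace Literature.NumberTheory.Transcendental.StewartYu

namespace PadicW80Par

variable {d : ℕ} (P : PadicW80Par d)

/-- `∑ⱼ ⌊Lⱼ/2^{J₀}⌋ ≤ 4 m V_θ` (real): `Lⱼ ≤ (2L_θ+2)V_θ`, `2^{J₀} > L_θ`. [folklore]
[cite: Waldschmidt1980, §3.5 (p. 274) (source FOLLOWED; the cell’s adaptation, NOT a printed statement)] -/
theorem sum_L_div_le : ((∑ j, P.Lp j / 2 ^ P.J₀p : ℕ) : ℝ) ≤ 4 * mRp d * P.Vel := by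
  have hLθ := P.Lθ_ge
  have hden := P.den_Lθ_pos
  have hL1 : (1 : ℝ) ≤ P.Lθp := by exact_mod_cast P.one_le_Lθ
  have hJ : (P.Lθp : ℝ) < (2 : ℝ) ^ P.J₀p := by exact_mod_cast P.Lθ_lt_two_pow
  have hVθ := P.one_le_Vθ
  have hj : ∀ j, ((P.Lp j / 2 ^ P.J₀p : ℕ) : ℝ) ≤ 4 * P.Vel := by
    intro j
    have h1 : ((P.Lp j / 2 ^ P.J₀p : ℕ) : ℝ) ≤ (P.Lp j : ℝ) / 2 ^ P.J₀p := by
      have := Nat.cast_div_le (α := ℝ) (m := P.Lp j) (n := 2 ^ P.J₀p); push_cast at this; exact this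
    have h0 : 0 < cLp' * mRp d * 2 ^ (d + 2) * (P.S₀p : ℝ) := by unfold cLp'; have := mR_pos P; have := P.S₀_pos; positivity
    have hVj := P.hV j
    have hU := P.U_pos
    have hLj : (P.Lp j : ℝ) ≤ P.Up / (cLp' * mRp d * 2 ^ (d + 2) * P.S₀p * P.Vs j) := by
      unfold Lp; exact Nat.floor_le (div_nonneg hU.le (by positivity))
    have h3 : P.Up / (cLp' * mRp d * 2 ^ (d + 2) * P.S₀p * P.Vs j) ≤ P.Up / (cLp' * mRp d * 2 ^ (d + 2) * P.S₀p * P.Vel) * P.Vel := by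
      have h3a : P.Up / (cLp' * mRp d * 2 ^ (d + 2) * P.S₀p * P.Vs j) ≤ P.Up / (cLp' * mRp d * 2 ^ (d + 2) * P.S₀p) :=
        div_le_div_of_nonneg_left hU.le h0 (le_mul_of_one_le_right h0.le hVj)
      have h3b : P.Up / (cLp' * mRp d * 2 ^ (d + 2) * P.S₀p) = P.Up / (cLp' * mRp d * 2 ^ (d + 2) * P.S₀p * P.Vel) * P.Vel := by
        field_simp
      rw [← h3b]; exact h3a
    have h5 : (P.Lp j : ℝ) ≤ (2 * P.Lθp + 2) * P.Vel := hLj.trans (h3.trans (by nlinarith))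
    have h6 : (P.Lp j : ℝ) / 2 ^ P.J₀p ≤ (2 * P.Lθp + 2) * P.Vel / P.Lθp := by
      calc (P.Lp j : ℝ) / 2 ^ P.J₀p ≤ (P.Lp j : ℝ) / P.Lθp := div_le_div_of_nonneg_left (Nat.cast_nonneg _) (by linarith) hJ.le
        _ ≤ (2 * P.Lθp + 2) * P.Vel / P.Lθp := div_le_div_of_nonneg_right h5 (by linarith)
    have h7 : (2 * P.Lθp + 2) * P.Vel / P.Lθp ≤ 4 * P.Vel := by
      rw [div_le_iff₀ (by linarith)]; nlinarith
    linarith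
  push_cast
  calc ∑ j, ((P.Lp j / 2 ^ P.J₀p : ℕ) : ℝ) ≤ ∑ _j : Fin d, 4 * P.Vel := sum_le_sum fun j _ => hj j
    _ = d * (4 * P.Vel) := by simp
    _ ≤ 4 * mRp d * P.Vel := by unfold mRp; nlinarith

/-- `T/2^{J₀} ≥ 2¹⁰ m² V_θ − 1` (real). [folklore]
[cite: Waldschmidt1980, §3.5 (p. 274) (source FOLLOWED; the cell’s adaptation, NOT a printed statement)] -/
theorem T_div_ge : (2 : ℝ) ^ 10 * mRp d ^ 2 * P.Vel - 1 ≤ ((P.Tp / 2 ^ P.J₀p : ℕ) : ℝ) := by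
  have h1 : (P.Tp : ℝ) / ((2 ^ P.J₀p : ℕ) : ℝ) - 1 ≤ ((P.Tp / 2 ^ P.J₀p : ℕ) : ℝ) := by
    have hb : 0 < 2 ^ P.J₀p := Nat.pow_pos two_pos
    have h := Nat.lt_div_mul_add hb (a := P.Tp)
    have hb' : (0 : ℝ) < ((2 ^ P.J₀p : ℕ) : ℝ) := by exact_mod_cast hb
    rw [div_sub_one hb'.ne', div_le_iff₀ hb']
    have : (P.Tp : ℝ) < (P.Tp / 2 ^ P.J₀p : ℕ) * ((2 ^ P.J₀p : ℕ) : ℝ) + ((2 ^ P.J₀p : ℕ) : ℝ) := by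
      exact_mod_cast h
    linarith
  push_cast at h1
  have h2 := P.T_ge_Lθ
  have h3 : ((2 : ℝ) ^ P.J₀p) ≤ 2 * P.Lθp := by exact_mod_cast P.two_pow_le
  have hL1 : (1 : ℝ) ≤ P.Lθp := by exact_mod_cast P.one_le_Lθ
  have h4 : (2 : ℝ) ^ 10 * mRp d ^ 2 * P.Vel ≤ (P.Tp : ℝ) / 2 ^ P.J₀p := by
    rw [le_div_iff₀ (by positivity)]
    calc (2 : ℝ) ^ 10 * mRp d ^ 2 * P.Vel * 2 ^ P.J₀p ≤ 2 ^ 10 * mRp d ^ 2 * P.Vel * (2 * P.Lθp) := by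
          have := P.one_le_Vθ; gcongr
      _ = 2 ^ 11 * mRp d ^ 2 * P.Vel * P.Lθp := by ring
      _ ≤ P.Tp := h2
  linarith

/-- **The numbers of the endgame**: `∑ⱼ ⌊Lⱼ/2^{J₀}⌋ + 1 ≤ ⌊T/2^{J₀}⌋` and
`h L_b < (⌊T/2^{J₀}⌋ − ∑ⱼ ⌊Lⱼ/2^{J₀}⌋) · #{odd s < 2^{J₀} S₀}` (the latter is `≥ m 𝔘/128`, the
former `≤ 𝔘/c_L + 3W⋆`). [cite: Waldschmidt1980, §3.5 (p. 274)] -/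
theorem endgame_numbers :
    (∑ j, P.Lp j / 2 ^ P.J₀p) + 1 ≤ P.Tp / 2 ^ P.J₀p ∧
      P.hparp * P.Lbp < (P.Tp / 2 ^ P.J₀p - ∑ j, P.Lp j / 2 ^ P.J₀p) * ((range (2 ^ P.J₀p * P.S₀p)).filter Odd).card := by
  have hsum := P.sum_L_div_le
  have hTd := P.T_div_ge
  have hm := two_le_mR P; have hm0 := mR_pos P; have hVθ := P.one_le_Vθ; have hW := P.one_le_Wstar
  have hU := P.𝔘_pos
  -- (1) the first claim, in the reals
  have h1real : ((∑ j, P.Lp j / 2 ^ P.J₀p : ℕ) : ℝ) + 1 ≤ ((P.Tp / 2 ^ P.J₀p : ℕ) : ℝ) := by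
    have : 4 * mRp d * P.Vel + 1 ≤ (2 : ℝ) ^ 10 * mRp d ^ 2 * P.Vel - 1 := by nlinarith
    linarith
  have h1 : (∑ j, P.Lp j / 2 ^ P.J₀p) + 1 ≤ P.Tp / 2 ^ P.J₀p := by exact_mod_cast h1real
  refine ⟨h1, ?_⟩
  -- (2) the second claim
  rw [P.card_odd_eq]
  have hsub : (((P.Tp / 2 ^ P.J₀p - ∑ j, P.Lp j / 2 ^ P.J₀p : ℕ)) : ℝ) = ((P.Tp / 2 ^ P.J₀p : ℕ) : ℝ) - ((∑ j, P.Lp j / 2 ^ P.J₀p : ℕ) : ℝ) := by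
    rw [Nat.cast_sub (by omega)]
  have hT' : (2 : ℝ) ^ 9 * mRp d ^ 2 * P.Vel ≤ ((P.Tp / 2 ^ P.J₀p - ∑ j, P.Lp j / 2 ^ P.J₀p : ℕ) : ℝ) := by
    rw [hsub]; nlinarith
  -- `#odd = 2^{J₀} ⌊c_S m W⋆⌋ ≥ Lθ (c_S m W⋆ − 1) ≥ Lθ c_S m W⋆ / 2`
  have hfl : cSp * mRp d * P.Wstarp - 1 ≤ (⌊cSp * mRp d * P.Wstarp⌋₊ : ℝ) := by
    have := Nat.lt_floor_add_one (cSp * mRp d * P.Wstarp); linarith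
  have hcS := P.cS_mul_ge
  have hJ : (P.Lθp : ℝ) ≤ (2 : ℝ) ^ P.J₀p := by exact_mod_cast P.Lθ_lt_two_pow.le
  have hodd : (P.Lθp : ℝ) * (cSp * mRp d * P.Wstarp / 2) ≤ ((2 ^ P.J₀p * ⌊cSp * mRp d * P.Wstarp⌋₊ : ℕ) : ℝ) := by
    push_cast
    have h2 : cSp * mRp d * P.Wstarp / 2 ≤ (⌊cSp * mRp d * P.Wstarp⌋₊ : ℝ) := by linarith
    exact mul_le_mul hJ h2 (by linarith) (by positivity)
  -- `Lθ Vθ ≥ 𝔘/(8 c_L' c_S m² W⋆)`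
  have hLθ := P.Lθ_ge
  have hS := P.S₀_le; have hS0 := P.S₀_pos
  have hLV : P.𝔘p / (8 * cLp' * cSp * mRp d ^ 2 * P.Wstarp) ≤ (P.Lθp : ℝ) * P.Vel := by
    have hden := P.den_Lθ_pos
    have e : P.Up / (cLp' * mRp d * 2 ^ (d + 2) * P.S₀p * P.Vel) / 2 = P.𝔘p / (4 * cLp' * mRp d * P.S₀p * P.Vel) := by
      rw [P.U_eq, pow_succ]; field_simp; ring
    rw [e] at hLθ
    have h2 : P.𝔘p / (8 * cLp' * cSp * mRp d ^ 2 * P.Wstarp) ≤ P.𝔘p / (4 * cLp' * mRp d * P.S₀p * P.Vel) * P.Vel := by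
      rw [div_mul_eq_mul_div, div_le_div_iff₀ (by unfold cLp' cSp; positivity) (by unfold cLp'; positivity)]
      -- `𝔘 (4 c_L' m S₀ Vθ) ≤ 𝔘 Vθ (8 c_L' c_S m² W⋆)` iff `S₀ ≤ 2 c_S m W⋆`
      have : 4 * cLp' * mRp d * (P.S₀p : ℝ) ≤ 8 * cLp' * cSp * mRp d ^ 2 * P.Wstarp := by unfold cLp' cSp at *; nlinarith
      have h0 : 0 ≤ P.𝔘p * P.Vel := by positivity
      nlinarith
    calc P.𝔘p / (8 * cLp' * cSp * mRp d ^ 2 * P.Wstarp) ≤ P.𝔘p / (4 * cLp' * mRp d * P.S₀p * P.Vel) * P.Vel := h2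
      _ ≤ (P.Lθp : ℝ) * P.Vel := mul_le_mul_of_nonneg_right hLθ (by linarith)
  -- assemble in the reals
  have hlhs := P.hparLb_le
  have hWU := P.Wstar_le_𝔘
  suffices key : (P.hparp : ℝ) * P.Lbp < ((P.Tp / 2 ^ P.J₀p - ∑ j, P.Lp j / 2 ^ P.J₀p : ℕ) : ℝ) * ((2 ^ P.J₀p * ⌊cSp * mRp d * P.Wstarp⌋₊ : ℕ) : ℝ) by
    exact_mod_cast key
  have hprod : (2 : ℝ) ^ 9 * mRp d ^ 2 * P.Vel * ((P.Lθp : ℝ) * (cSp * mRp d * P.Wstarp / 2)) ≤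
      ((P.Tp / 2 ^ P.J₀p - ∑ j, P.Lp j / 2 ^ P.J₀p : ℕ) : ℝ) * ((2 ^ P.J₀p * ⌊cSp * mRp d * P.Wstarp⌋₊ : ℕ) : ℝ) :=
    by
      have hc : (0 : ℝ) < cSp := by unfold cSp; norm_num
      have h0 : (0 : ℝ) ≤ cSp * mRp d * P.Wstarp / 2 := by positivity
      exact mul_le_mul hT' hodd (mul_nonneg (Nat.cast_nonneg _) h0) (Nat.cast_nonneg _)
  refine lt_of_lt_of_le ?_ hprod
  -- `2^9 m² Vθ Lθ c_S m W⋆/2 ≥ 2^8 c_S m³ W⋆ · 𝔘/(8 c_L' c_S m² W⋆) = 32 m 𝔘/c_L' ≥ 𝔘/64 > 𝔘/c_L + 3 W⋆`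
  have h32 : P.𝔘p / 64 ≤ (2 : ℝ) ^ 9 * mRp d ^ 2 * P.Vel * ((P.Lθp : ℝ) * (cSp * mRp d * P.Wstarp / 2)) := by
    have e : (2 : ℝ) ^ 9 * mRp d ^ 2 * P.Vel * ((P.Lθp : ℝ) * (cSp * mRp d * P.Wstarp / 2)) =
        (2 ^ 8 * cSp * mRp d ^ 3 * P.Wstarp) * ((P.Lθp : ℝ) * P.Vel) := by ring
    rw [e]
    have h0 : (0 : ℝ) ≤ 2 ^ 8 * cSp * mRp d ^ 3 * P.Wstarp := by unfold cSp; positivity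
    calc P.𝔘p / 64 ≤ (2 ^ 8 * cSp * mRp d ^ 3 * P.Wstarp) * (P.𝔘p / (8 * cLp' * cSp * mRp d ^ 2 * P.Wstarp)) := by
          unfold cLp' cSp
          rw [mul_div_assoc', le_div_iff₀ (by positivity)]
          have h0' : 0 ≤ mRp d ^ 2 * P.Wstarp * P.𝔘p := by positivity
          have h2m := mul_le_mul_of_nonneg_left hm h0'
          calc P.𝔘p / 64 * (8 * (2 : ℝ) ^ 12 * 2 ^ 15 * mRp d ^ 2 * P.Wstarp) = 2 ^ 24 * (mRp d ^ 2 * P.Wstarp * P.𝔘p) := by ring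
            _ ≤ 2 ^ 23 * (mRp d * (mRp d ^ 2 * P.Wstarp * P.𝔘p)) := by nlinarith
            _ = 2 ^ 8 * 2 ^ 15 * mRp d ^ 3 * P.Wstarp * P.𝔘p := by ring
      _ ≤ (2 ^ 8 * cSp * mRp d ^ 3 * P.Wstarp) * ((P.Lθp : ℝ) * P.Vel) := mul_le_mul_of_nonneg_left hLV h0
  have : P.𝔘p / cLp + 3 * P.Wstarp < P.𝔘p / 64 := by unfold cLp; nlinarith
  linarith

end PadicW80Par

end Literature.NumberTheory.Transcendental.StewartYu

end Part5

/-!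
## Part 6 — port of `Summits/ABC/StewartYu/PadicW80ParF.lean`

# The `p`-adic Waldschmidt parameter record — Siegel count (sequel of `PadicW80ParE`)

Support file (theorems only): `padic_siegel_count` — twice the number of Siegel equations at level
`0`, `2·#((range S₀) ×ˢ tauSet d T)`, is at most the number of unknowns `#box₀` for the record
`PadicW80Par` (`c_S = 2¹⁵`: exponent slack `33(d+1) − 31` bits). [cite: Waldschmidt1980, Lemma 3.2 (p. 266)]
-/

section Part6

open _root_.Finset _root_.Real
open Literature.NumberTheory.Transcendental Literature.NumberTheory.Transcendental.Waldschmidt1980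

namespace Literature.NumberTheory.Transcendental.StewartYu

namespace PadicW80Par

open Literature.NumberTheory.Transcendental.CW77 Literature.NumberTheory.Transcendental.CW77.Setup

/-- **The count of Lemma 3.2**: twice the number of equations `(s, τ)`, `s < S₀`, `|τ| < T`, is at
most the number of unknowns `#box₀ = h L_b ∏(Lallᵢ + 1)` — with the factorial of
`#tauSet ≤ (T+d)^{d+1}/(d+1)!` against the `m^{2m+1}/m!` of `U`.
[cite: Waldschmidt1980, Lemma 3.2 and (3.6) (pp. 264–267)] -/
theorem padic_siegel_count (S : CW77.Setup) (P : PadicW80Par S.d) :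
    2 * ((range P.S₀p) ×ˢ tauSet S.d P.Tp).card ≤ (S.box (h := P.hparp) (Lb := P.Lbp) P.Lp P.Lθp 0).card := by
  rw [S.card_box, card_product, card_range]
  simp only [pow_zero, Nat.div_one]
  -- pass to the reals
  have hprodL : (∏ j, (P.Lp j + 1)) * (P.Lθp + 1) = ∏ i, (P.Lallp i + 1) := by
    rw [Fin.prod_univ_castSucc]; simp
  rw [hprodL]
  suffices key : (2 : ℝ) * (P.S₀p * ((tauSet S.d P.Tp).card : ℝ)) ≤ P.hparp * P.Lbp * ∏ i, ((P.Lallp i : ℝ) + 1) by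
    exact_mod_cast key
  -- notation and basic facts
  have hm0 := mR_pos P; have hm2 := two_le_mR P
  have hW := P.one_le_Wstar; have hG := P.G_pos; have hU := P.U_pos; have h𝔘 := P.𝔘_pos
  have hS := P.S₀_pos; have hT := P.T_pos
  have em : ((S.d + 1 : ℕ) : ℝ) = mRp S.d := by unfold mRp; push_cast; ring
  -- (1) the count of `τ`
  have h1 : ((tauSet S.d P.Tp).card : ℝ) ≤ (2 * (P.Tp : ℝ)) ^ (S.d + 1) / (S.d + 1).factorial := by
    have h := Waldschmidt1980.card_tauSet_le_pow_div_factorial S.d P.Tp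
    have hTd : (P.Tp : ℝ) + S.d ≤ 2 * P.Tp := by
      -- `d ≤ T` from `T ≥ 2^{11} m² Vθ Lθ ≥ 2^{11} m²`
      have h2 := P.T_ge_Lθ
      have hL : (1 : ℝ) ≤ P.Lθp := by exact_mod_cast P.one_le_Lθ
      have hV := P.one_le_Vθ
      have hd : (S.d : ℝ) ≤ mRp S.d := by unfold mRp; linarith
      have : (S.d : ℝ) ≤ 2 ^ 11 * mRp S.d ^ 2 * P.Vel * P.Lθp := by
        have h3 : mRp S.d ≤ 2 ^ 11 * mRp S.d ^ 2 * P.Vel * P.Lθp := by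
          calc mRp S.d = 1 * (mRp S.d * 1) * 1 * 1 := by ring
            _ ≤ 2 ^ 11 * (mRp S.d * mRp S.d) * P.Vel * P.Lθp := by gcongr <;> linarith
            _ = 2 ^ 11 * mRp S.d ^ 2 * P.Vel * P.Lθp := by ring
        linarith
      linarith
    calc ((tauSet S.d P.Tp).card : ℝ) ≤ ((P.Tp : ℝ) + S.d) ^ (S.d + 1) / (S.d + 1).factorial := h
      _ ≤ (2 * (P.Tp : ℝ)) ^ (S.d + 1) / (S.d + 1).factorial := by gcongr
  -- (2) `T ≤ 𝔘/(c_T W⋆)`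
  have h2 : (P.Tp : ℝ) ≤ P.𝔘p / (cTp * P.Wstarp) := by
    have := P.T_le
    rw [P.U_eq] at this
    have e : 2 ^ (S.d + 1) * P.𝔘p / (cTp * 2 ^ (S.d + 1) * P.Wstarp) = P.𝔘p / (cTp * P.Wstarp) := by
      unfold cTp; field_simp
    rw [← e]; exact this
  -- (3) the lower bounds for the unknowns
  have h3 : P.𝔘p / (cLp * P.Gp) ≤ (P.hparp : ℝ) * P.Lbp := by
    have hh := P.hpar_pos
    have hLb : P.Up / (cLp * 2 ^ (S.d + 1) * P.Gp * P.hparp) ≤ (P.Lbp : ℝ) := by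
      unfold PadicW80Par.Lbp; push_cast; exact (Nat.lt_floor_add_one _).le
    have e : P.Up / (cLp * 2 ^ (S.d + 1) * P.Gp * P.hparp) = P.𝔘p / (cLp * P.Gp) / P.hparp := by
      rw [P.U_eq]; unfold cLp; field_simp
    rw [e, div_le_iff₀ hh] at hLb
    linarith
  have h4 : ∀ i, P.Up / (cLp' * mRp S.d * 2 ^ (S.d + 2) * P.S₀p * P.Vallp i) ≤ (P.Lallp i : ℝ) + 1 := by
    intro i
    refine Fin.lastCases ?_ (fun j => ?_) i
    · rw [P.Lall_last, P.Vall_last]; unfold PadicW80Par.Lθp; exact (Nat.lt_floor_add_one _).le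
    · rw [P.Lall_castSucc, P.Vall_castSucc]; unfold PadicW80Par.Lp; exact (Nat.lt_floor_add_one _).le
  set D : ℝ := cLp' * mRp S.d * 2 ^ (S.d + 2) * P.S₀p with hD
  have hD0 : 0 < D := by rw [hD]; unfold cLp'; positivity
  have h5 : P.Up ^ (S.d + 1) / (D ^ (S.d + 1) * ∏ i, P.Vallp i) ≤ ∏ i, ((P.Lallp i : ℝ) + 1) := by
    have e : P.Up ^ (S.d + 1) / (D ^ (S.d + 1) * ∏ i, P.Vallp i) = ∏ i, (P.Up / (D * P.Vallp i)) := by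
      rw [prod_div_distrib, prod_const, card_univ, Fintype.card_fin, prod_mul_distrib, prod_const, card_univ,
        Fintype.card_fin]
    rw [e]
    refine prod_le_prod (fun i _ => by have := P.Vall_pos i; positivity) fun i _ => ?_
    have := h4 i
    rwa [show cLp' * mRp S.d * 2 ^ (S.d + 2) * (P.S₀p : ℝ) * P.Vallp i = D * P.Vallp i by rw [hD]] at this
  -- (4) the numerical heart: `2 S₀ (2𝔘/(c_T W⋆))^m/m! ≤ (𝔘/(c_L G)) · U^m/(D^m ∏Vall)`
  have hVall : 0 < ∏ i, P.Vallp i := prod_pos fun i _ => P.Vall_pos i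
  have hfac : (0 : ℝ) < (S.d + 1).factorial := by exact_mod_cast Nat.factorial_pos _
  set A₁ : ℝ := 2 * P.S₀p * (2 * P.𝔘p) ^ (S.d + 1) with hA₁
  set B₁ : ℝ := (cTp * P.Wstarp) ^ (S.d + 1) * (S.d + 1).factorial with hB₁
  set A₂ : ℝ := P.𝔘p * P.Up ^ (S.d + 1) with hA₂
  set B₂ : ℝ := cLp * P.Gp * (D ^ (S.d + 1) * ∏ i, P.Vallp i) with hB₂
  have hB₁0 : 0 < B₁ := by rw [hB₁]; unfold cTp; positivity
  have hB₂0 : 0 < B₂ := by rw [hB₂]; unfold cLp; positivity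
  have eL : 2 * ((P.S₀p : ℝ) * ((2 * (P.𝔘p / (cTp * P.Wstarp))) ^ (S.d + 1) / (S.d + 1).factorial)) = A₁ / B₁ := by
    rw [hA₁, hB₁, show (2 : ℝ) * (P.𝔘p / (cTp * P.Wstarp)) = (2 * P.𝔘p) / (cTp * P.Wstarp) by ring, div_pow,
      div_div, mul_div_assoc, mul_assoc]
  have eR : (P.𝔘p / (cLp * P.Gp)) * (P.Up ^ (S.d + 1) / (D ^ (S.d + 1) * ∏ i, P.Vallp i)) = A₂ / B₂ := by
    rw [hA₂, hB₂, div_mul_div_comm]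
  have heart : A₁ / B₁ ≤ A₂ / B₂ := by
    rw [div_le_div_iff₀ hB₁0 hB₂0, hA₁, hB₁, hA₂, hB₂]
    -- `2 S₀ (2𝔘)^m · c_L G D^m ∏Vall ≤ 𝔘 U^m · (c_T W⋆)^m m!`
    rw [P.U_eq]
    have hprodV : (∏ i, P.Vallp i) = (∏ j, P.Vs j) * P.Vel := by rw [Fin.prod_univ_castSucc]; simp
    have h𝔘eq : P.𝔘p * ((S.d + 1).factorial : ℝ) * 2 ^ (S.d + 1) =
        PadicW80Par.Ap ^ (S.d + 1) * mRp S.d ^ (2 * S.d + 3) * ((∏ j, P.Vs j) * P.Vel) * P.Wstarp * P.Gp := by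
      unfold PadicW80Par.𝔘p PadicW80Par.Up; field_simp
    have hS₀ := P.S₀_le
    have hS0' : (0 : ℝ) ≤ P.S₀p := hS.le
    have LHS_le : 2 * (P.S₀p : ℝ) * (2 * P.𝔘p) ^ (S.d + 1) * (cLp * P.Gp * (D ^ (S.d + 1) * ∏ i, P.Vallp i)) ≤
        2 * (2 * (cSp * mRp S.d * P.Wstarp)) * (2 * P.𝔘p) ^ (S.d + 1) *
          (cLp * P.Gp * ((cLp' * mRp S.d * 2 ^ (S.d + 2) * (2 * (cSp * mRp S.d * P.Wstarp))) ^ (S.d + 1) * ∏ i, P.Vallp i)) := by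
      have hDle : D ≤ cLp' * mRp S.d * 2 ^ (S.d + 2) * (2 * (cSp * mRp S.d * P.Wstarp)) := by
        rw [hD]; unfold cLp'; gcongr
      have hcS : (0 : ℝ) < cSp := by unfold cSp; norm_num
      have hcL : (0 : ℝ) < cLp := by unfold cLp; norm_num
      have h0 : (0 : ℝ) ≤ 2 * (2 * (cSp * mRp S.d * P.Wstarp)) * (2 * P.𝔘p) ^ (S.d + 1) := by positivity
      gcongr
    refine LHS_le.trans ?_
    have e3 : ((2 : ℝ) ^ (S.d + 1)) ^ (S.d + 1) = (2 ^ (S.d + 1)) ^ S.d * 2 ^ (S.d + 1) := pow_succ _ _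
    have eRR : P.𝔘p * (2 ^ (S.d + 1) * P.𝔘p) ^ (S.d + 1) * ((cTp * P.Wstarp) ^ (S.d + 1) * (S.d + 1).factorial) =
        (P.𝔘p * ((S.d + 1).factorial : ℝ) * 2 ^ (S.d + 1)) * (2 ^ (S.d + 1)) ^ S.d * P.𝔘p ^ (S.d + 1) * cTp ^ (S.d + 1) *
          P.Wstarp ^ (S.d + 1) := by
      rw [mul_pow, mul_pow, e3]; ring
    rw [eRR, h𝔘eq, hprodV]
    unfold cSp cLp cLp' cTp
    set M : ℝ := mRp S.d ^ (2 * S.d + 3) * ((∏ j, P.Vs j) * P.Vel) * P.Wstarp * P.Gp * P.𝔘p ^ (S.d + 1) * P.Wstarp ^ (S.d + 1)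
      with hM
    have key : (2 : ℝ) * (2 * (2 ^ 15 * mRp S.d * P.Wstarp)) * (2 * P.𝔘p) ^ (S.d + 1) *
        (2 ^ 14 * P.Gp * ((2 ^ 12 * mRp S.d * 2 ^ (S.d + 2) * (2 * (2 ^ 15 * mRp S.d * P.Wstarp))) ^ (S.d + 1) * ((∏ j, P.Vs j) * P.Vel)))
        = ((2 : ℝ) ^ 1 * 2 ^ 1 * 2 ^ 15 * 2 ^ 14 * 2 ^ (S.d + 1) * (2 ^ 12 * 2 ^ (S.d + 2) * 2 ^ 1 * 2 ^ 15) ^ (S.d + 1)) * M := by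
      rw [hM]
      have e1 : mRp S.d ^ (2 * S.d + 3) = mRp S.d * (mRp S.d * mRp S.d) ^ (S.d + 1) := by ring
      rw [e1]; ring
    rw [key]
    have key2 : PadicW80Par.Ap ^ (S.d + 1) * mRp S.d ^ (2 * S.d + 3) * ((∏ j, P.Vs j) * P.Vel) * P.Wstarp * P.Gp *
        (2 ^ (S.d + 1)) ^ S.d * P.𝔘p ^ (S.d + 1) * (2 ^ 14) ^ (S.d + 1) * P.Wstarp ^ (S.d + 1)
        = (PadicW80Par.Ap ^ (S.d + 1) * ((2 : ℝ) ^ (S.d + 1)) ^ S.d * (2 ^ 14) ^ (S.d + 1)) * M := by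
      rw [hM]; ring
    rw [key2]
    have hVV : 0 ≤ (∏ j, P.Vs j) * P.Vel := by rw [← hprodV]; exact hVall.le
    have hM0 : 0 ≤ M := by rw [hM]; positivity
    refine mul_le_mul_of_nonneg_right ?_ hM0
    -- constants: `2^{30+d} · 2^{(28+d)(d+1)} ≤ 2^{50(d+1)} · 2^{(d+1)d} · 2^{14(d+1)}`
    rw [show PadicW80Par.Ap = (2 : ℝ) ^ 50 from rfl]
    have hexp : 1 + 1 + 15 + 14 + (S.d + 1) + (12 + (S.d + 2) + 1 + 15) * (S.d + 1) ≤
        50 * (S.d + 1) + (S.d + 1) * S.d + 14 * (S.d + 1) := by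
      have e : (12 + (S.d + 2) + 1 + 15) * (S.d + 1) = 30 * (S.d + 1) + (S.d + 1) * S.d := by ring
      rw [e]
      generalize (S.d + 1) * S.d = q
      omega
    calc (2 : ℝ) ^ 1 * 2 ^ 1 * 2 ^ 15 * 2 ^ 14 * 2 ^ (S.d + 1) * (2 ^ 12 * 2 ^ (S.d + 2) * 2 ^ 1 * 2 ^ 15) ^ (S.d + 1)
        = 2 ^ (1 + 1 + 15 + 14 + (S.d + 1) + (12 + (S.d + 2) + 1 + 15) * (S.d + 1)) := by
          simp only [← pow_mul, ← pow_add]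
      _ ≤ 2 ^ (50 * (S.d + 1) + (S.d + 1) * S.d + 14 * (S.d + 1)) := pow_le_pow_right₀ (by norm_num) hexp
      _ = (2 ^ 50) ^ (S.d + 1) * (2 ^ (S.d + 1)) ^ S.d * (2 ^ 14) ^ (S.d + 1) := by
          simp only [← pow_mul, ← pow_add]
  -- (5) combine
  calc (2 : ℝ) * (P.S₀p * ((tauSet S.d P.Tp).card : ℝ))
      ≤ 2 * (P.S₀p * ((2 * (P.Tp : ℝ)) ^ (S.d + 1) / (S.d + 1).factorial)) := by gcongr
    _ ≤ 2 * (P.S₀p * ((2 * (P.𝔘p / (cTp * P.Wstarp))) ^ (S.d + 1) / (S.d + 1).factorial)) := by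
        gcongr
    _ = A₁ / B₁ := eL
    _ ≤ A₂ / B₂ := heart
    _ = (P.𝔘p / (cLp * P.Gp)) * (P.Up ^ (S.d + 1) / (D ^ (S.d + 1) * ∏ i, P.Vallp i)) := eR.symm
    _ ≤ (P.hparp * P.Lbp) * ∏ i, ((P.Lallp i : ℝ) + 1) := by
        refine mul_le_mul h3 h5 (by positivity) (by positivity)
    _ = P.hparp * P.Lbp * ∏ i, ((P.Lallp i : ℝ) + 1) := by ring

variable {d : ℕ} (P : PadicW80Par d)

/-! ### Two small inputs of the parameter pack: `log p ≤ U` and the rooms -/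

/-- `log p ≤ U` from the height floor `log p ≤ V_θ` (`U ≥ V_θ`, all other factors `≥ 1`).
[cite: Waldschmidt1980, §3.2 (p. 264)] -/
theorem log_p_le_U {p : ℕ} (hpV : Real.log p ≤ P.Vel) : Real.log p ≤ P.Up := by
  have h := P.U_div_ge
  have hG := P.one_le_G; have hW := P.one_le_Wstar; have hV := P.one_le_prodV; have hVθ := P.one_le_Vθ
  have hU := P.U_pos
  have h2 : (1 : ℝ) ≤ 2 ^ (49 * (d + 1)) := one_le_pow₀ (by norm_num)
  have h3 : P.Vel ≤ 2 ^ (49 * (d + 1)) * P.Gp * ((∏ j, P.Vs j) * P.Vel) * P.Wstarp := by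
    calc P.Vel = 1 * 1 * (1 * P.Vel) * 1 := by ring
      _ ≤ 2 ^ (49 * (d + 1)) * P.Gp * ((∏ j, P.Vs j) * P.Vel) * P.Wstarp := by
          gcongr
  have h4 : P.Up / 2 ^ (d + 1) ≤ P.Up := div_le_self hU.le (one_le_pow₀ (by norm_num))
  linarith

/-- Room for the inner chain AND the half step: `2(d+1)·t_J ≤ T/2^J` (`t_J = ⌊(T/2^J)/(2m)⌋`),
hence `(d+1)·t_J ≤ T/2^J` and `T/2^{J+1} + t_J ≤ T/2^J − d·t_J`… in the form p3's J3 uses: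
`T/2^(J+1) + (d+1)·t_J ≤ T/2^J`. [cite: Waldschmidt1980, Lemma 3.6 (p. 272)] -/
theorem room_half (J : ℕ) : P.Tp / 2 ^ (J + 1) + (d + 1) * P.tJp J ≤ P.Tp / 2 ^ J := by
  have h : 2 * ((d + 1) * P.tJp J) ≤ P.Tp / 2 ^ J := by
    have := P.tJ_mul_le J; rwa [mul_assoc] at this
  have h2 : P.Tp / 2 ^ (J + 1) = P.Tp / 2 ^ J / 2 := by
    rw [pow_succ, Nat.div_div_eq_div_mul]
  rw [h2]
  omega

end PadicW80Par

end Literature.NumberTheory.Transcendental.StewartYu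

end Part6

/-!
## Part 7 — port of `Summits/ABC/StewartYu/DescentSizesQ.lean`

# Cell abc-stewartyu, WP-A3 (viii): the archimedean SIZE estimates of Waldschmidt 1980 for the
# signed set-up, imported through the flattening `S♭`

`Summits/ABC/StewartYu/DescentSizesQ.lean` — cell `abc-stewartyu` (HOME
`run/shared/lean/pub/abc-stewartyu/`, seat p3; rows "W80Sizes/W80SizesB (class H)" of
`HOME/plan/PORT-MAP.md`; theorems only, no named fact), sequel to `DescentSetupQ.lean`.

The `p`-adic proof needs the SIZES (archimedean absolute values, as heights) and DENOMINATORS of the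
algebraic numbers it evaluates — exactly the content of the tree's `Waldschmidt1980Sizes*.lean`,
which is stated for `S : CW77.Setup` under `hy : S.W80Hyp P` (`P : W80Par S.d` Waldschmidt's
parameters).  Since the signed cores of `Q : SetupQ` have the same absolute values and denominators
as those of `Q.flat` (`SetupQ.abs_qTerm`, `abs_rHalf`, …), nothing is re-proved here:

* `hgt_abs`, `abs_log_abs_le_log_hgt` — `H(|q|) = H(q)` and `|log |q|| ≤ log H(q)` (`q ≠ 0`);
* `flat_W80Hyp` — **the hypothesis structure `W80Hyp` for `Q.flat`** from the sign-free data
  `log H(αⱼ) ≤ Vⱼ`, `log H(θ) ≤ V_θ`, `|bⱼ|, |b_θ| ≤ e^W` (for positive rationals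
  `|log α| ≤ log H(α)` is automatic, so the `p`-adic hypothesis list has NO `|log αⱼ| ≤ Vⱼ` clause);
* the signed corollaries used by Siegel's lemma and by the two Liouville steps:
  `abs_Dclear_qTerm_le` (`|Dclear♭ · qTerm| ≤ 𝔅⁴ E(2)`), `abs_rHalf_le` (`|rHalf| ≤ 𝔅² E(2)`),
  `sum_abs_classVec_le_card` (`∑|classVec| ≤ #box · Pr · Rmax`), `heightProd_all_le`
  (`∏ H(allᵢ) ≤ exp(∑ Vallᵢ)`).

Everything is [folklore].
-/

section Part7

open _root_.Finset
open Literature.NumberTheory.Transcendental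
open Literature.NumberTheory.Transcendental.CW77
open Literature.NumberTheory.Transcendental.CW77.Setup (Idx Tau tauNorm scale tauSet)
open Literature.NumberTheory.Transcendental.Waldschmidt1980 (W80Par)
open Literature.NumberTheory.Transcendental.Waldschmidt1980.W80Par (cL')

namespace Literature.NumberTheory.Transcendental.StewartYu

namespace SetupQ

/-! ### Heights do not see signs -/

/-- `H(|q|) = H(q)`. [folklore]
[cite: Waldschmidt1980, §3.3 (source FOLLOWED; sizes of the cell’s signed cores, NOT a printed statement)] -/
theorem hgt_abs (q : ℚ) : hgt |q| = hgt q := by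
  unfold hgt
  rw [Rat.num_abs_eq_abs_num, Rat.den_abs_eq_den, Int.natAbs_abs]

/-- `|log |q|| ≤ log H(q)` for a non-zero rational `q` (`|q| = |num|/den` with
`1 ≤ |num|, den ≤ H(q)`). [folklore]
[cite: Waldschmidt1980, §3.3 (source FOLLOWED; sizes of the cell’s signed cores, NOT a printed statement)] -/
theorem abs_log_abs_le_log_hgt {q : ℚ} (hq : q ≠ 0) : |Real.log (|(q : ℝ)|)| ≤ Real.log (hgt q) := by
  have hnum : (1 : ℝ) ≤ (q.num.natAbs : ℝ) := by
    exact_mod_cast Nat.one_le_iff_ne_zero.mpr (Int.natAbs_ne_zero.mpr (Rat.num_ne_zero.mpr hq))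
  have hden : (1 : ℝ) ≤ (q.den : ℝ) := by exact_mod_cast q.den_pos
  have hH1 : (q.num.natAbs : ℝ) ≤ hgt q := by
    unfold hgt; exact_mod_cast le_max_left _ _
  have hH2 : (q.den : ℝ) ≤ hgt q := by
    unfold hgt; exact_mod_cast le_max_right _ _
  have habs : |(q : ℝ)| = (q.num.natAbs : ℝ) / q.den := by
    have h1 : ((q.num.natAbs : ℕ) : ℝ) = |(q.num : ℝ)| := by
      rw [← Int.cast_natCast, Int.natCast_natAbs, Int.cast_abs]
    rw [h1, Rat.cast_def, abs_div, Nat.abs_cast]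
  rw [habs, Real.log_div (by positivity) (by positivity), abs_le]
  constructor
  · have h1 : 0 ≤ Real.log (q.num.natAbs : ℝ) := Real.log_nonneg hnum
    have h2 : Real.log (q.den : ℝ) ≤ Real.log (hgt q) := Real.log_le_log (by positivity) hH2
    linarith
  · have h1 : 0 ≤ Real.log (q.den : ℝ) := Real.log_nonneg hden
    have h2 : Real.log (q.num.natAbs : ℝ) ≤ Real.log (hgt q) := Real.log_le_log (by positivity) hH1
    linarith

variable (Q : SetupQ) {h Lb : ℕ}

/-- `H(all♭ᵢ) = H(allᵢ)`, hence `∏ H(all♭ᵢ) = ∏ H(allᵢ)`. [folklore]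
[cite: Waldschmidt1980, §3.3 (source FOLLOWED; sizes of the cell’s signed cores, NOT a printed statement)] -/
theorem heightProd_flat_all : heightProd Q.flat.all = heightProd Q.all := by
  unfold heightProd
  exact prod_congr rfl fun i _ => by rw [Q.flat_all, hgt_abs]

/-! ### `W80Hyp` for the flattening from sign-free height data -/

/-- **Waldschmidt's hypothesis structure for `Q.flat`** from the sign-free data: heights
`log H(αⱼ) ≤ Vⱼ`, `log H(θ) ≤ V_θ` and coefficients `|bⱼ|, |b_θ| ≤ e^W`. [folklore]
[cite: Waldschmidt1980, §3.3 (source FOLLOWED; sizes of the cell’s signed cores, NOT a printed statement)] -/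
theorem flat_W80Hyp (P : W80Par Q.d) (hH : ∀ j, Real.log (hgt (Q.α j)) ≤ P.V j)
    (hHθ : Real.log (hgt Q.θ) ≤ P.Vθ) (hb : ∀ j, |(Q.b j : ℝ)| ≤ Real.exp P.W)
    (hbθ : |(Q.bθ : ℝ)| ≤ Real.exp P.W) : Q.flat.W80Hyp P where
  hH := fun j => by
    show Real.log (hgt |Q.α j|) ≤ P.V j
    rw [hgt_abs]; exact hH j
  hl := fun j => by
    show |Real.log ((|Q.α j| : ℚ) : ℝ)| ≤ P.V j
    rw [Rat.cast_abs]
    exact (abs_log_abs_le_log_hgt (Q.α_ne j)).trans (hH j)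
  hHθ := by
    show Real.log (hgt |Q.θ|) ≤ P.Vθ
    rw [hgt_abs]; exact hHθ
  hlθ := by
    show |Real.log ((|Q.θ| : ℚ) : ℝ)| ≤ P.Vθ
    rw [Rat.cast_abs]
    exact (abs_log_abs_le_log_hgt Q.θ_ne).trans hHθ
  hb := hb
  hbθ := hbθ

/-! ### The signed corollaries -/

variable {Q}
variable {P : W80Par Q.d} (hy : Q.flat.W80Hyp P)
include hy

/-- **`|Dclear♭(s,τ) · qTerm_{0}(u,τ,s)| ≤ 𝔅⁴ E(2)`** for the SIGNED core on the box of level `0`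
(`s < S₀`, `|τ| < T`): the coefficient bound `Amax` of `SetupQ.siegel_step`. [folklore]
[cite: Waldschmidt1980, §3.3 (source FOLLOWED; sizes of the cell’s signed cores, NOT a printed statement)] -/
theorem abs_Dclear_qTerm_le {s : ℕ} (hs : s < P.S₀) {τ : Tau Q.d} (hτ : tauNorm τ < P.T)
    {u : Idx Q.d P.hpar P.Lb} (hu : u ∈ Q.flat.box (h := P.hpar) (Lb := P.Lb) P.L P.Lθ 0) :
    |((Q.flat.Dclear (h := P.hpar) P.J₀ P.L P.Lθ s τ : ℕ) : ℝ) * (Q.qTerm (h := P.hpar) P.J₀ 0 u τ s : ℝ)| ≤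
      P.𝔅 ^ 4 * Real.exp (2 * (P.𝔘 / (2 * cL'))) := by
  have h1 := hy.abs_Dclear_qTerm_le hs hτ hu
  rw [abs_mul] at h1 ⊢
  have h2 : |(Q.qTerm (h := P.hpar) P.J₀ 0 u τ s : ℝ)| = |(Q.flat.qTerm (h := P.hpar) P.J₀ 0 u τ s : ℝ)| := by
    rw [← Rat.cast_abs, ← Rat.cast_abs, Q.abs_qTerm]
  rwa [h2]

/-- **`|rHalf_{J}(u,τ,s)| ≤ 𝔅² E(2)`** for the SIGNED half-point coefficient (`J < J₀`, `u` in the box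
of level `J`, `|τ| ≤ T`, `s < 2^{J+1} S₀`). [folklore]
[cite: Waldschmidt1980, §3.3 (source FOLLOWED; sizes of the cell’s signed cores, NOT a printed statement)] -/
theorem abs_rHalf_le {J : ℕ} (hJ : J < P.J₀) {u : Idx Q.d P.hpar P.Lb}
    (hu : u ∈ Q.flat.box (h := P.hpar) (Lb := P.Lb) P.L P.Lθ J) {τ : Tau Q.d} (hτ : tauNorm τ ≤ P.T)
    {s : ℕ} (hs : s < 2 ^ (J + 1) * P.S₀) :
    |(Q.rHalf (h := P.hpar) P.J₀ J u τ s : ℝ)| ≤ P.𝔅 ^ 2 * Real.exp (2 * (P.𝔘 / (2 * cL'))) := by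
  have h1 := hy.abs_rHalf_le hJ hu hτ hs
  have h2 : |(Q.rHalf (h := P.hpar) P.J₀ J u τ s : ℝ)| = |(Q.flat.rHalf (h := P.hpar) P.J₀ J u τ s : ℝ)| := by
    rw [← Rat.cast_abs, ← Rat.cast_abs, Q.abs_rHalf]
  rwa [h2]

/-- `∏ᵢ H(allᵢ) ≤ exp(∑ᵢ Vallᵢ)` for the signed generators. [folklore]
[cite: Waldschmidt1980, §3.3 (source FOLLOWED; sizes of the cell’s signed cores, NOT a printed statement)] -/
theorem heightProd_all_le : heightProd Q.all ≤ Real.exp (∑ i, P.Vall i) := by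
  rw [← Q.heightProd_flat_all]; exact hy.heightProd_le

omit hy in
/-- `∑_{T'} |classVec(T')| ≤ #box · Pr · Rmax` from `|p(u)| ≤ Pr` and `|rHalf(u)| ≤ Rmax` on the box.
[folklore]
[cite: Waldschmidt1980, §3.3 (source FOLLOWED; sizes of the cell’s signed cores, NOT a printed statement)] -/
theorem sum_abs_classVec_le_card (J₀ J : ℕ) (box : Finset (Idx Q.d h Lb)) (p : Idx Q.d h Lb → ℤ)
    (τ : Tau Q.d) (s : ℕ) {Pr Rmax : ℝ} (hPr : 0 ≤ Pr) (hp : ∀ u ∈ box, |(p u : ℝ)| ≤ Pr)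
    (hR : ∀ u ∈ box, |(Q.rHalf J₀ J u τ s : ℝ)| ≤ Rmax) :
    ∑ T', |(Q.classVec J₀ J box p τ s T' : ℝ)| ≤ box.card * Pr * Rmax := by
  refine (Q.sum_abs_classVec_le J₀ J box p τ s).trans ?_
  calc ∑ u ∈ box, |(p u : ℝ)| * |(Q.rHalf J₀ J u τ s : ℝ)|
      ≤ ∑ u ∈ box, Pr * Rmax :=
        sum_le_sum fun u hu => mul_le_mul (hp u hu) (hR u hu) (abs_nonneg _) hPr
    _ = box.card * Pr * Rmax := by rw [sum_const, nsmul_eq_mul]; ring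

end SetupQ

end Literature.NumberTheory.Transcendental.StewartYu

end Part7

/-!
## Part 8 — port of `Summits/ABC/StewartYu/PadicCW77Sizes.lean`

# Cell abc-stewartyu, junctions J1/J2: p2's inputs `KSizes`, `Siegel`, `Endgame` in CLOSED FORM at
# p1's parameter record `PadicW80Par`

`Summits/ABC/StewartYu/PadicCW77Sizes.lean` — cell `abc-stewartyu` (HOME
`run/shared/lean/pub/abc-stewartyu/`, seat p3; theorems only, no named fact), on top of p2's
`PadicCW77Main.lean` (the `Prop`s `Inv`, `KSizes`, `Siegel`, `Endgame` of a signed set-up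
`S : PadicCW77.Setup`), p1's record `PadicW80Par` (`PadicW80Par{,B–F}.lean`: parameters,
`endgame_numbers`, `padic_siegel_count`), p2's height link `CW77.Setup.SizeHyp`, and p3's
`PadicW80Sizes(B,C).lean` (archimedean sizes), `PadicW80Budgets.lean` (closed forms `DmaxK`, `MmaxK`,
`PrVp`, `Efacp`), `PadicCW77HalfStep.lean` (`toQ'`) and the sign-free descent files `DescentStepQ` /
`DescentIntegralityQ` / `DescentSizesQ` (`SetupQ.Inv`, `SetupQ.siegel_step`, `SetupQ.w80_endgame`).

* **J1** `inv_iff'` — p2's `S.Inv` and p3's `S.toQ'.Inv` are the same `Prop` (fields `rfl`);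
* `abs_cast_qTerm_eq_flat'`, `exists_int_flatDclearJ_mul_qTerm'` / `…_coreSum` — the signed term has
  the absolute value of the flattened one, so the flattening's clearing denominator `DclearJ♭` (the
  tree's `CW77.Setup.DclearJ`, integral on `qTerm♭` by `exists_int_DclearJ_mul_qTerm`) clears the SIGNED
  `coreSum` as well (`|x| = |z|, z ∈ ℤ ⟹ x ∈ ℤ`);
* **`kSizes_of_hyp'`** — `S.Inv … J p` with `|p| ≤ Pint ≤ PrV` ⟹ `S.KSizes J₀ J L L_θ S₀ T t p DmaxK MmaxK`
  (`D = DclearJ♭(s₁,τ) ≤ 𝔅²E(2^{k+1})` by `DclearJ_le_p'`; `|coreSum| ≤ #box·PrV·max|qTerm|` by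
  `abs_qTerm_le_p'`, `card_box_le_𝔅_p'`);
* **`siegel_of_hyp'`** — `S.Siegel J₀ L L_θ S₀ T ⌈#box₀·𝔅⁴E(2)⌉` (p3's `SetupQ.siegel_step` + p1's
  count `padic_siegel_count` + `abs_Dclear_qTerm_le_p'`, via `inv_iff'`);
* **`endgame_of_params'`** — `S.Endgame J₀ L L_θ S₀ T Pint` (p3's `SetupQ.w80_endgame` + p1's
  `endgame_numbers`, `Lθ_lt_two_pow`, via `inv_iff'`).

(p2's own `PadicCW77Siegel/Endgame.lean` prove the same two inputs from the p-adic side; this file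
does not depend on them, which saves one landing layer.)  Everything is [folklore].
-/

section Part8

open _root_.Finset
open Literature.NumberTheory.Transcendental
open Literature.NumberTheory.Transcendental.CW77 (heightProd hgt)
open Literature.NumberTheory.Transcendental.CW77.Setup (Idx Tau tauNorm tauSet)

namespace Literature.NumberTheory.Transcendental.PadicCW77.Setup

open Literature.NumberTheory.Transcendental.StewartYu
open Literature.NumberTheory.Transcendental.StewartYu.PadicW80Par (cLp')

variable (S : PadicCW77.Setup) {h Lb : ℕ}

/-! ### J1: the two invariants coincide -/

/-- **J1: p2's `Inv` and the sign-free `SetupQ.Inv` of `S.toQ'` are the same** (`frame.box = flat.box`,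
`coreSum = toQ'.coreSum` definitionally). [folklore]
[cite: Waldschmidt1980, §3.3–§3.5 (source FOLLOWED for the size hypotheses, the Siegel step and the endgame; the cell’s p-adic adaptation, NOT a printed statement)] -/
theorem inv_iff' {J₀ : ℕ} {L : Fin S.d → ℕ} {Lθ S₀ T : ℕ} {P : ℤ} {J : ℕ} {p : Idx S.d h Lb → ℤ} :
    S.Inv J₀ L Lθ S₀ T P J p ↔ S.toQ'.Inv J₀ L Lθ S₀ T P J p :=
  ⟨fun hI => ⟨hI.supp, hI.nonzero, hI.bound, hI.rel⟩, fun hI => ⟨hI.supp, hI.nonzero, hI.bound, hI.rel⟩⟩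

/-! ### Sign transfer: absolute values and integrality -/

/-- `|qTerm|` of the signed set-up is `|qTerm♭|` (real casts). [folklore]
[cite: Waldschmidt1980, §3.3–§3.5 (source FOLLOWED for the size hypotheses, the Siegel step and the endgame; the cell’s p-adic adaptation, NOT a printed statement)] -/
theorem abs_cast_qTerm_eq_flat' (J₀ J : ℕ) (u : Idx S.d h Lb) (τ : Tau S.d) (s : ℕ) :
    |(S.qTerm J₀ J u τ s : ℝ)| = |(S.toQ'.flat.qTerm J₀ J u τ s : ℝ)| := by
  rw [← S.toQ_qTerm', ← Rat.cast_abs, ← Rat.cast_abs, S.toQ'.abs_qTerm]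

/-- **`DclearJ♭(s,τ) · qTerm_J(u,τ,s) ∈ ℤ`** for the SIGNED term on the box of level `J`: the flattened
product is an integer (tree: `CW77.Setup.exists_int_DclearJ_mul_qTerm`) and the signed one has the same
absolute value. [folklore]
[cite: Waldschmidt1980, §3.3–§3.5 (source FOLLOWED for the size hypotheses, the Siegel step and the endgame; the cell’s p-adic adaptation, NOT a printed statement)] -/
theorem exists_int_flatDclearJ_mul_qTerm' (J₀ J : ℕ) {L : Fin S.d → ℕ} {Lθ : ℕ} {u : Idx S.d h Lb}
    (hu : u ∈ S.frame.box (h := h) (Lb := Lb) L Lθ J) (τ : Tau S.d) (s : ℕ) :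
    ∃ z : ℤ, ((S.toQ'.flat.DclearJ (h := h) J₀ J L Lθ s τ : ℕ) : ℚ) * S.qTerm J₀ J u τ s = z := by
  obtain ⟨z, hz⟩ := S.toQ'.flat.exists_int_DclearJ_mul_qTerm J₀ J (u := u) hu τ s
  have habs : |((S.toQ'.flat.DclearJ (h := h) J₀ J L Lθ s τ : ℕ) : ℚ) * S.qTerm J₀ J u τ s| = |(z : ℚ)| := by
    rw [← hz, abs_mul, abs_mul, ← S.toQ_qTerm', S.toQ'.abs_qTerm]
  rcases abs_eq_abs.mp habs with h1 | h1
  · exact ⟨z, h1⟩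
  · exact ⟨-z, by rw [h1]; push_cast; ring⟩

/-- **`DclearJ♭(s,τ) · coreSum_J(τ,s) ∈ ℤ`** for coefficients supported... summed over the box of level
`J` (every term is an integer). [folklore]
[cite: Waldschmidt1980, §3.3–§3.5 (source FOLLOWED for the size hypotheses, the Siegel step and the endgame; the cell’s p-adic adaptation, NOT a printed statement)] -/
theorem exists_int_flatDclearJ_mul_coreSum' (J₀ J : ℕ) (L : Fin S.d → ℕ) (Lθ : ℕ)
    (p : Idx S.d h Lb → ℤ) (τ : Tau S.d) (s : ℕ) :
    ∃ m : ℤ, ((S.toQ'.flat.DclearJ (h := h) J₀ J L Lθ s τ : ℕ) : ℚ) *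
      S.coreSum J₀ J (S.frame.box (h := h) (Lb := Lb) L Lθ J) p τ s = m := by
  classical
  have hint : ∀ u ∈ S.frame.box (h := h) (Lb := Lb) L Lθ J, ∃ z : ℤ,
      ((S.toQ'.flat.DclearJ (h := h) J₀ J L Lθ s τ : ℕ) : ℚ) * S.qTerm J₀ J u τ s = z :=
    fun u hu => S.exists_int_flatDclearJ_mul_qTerm' J₀ J hu τ s
  choose! z hz using hint
  refine ⟨∑ u ∈ S.frame.box (h := h) (Lb := Lb) L Lθ J, p u * z u, ?_⟩
  unfold coreSum
  rw [mul_sum]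
  push_cast
  refine sum_congr rfl fun u hu => ?_
  rw [← hz u hu]; ring

variable {S}
variable {P : PadicW80Par S.d} (hy : S.toQ'.flat.SizeHyp P.Vs P.Vel P.Wb)
include hy

/-! ### J2 (inner steps): `KSizes` in closed form -/

omit hy in
/-- `4 · (2^{k+J} S₀ / 2) = 2^{k+1+J} S₀` (`S₀` is even). [folklore]
[cite: Waldschmidt1980, §3.3–§3.5 (source FOLLOWED for the size hypotheses, the Siegel step and the endgame; the cell’s p-adic adaptation, NOT a printed statement)] -/
theorem four_mul_kptsp' (P : PadicW80Par S.d) (J k : ℕ) :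
    4 * (2 ^ (k + J) * P.S₀p / 2) = 2 ^ (k + 1 + J) * P.S₀p := by
  obtain ⟨m, hm⟩ := P.even_S₀
  rw [hm, ← two_mul, show 2 ^ (k + J) * (2 * m) = 2 ^ (k + J) * m * 2 by ring,
    Nat.mul_div_cancel _ two_pos]
  ring

/-- **J2, the archimedean sizes of the inner steps in closed form.** For coefficients `p` of level
`J < J₀` with `|p(u)| ≤ Pint ≤ PrV`: at step `k < d`, `|τ| + t ≤ T/2^J − kt`, odd `s₁ < 2^{k+1+J}S₀`,
the integer `D = DclearJ♭(s₁,τ) ≤ Dmax_k` clears `coreSum` and `|coreSum| ≤ Mmax_k`. [folklore]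
[cite: Waldschmidt1980, §3.3–§3.5 (source FOLLOWED for the size hypotheses, the Siegel step and the endgame; the cell’s p-adic adaptation, NOT a printed statement)] -/
theorem kSizes_of_hyp' {J : ℕ} (hJ : J < P.J₀p) (t : ℕ) {Pint : ℤ} (hPint : (Pint : ℝ) ≤ P.PrVp)
    {p : Idx S.d P.hparp P.Lbp → ℤ} (inv : S.Inv P.J₀p P.Lp P.Lθp P.S₀p P.Tp Pint J p) :
    S.KSizes P.J₀p J P.Lp P.Lθp P.S₀p P.Tp t p P.DmaxK P.MmaxK := by
  classical
  intro k hk τ hτ s₁ hs₁ _hodd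
  have hPr : (0 : ℝ) ≤ P.PrVp := by linarith [P.one_le_PrVp]
  have hτT : tauNorm τ ≤ P.Tp := by have := Nat.div_le_self P.Tp (2 ^ J); omega
  have hs4 : s₁ < 2 ^ (k + 1 + J) * P.S₀p := by rw [← four_mul_kptsp' P J k]; exact hs₁
  have hB0 : 0 ≤ P.DmaxK k := (P.DmaxK_pos k).le
  refine ⟨S.toQ'.flat.DclearJ (h := P.hparp) P.J₀p J P.Lp P.Lθp s₁ τ, S.toQ'.flat.DclearJ_pos _ _ _ _ _ _,
    ?_, S.exists_int_flatDclearJ_mul_coreSum' P.J₀p J P.Lp P.Lθp p τ s₁, ?_⟩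
  · have := hy.DclearJ_le_p' hJ.le hk.le hτT hs4
    unfold PadicW80Par.DmaxK PadicW80Par.Efacp; exact this
  · have hterm : ∀ u ∈ S.frame.box (h := P.hparp) (Lb := P.Lbp) P.Lp P.Lθp J,
        |(p u : ℝ)| * |(S.qTerm P.J₀p J u τ s₁ : ℝ)| ≤ P.PrVp * P.DmaxK k := by
      intro u hu
      have hq : |(S.qTerm P.J₀p J u τ s₁ : ℝ)| ≤ P.DmaxK k := by
        rw [S.abs_cast_qTerm_eq_flat']
        have := hy.abs_qTerm_le_p' hJ.le hk.le (u := u) hu hτT hs4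
        unfold PadicW80Par.DmaxK PadicW80Par.Efacp; exact this
      have hp : |(p u : ℝ)| ≤ P.PrVp := le_trans (by exact_mod_cast inv.bound u) hPint
      exact mul_le_mul hp hq (abs_nonneg _) hPr
    have hcard : ((S.frame.box (h := P.hparp) (Lb := P.Lbp) P.Lp P.Lθp J).card : ℝ) ≤ P.𝔅p :=
      S.toQ'.flat.card_box_le_𝔅_p' P J
    show |((S.coreSum P.J₀p J _ p τ s₁ : ℚ) : ℝ)| ≤ P.MmaxK k
    unfold coreSum PadicW80Par.MmaxK
    push_cast
    calc |∑ u ∈ S.frame.box (h := P.hparp) (Lb := P.Lbp) P.Lp P.Lθp J, (p u : ℝ) * (S.qTerm P.J₀p J u τ s₁ : ℝ)|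
        ≤ ∑ u ∈ S.frame.box (h := P.hparp) (Lb := P.Lbp) P.Lp P.Lθp J, |(p u : ℝ) * (S.qTerm P.J₀p J u τ s₁ : ℝ)| :=
          abs_sum_le_sum_abs _ _
      _ ≤ ∑ u ∈ S.frame.box (h := P.hparp) (Lb := P.Lbp) P.Lp P.Lθp J, P.PrVp * P.DmaxK k :=
          sum_le_sum fun u hu => by rw [abs_mul]; exact hterm u hu
      _ = (S.frame.box (h := P.hparp) (Lb := P.Lbp) P.Lp P.Lθp J).card * (P.PrVp * P.DmaxK k) := by
          rw [sum_const, nsmul_eq_mul]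
      _ ≤ P.𝔅p * (P.PrVp * P.DmaxK k) := mul_le_mul_of_nonneg_right hcard (mul_nonneg hPr hB0)
      _ = P.𝔅p * P.PrVp * P.DmaxK k := by ring

/-! ### Siegel and the endgame at p1's parameters, via the sign-free descent files -/

/-- **The input `Siegel` in closed form**: integers `p(u)` of level `0`, `|p(u)| ≤ ⌈#box₀ · 𝔅⁴E(2)⌉`
(`SetupQ.siegel_step` with the count `padic_siegel_count` and `Amax = 𝔅⁴E(2)` from
`abs_Dclear_qTerm_le_p'`). [folklore]
[cite: Waldschmidt1980, §3.3–§3.5 (source FOLLOWED for the size hypotheses, the Siegel step and the endgame; the cell’s p-adic adaptation, NOT a printed statement)] -/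
theorem siegel_of_hyp' :
    S.Siegel (h := P.hparp) (Lb := P.Lbp) P.J₀p P.Lp P.Lθp P.S₀p P.Tp
      ⌈((S.frame.box (h := P.hparp) (Lb := P.Lbp) P.Lp P.Lθp 0).card : ℝ) * (P.𝔅p ^ 4 * P.Efacp 2)⌉ := by
  have hS₀ : 1 ≤ P.S₀p := le_trans (by norm_num) P.two_le_S₀
  have hAmax : 1 ≤ P.𝔅p ^ 4 * P.Efacp 2 :=
    one_le_mul_of_one_le_of_one_le (one_le_pow₀ P.one_le_𝔅) (P.one_le_Efacp (by norm_num))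
  have hA : ∀ s, s < P.S₀p → ∀ τ : Tau S.d, tauNorm τ < P.Tp →
      ∀ u ∈ S.toQ'.flat.box (h := P.hparp) (Lb := P.Lbp) P.Lp P.Lθp 0,
      |((S.toQ'.flat.Dclear (h := P.hparp) P.J₀p P.Lp P.Lθp s τ : ℕ) : ℝ) * (S.toQ'.qTerm P.J₀p 0 u τ s : ℝ)| ≤
        P.𝔅p ^ 4 * P.Efacp 2 := by
    intro s hs τ hτ u hu
    rw [abs_mul, S.toQ_qTerm', S.abs_cast_qTerm_eq_flat', ← abs_mul]
    have := hy.abs_Dclear_qTerm_le_p' hs hτ hu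
    unfold PadicW80Par.Efacp; exact this
  obtain ⟨p, hp⟩ := S.toQ'.siegel_step P.J₀p P.Lp P.Lθp P.S₀p P.Tp hS₀ P.one_le_T
    (PadicW80Par.padic_siegel_count S.toQ'.flat P) hAmax hA
  exact ⟨p, (S.inv_iff').mpr hp⟩

omit hy in
/-- **The input `Endgame` at p1's parameters** (`SetupQ.w80_endgame` with p1's `endgame_numbers` and
`Lθ_lt_two_pow`). [folklore]
[cite: Waldschmidt1980, §3.3–§3.5 (source FOLLOWED for the size hypotheses, the Siegel step and the endgame; the cell’s p-adic adaptation, NOT a printed statement)] -/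
theorem endgame_of_params' (P : PadicW80Par S.d) (Pint : ℤ) :
    S.Endgame (h := P.hparp) (Lb := P.Lbp) P.J₀p P.Lp P.Lθp P.S₀p P.Tp Pint := by
  intro p inv
  obtain ⟨h1, h2⟩ := P.endgame_numbers
  have hT' : (P.Tp / 2 ^ P.J₀p - ∑ j, P.Lp j / 2 ^ P.J₀p) + ∑ j, P.Lp j / 2 ^ P.J₀p ≤ P.Tp / 2 ^ P.J₀p := by
    omega
  exact S.toQ'.w80_endgame ((S.inv_iff').mp inv) P.Lθ_lt_two_pow
    (T' := P.Tp / 2 ^ P.J₀p - ∑ j, P.Lp j / 2 ^ P.J₀p) hT' h2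

end Literature.NumberTheory.Transcendental.PadicCW77.Setup

end Part8

/-!
## Part 9 — port of `Summits/ABC/StewartYu/PadicCW77Junctions.lean`

# Cell abc-stewartyu, junction J3: p2's input `HalfStep` from half-point sizes and the half-point
# inequality, and the half-point sizes in closed form

`Summits/ABC/StewartYu/PadicCW77Junctions.lean` — cell `abc-stewartyu` (HOME
`run/shared/lean/pub/abc-stewartyu/`, seat p3; two plain `Prop` definitions in p2's style + theorems,
no named fact), on top of p2's `PadicCW77Main.lean` (`Inv`, `HalfStep`, `norm_Φ_le_of_zeros`),
p3's `PadicCW77HalfStep.lean` (`toQ'`, `inv_succ_of_norm_Φ_half_lt'`), `PadicW80SizesC.lean`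
(`Dhalf_le_p'`, `abs_rHalf_le_p'`), `PadicW80Budgets.lean` (`DmaxHp`, `MmaxHp`) and `DescentSizesQ.lean`.

* `HSizesHalf'` (archimedean sizes at the half points: `Dhalf♭ ≤ DmaxH`, `∑|classVec| ≤ MmaxH`) and
  `HFinalHalf'` (the half-point inequality of the parameters, sharp branch-1 form
  `p^{⌊hL_b/(p−1)⌋}‖Λ₀‖p^{⌊(t−1)/(p−1)⌋}p^{condExp}`) — the two named WP-A4 targets;
* **`halfStep_of'`** — `hind` (Kummer on the signed generators) + `‖Λ₀‖ ≤ p⁻¹` + the room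
  `T/2^{J+1} + t ≤ T/2^J − d·t` + `HSizesHalf'` + `HFinalHalf' J` ⟹ `S.HalfStep J₀ J L Lθ S₀ T t P`
  (p2's `norm_Φ_le_of_zeros` at `z = 2⁻¹·s`, then `inv_succ_of_norm_Φ_half_lt'`);
* `hFinalHalf_of_log_ineq'` — two real inequalities between logarithms ⟹ `HFinalHalf'`;
* **`hSizesHalf_of_hyp'`** — under the height link `hy : S.toQ'.flat.SizeHyp P.Vs P.Vel P.Wb`,
  `HSizesHalf'` holds with `DmaxHp = 𝔅²E(2)`, `MmaxHp = 𝔅·PrV·𝔅²E(2)` for `|p| ≤ Pint ≤ PrV`.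

Everything is [folklore].
-/

section Part9

open _root_.NormedSpace _root_.Finset
open Literature.NumberTheory.Transcendental
open Literature.NumberTheory.Transcendental.CW77 (heightProd)
open Literature.NumberTheory.Transcendental.CW77.Setup (Idx Tau tauNorm)

namespace Literature.NumberTheory.Transcendental.PadicCW77.Setup

open Literature.NumberTheory.Transcendental.StewartYu
open Literature.NumberTheory.Transcendental.StewartYu.PadicW80Par (cLp')

variable (S : PadicCW77.Setup) {h Lb : ℕ}

/-- **Archimedean sizes at the half points of level `J`** (WP-A4 target, from the heights: `Dhalf♭`
of the flattening and the `ℓ¹`-norm of the signed class-sum vector for every admissible `p`).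
[folklore]
[cite: Waldschmidt1980, §3.4–§3.5 with Yu1989, Lemma 1.4 (sources FOLLOWED; junction plumbing of the cell, NOT a printed statement)] -/
def HSizesHalf' (J₀ J : ℕ) (L : Fin S.d → ℕ) (Lθ S₀ T : ℕ) (P : ℤ) (DmaxH MmaxH : ℝ) : Prop :=
  1 ≤ MmaxH ∧ ∀ p : Idx S.d h Lb → ℤ, S.Inv J₀ L Lθ S₀ T P J p →
    ∀ s, s < 2 ^ (J + 1) * S₀ → Odd s → ∀ τ : Tau S.d, tauNorm τ < T / 2 ^ (J + 1) →
      ((S.toQ'.flat.Dhalf (h := h) J₀ J L Lθ s τ : ℕ) : ℝ) ≤ DmaxH ∧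
      ∑ T', |(S.toQ'.classVec J₀ J (S.toQ'.flat.box (h := h) (Lb := Lb) L Lθ J) p τ s T' : ℝ)| ≤ MmaxH

/-- **The half-point inequality of the parameters at level `J`** (WP-A4 target, twin of
`W80Par.final_half`): the Schwarz bound at `kpts = 2^{d+J} S₀/2` nodes of multiplicity `t` is below
the sharp `p`-adic Liouville bound of the class sums. [folklore]
[cite: Waldschmidt1980, §3.4–§3.5 with Yu1989, Lemma 1.4 (sources FOLLOWED; junction plumbing of the cell, NOT a printed statement)] -/
def HFinalHalf' (J : ℕ) (S₀ t : ℕ) (DmaxH MmaxH : ℝ) : Prop :=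
  max ((S.p : ℝ) ^ (h * Lb / (S.p - 1)) * ‖S.Λ₀‖ * (S.p : ℝ) ^ ((t - 1) / (S.p - 1)) *
        (S.p : ℝ) ^ condExp S.p (2 ^ (S.d + J) * S₀ / 2) t)
      ((S.p : ℝ) ^ (h * Lb) / Real.sqrt S.p ^ ((2 ^ (S.d + J) * S₀ / 2) * t)) <
    DmaxH / (4 * DmaxH ^ 2 * MmaxH * heightProd S.all ^ 3) ^ (2 ^ (S.d + 1))

/-- **J3: the half step from sizes and the half-point inequality.** [folklore]
[cite: Waldschmidt1980, §3.4–§3.5 with Yu1989, Lemma 1.4 (sources FOLLOWED; junction plumbing of the cell, NOT a printed statement)] -/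
theorem halfStep_of' {J₀ J : ℕ} (hJ : J < J₀)
    (hind : ∀ T' : Finset (Fin (S.d + 1)), T'.Nonempty → ¬ IsSquare (∏ i ∈ T', S.all i))
    (hΛ : ‖S.Λ₀‖ ≤ (S.p : ℝ)⁻¹) {L : Fin S.d → ℕ} {Lθ S₀ T t : ℕ} {P : ℤ} (ht : 1 ≤ t)
    (hS₀ : Even S₀) (hroom : T / 2 ^ (J + 1) + t ≤ T / 2 ^ J - S.d * t) {DmaxH MmaxH : ℝ}
    (hsz : S.HSizesHalf' (h := h) (Lb := Lb) J₀ J L Lθ S₀ T P DmaxH MmaxH)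
    (hfin : S.HFinalHalf' (h := h) (Lb := Lb) J S₀ t DmaxH MmaxH) :
    S.HalfStep (h := h) (Lb := Lb) J₀ J L Lθ S₀ T t P := by
  intro p inv hvan
  have invQ : S.toQ'.Inv J₀ L Lθ S₀ T P J p := ⟨inv.supp, inv.nonzero, inv.bound, inv.rel⟩
  -- the smallness at the half points from the ultrametric Schwarz lemma
  have hsmall : ∀ s, s < 2 ^ (J + 1) * S₀ → Odd s → ∀ τ : Tau S.d, tauNorm τ < T / 2 ^ (J + 1) →
      ‖S.Φ J₀ J (S.toQ'.flat.box (h := h) (Lb := Lb) L Lθ J) p τ ((2 : ℚ_[S.p])⁻¹ * (s : ℚ_[S.p]))‖ <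
        DmaxH / (4 * DmaxH ^ 2 * MmaxH * heightProd S.all ^ 3) ^ (2 ^ (S.d + 1)) := by
    intro s hs hodd τ hτ
    have hzero : ∀ i < 2 ^ (S.d + J) * S₀ / 2, ∀ τ'' : Tau S.d, tauNorm τ'' < T / 2 ^ J - S.d * t →
        S.coreSum J₀ J (S.toQ'.flat.box (h := h) (Lb := Lb) L Lθ J) p τ'' (2 * i + 1) = 0 := by
      intro i hi τ'' hτ''
      obtain ⟨m, hm⟩ := hS₀
      have h2i : 2 * i + 1 < 2 ^ (S.d + J) * S₀ := by omega
      exact hvan (2 * i + 1) h2i ⟨i, rfl⟩ τ'' hτ''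
    have hz : ‖(2 : ℚ_[S.p])⁻¹ * (s : ℚ_[S.p])‖ ≤ 1 := by
      rw [norm_mul, norm_inv, PadicExp.norm_two_eq_one S.hp3, inv_one, one_mul]
      exact_mod_cast Padic.norm_int_le_one (p := S.p) (s : ℤ)
    have hτt : tauNorm τ + t ≤ T / 2 ^ J - S.d * t := by omega
    have key := (S.norm_Φ_le_of_zeros J₀ J (S.toQ'.flat.box (h := h) (Lb := Lb) L Lθ J) p ht hzero hΛ hz τ hτt).2
    exact lt_of_le_of_lt key hfin
  obtain ⟨p', h'⟩ := S.inv_succ_of_norm_Φ_half_lt' hJ hind invQ hsz.1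
    (fun s hs ho τ hτ => (hsz.2 p inv s hs ho τ hτ).1) (fun s hs ho τ hτ => (hsz.2 p inv s hs ho τ hτ).2) hsmall
  exact ⟨p', ⟨h'.supp, h'.nonzero, h'.bound, h'.rel⟩⟩

/-! ### `HFinalHalf'` in logarithmic form (the WP-A4 target, twin of p2's `kFinal_of_log_ineq`) -/

/-- `(√p)^n = exp((n/2) log p)`. [folklore] -/
private theorem sqrt_pow_eq_exp' (n : ℕ) :
    Real.sqrt S.p ^ n = Real.exp ((n : ℝ) / 2 * Real.log S.p) := by
  have hp0 : (0 : ℝ) < S.p := by exact_mod_cast S.hp.pos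
  rw [Real.sqrt_eq_rpow, ← Real.rpow_natCast, ← Real.rpow_mul hp0.le, Real.rpow_def_of_pos hp0]
  congr 1; ring

/-- `p^n = exp(n log p)`. [folklore] -/
private theorem natPow_eq_exp' (n : ℕ) : (S.p : ℝ) ^ n = Real.exp ((n : ℝ) * Real.log S.p) := by
  have hp0 : (0 : ℝ) < S.p := by exact_mod_cast S.hp.pos
  rw [← Real.rpow_natCast, Real.rpow_def_of_pos hp0]; congr 1; ring

/-- **`HFinalHalf'` from two inequalities between logarithms** (the form in which WP-A4 verifies it):
with `kpts = 2^{d+J} S₀/2` and `B = 2^{d+1}·log(4·DmaxH²·MmaxH·(∏H(allᵢ))³) − log DmaxH`, if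
`‖Λ₀‖_p ≤ e^{−U}`, (1) `(⌊hLb/(p−1)⌋ + ⌊(t−1)/(p−1)⌋ + condExp)·log p + B < U` and
(2) `hLb·log p + B < (kpts·t/2)·log p`, then `HFinalHalf' J S₀ t DmaxH MmaxH`. [folklore]
[cite: Waldschmidt1980, §3.4–§3.5 with Yu1989, Lemma 1.4 (sources FOLLOWED; junction plumbing of the cell, NOT a printed statement)] -/
theorem hFinalHalf_of_log_ineq' {U : ℝ} (J S₀ t : ℕ) {DmaxH MmaxH : ℝ}
    (hΛ : ‖S.Λ₀‖ ≤ Real.exp (-U)) (hD : 0 < DmaxH) (hM : 0 < MmaxH)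
    (h1 : ((h * Lb / (S.p - 1) + (t - 1) / (S.p - 1) + condExp S.p (2 ^ (S.d + J) * S₀ / 2) t : ℕ) : ℝ) *
          Real.log S.p +
        ((2 : ℝ) ^ (S.d + 1) * Real.log (4 * DmaxH ^ 2 * MmaxH * heightProd S.all ^ 3) -
          Real.log DmaxH) < U)
    (h2 : ((h * Lb : ℕ) : ℝ) * Real.log S.p +
        ((2 : ℝ) ^ (S.d + 1) * Real.log (4 * DmaxH ^ 2 * MmaxH * heightProd S.all ^ 3) -
          Real.log DmaxH) <
        (((2 ^ (S.d + J) * S₀ / 2) * t : ℕ) : ℝ) / 2 * Real.log S.p) :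
    S.HFinalHalf' (h := h) (Lb := Lb) J S₀ t DmaxH MmaxH := by
  have hH : 1 ≤ heightProd S.all := CW77.one_le_heightProd _
  have hQ : 0 < 4 * DmaxH ^ 2 * MmaxH * heightProd S.all ^ 3 := by positivity
  have hrhs : DmaxH / (4 * DmaxH ^ 2 * MmaxH * heightProd S.all ^ 3) ^ (2 ^ (S.d + 1)) =
      Real.exp (Real.log DmaxH -
        (2 : ℝ) ^ (S.d + 1) * Real.log (4 * DmaxH ^ 2 * MmaxH * heightProd S.all ^ 3)) := by
    have hc : (2 : ℝ) ^ (S.d + 1) * Real.log (4 * DmaxH ^ 2 * MmaxH * heightProd S.all ^ 3) =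
        Real.log ((4 * DmaxH ^ 2 * MmaxH * heightProd S.all ^ 3) ^ (2 ^ (S.d + 1))) := by
      rw [Real.log_pow]; push_cast; ring
    rw [hc, Real.exp_sub, Real.exp_log hD, Real.exp_log (pow_pos hQ _)]
  unfold HFinalHalf'
  rw [hrhs]
  refine max_lt ?_ ?_
  · rcases (norm_nonneg S.Λ₀).eq_or_lt with h0 | hpos
    · rw [← h0]; simp [Real.exp_pos]
    · have e1 : (S.p : ℝ) ^ (h * Lb / (S.p - 1)) * ‖S.Λ₀‖ * (S.p : ℝ) ^ ((t - 1) / (S.p - 1)) *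
          (S.p : ℝ) ^ condExp S.p (2 ^ (S.d + J) * S₀ / 2) t =
          Real.exp (((h * Lb / (S.p - 1) : ℕ) : ℝ) * Real.log S.p + Real.log ‖S.Λ₀‖ +
            (((t - 1) / (S.p - 1) : ℕ) : ℝ) * Real.log S.p +
            (condExp S.p (2 ^ (S.d + J) * S₀ / 2) t : ℝ) * Real.log S.p) := by
        rw [S.natPow_eq_exp', S.natPow_eq_exp', S.natPow_eq_exp', ← Real.exp_log hpos]
        simp only [← Real.exp_add, Real.log_exp]
      rw [e1, Real.exp_lt_exp]
      have hlog : Real.log ‖S.Λ₀‖ ≤ -U := by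
        have := Real.log_le_log hpos hΛ; rwa [Real.log_exp] at this
      push_cast at h1 ⊢
      linarith
  · have e2 : (S.p : ℝ) ^ (h * Lb) / Real.sqrt S.p ^ ((2 ^ (S.d + J) * S₀ / 2) * t) =
        Real.exp (((h * Lb : ℕ) : ℝ) * Real.log S.p -
          (((2 ^ (S.d + J) * S₀ / 2) * t : ℕ) : ℝ) / 2 * Real.log S.p) := by
      rw [S.natPow_eq_exp', S.sqrt_pow_eq_exp', ← Real.exp_sub]
    rw [e2, Real.exp_lt_exp]
    linarith

/-! ### J2 at the half points: `HSizesHalf'` in closed form (sizes from `PadicW80SizesC`) -/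

/-- `|rHalf|` of the signed set-up is `|rHalf♭|` (real casts). [folklore]
[cite: Waldschmidt1980, §3.4–§3.5 with Yu1989, Lemma 1.4 (sources FOLLOWED; junction plumbing of the cell, NOT a printed statement)] -/
theorem abs_cast_rHalf_eq_flat' (J₀ J : ℕ) (u : Idx S.d h Lb) (τ : Tau S.d) (s : ℕ) :
    |(S.toQ'.rHalf J₀ J u τ s : ℝ)| = |(S.toQ'.flat.rHalf J₀ J u τ s : ℝ)| := by
  rw [← Rat.cast_abs, ← Rat.cast_abs, S.toQ'.abs_rHalf]

variable {S}
variable {P : PadicW80Par S.d} (hy : S.toQ'.flat.SizeHyp P.Vs P.Vel P.Wb)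
include hy

/-- **J2, the archimedean sizes at the half points in closed form**: `Dhalf♭ ≤ DmaxH` and
`∑_{T'}|classVec(T')| ≤ MmaxH` for every `p` of level `J < J₀` with `|p| ≤ Pint ≤ PrV`. [folklore]
[cite: Waldschmidt1980, §3.4–§3.5 with Yu1989, Lemma 1.4 (sources FOLLOWED; junction plumbing of the cell, NOT a printed statement)] -/
theorem hSizesHalf_of_hyp' {J : ℕ} (hJ : J < P.J₀p) {Pint : ℤ} (hPint : (Pint : ℝ) ≤ P.PrVp) :
    S.HSizesHalf' (h := P.hparp) (Lb := P.Lbp) P.J₀p J P.Lp P.Lθp P.S₀p P.Tp Pint P.DmaxHp P.MmaxHp := by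
  refine ⟨P.one_le_MmaxHp, ?_⟩
  intro p inv s hs _hodd τ hτ
  have hPr : (0 : ℝ) ≤ P.PrVp := by linarith [P.one_le_PrVp]
  have hτT : tauNorm τ ≤ P.Tp := by have := Nat.div_le_self P.Tp (2 ^ (J + 1)); omega
  refine ⟨?_, ?_⟩
  · have := hy.Dhalf_le_p' hJ hτT hs
    unfold PadicW80Par.DmaxHp PadicW80Par.Efacp; exact this
  · have hcard : ((S.toQ'.flat.box (h := P.hparp) (Lb := P.Lbp) P.Lp P.Lθp J).card : ℝ) ≤ P.𝔅p :=
      S.toQ'.flat.card_box_le_𝔅_p' P J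
    have key := S.toQ'.sum_abs_classVec_le_card P.J₀p J (S.toQ'.flat.box (h := P.hparp) (Lb := P.Lbp) P.Lp P.Lθp J)
      p τ s (Rmax := P.DmaxHp) hPr
      (fun u _ => le_trans (by exact_mod_cast inv.bound u) hPint)
      (fun u hu => by
        rw [S.abs_cast_rHalf_eq_flat']
        have := hy.abs_rHalf_le_p' hJ hu hτT hs
        unfold PadicW80Par.DmaxHp PadicW80Par.Efacp; exact this)
    refine key.trans ?_
    have hR0 : (0 : ℝ) ≤ P.DmaxHp := by linarith [P.one_le_DmaxHp]
    unfold PadicW80Par.MmaxHp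
    exact mul_le_mul_of_nonneg_right (mul_le_mul_of_nonneg_right hcard hPr) hR0

end Literature.NumberTheory.Transcendental.PadicCW77.Setup

end Part9

/-!
## Part 10 — port of `Summits/ABC/StewartYu/PadicW80Numeric.lean`

# The `p`-adic Waldschmidt numerics (WP-A4, cell abc-stewartyu): the extrapolation inequalities

Support file (theorems only), sequel to `PadicW80Par.lean`. It discharges the two logarithmic
inequalities behind p2's `PadicCW77.Setup.kFinal_of_log_ineq` (`KFinal`, the inner `k`-steps,
`k < d`) and the two behind p3's `hFinalHalf_of_log_ineq'` (`HFinalHalf'`, the half step) for the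
parameter record `PadicW80Par` — with the archimedean size inputs `log(Dmax·Mmax)` (k-step) and `B`
(half step) as ABSTRACT budgets (`≤ 𝔘/4 + 2ᵏ𝔘/16`, resp. `≤ (7/16)·2ᵈ𝔘`) to be met by p3's closed
forms (junction J2; W80's values are `≈ 0.16𝔘 + 0.001·2ᵏ𝔘` resp. `≈ 0.375·2ᵈ𝔘`):

* `condSum_mul_log_le` — the node-conditioning exponent of `PadicCW77KStep.condExp`
  (`∑_{j < log_p(2 kpts)} t(⌊kpts/p^{j+1}⌋ + 1)`, written out) costs
  `≤ kpts·t·log p/(p−1) + t·log(2 kpts)` — `p`-uniform (Legendre);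
* `kstep_ineq_one`, `kstep_ineq_two` — (1) `(⌊hL_b/(p−1)⌋ + ⌊(t−1)/(p−1)⌋ + cond)·log p +
  log(Dmax·Mmax) < U` and (2) `hL_b·log p + log(Dmax·Mmax) < (kpts·t/2)·log p`, from `kpts·t ∈
  [(31/32)·2ᵏ𝔘, 2ᵏ𝔘]` (`KT_ge/KT_le`), `log p/(p−1) ≤ 1`, `log p ≥ 1` (`p ≥ 3`), `U = 2^{d+1}𝔘`;
* `halfstep_ineq_one`, `halfstep_ineq_two` — the same at `kpts' = 2^{d+J}S₀/2` against the
  half-step threshold `B`;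
* (`log_p_le_U`, `room_half` live in `PadicW80ParF`.)

## References
* [Waldschmidt1980] M. Waldschmidt, Acta Arith. 37 (1980), Lemmas 3.5–3.7 (pp. 271–273).
* [Yu1989] K. Yu, Acta Arith. 53 (1989), Lemma 1.4 (p. 117) — the Legendre conditioning.
-/

section Part10

open _root_.Finset _root_.Real

open Literature.NumberTheory.Transcendental Literature.NumberTheory.Transcendental.Waldschmidt1980

namespace Literature.NumberTheory.Transcendental.StewartYu

namespace PadicW80Par

variable {d : ℕ} (P : PadicW80Par d)

/-! ### Elementary facts about `log p` -/

omit P in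
/-- `log p ≤ p − 1`, i.e. `x·log p/(p−1) ≤ x`. [folklore] -/
private theorem log_le_sub_one_nat {p : ℕ} (hp : 2 ≤ p) : Real.log p ≤ (p : ℝ) - 1 :=
  Real.log_le_sub_one_of_pos (by exact_mod_cast (by omega : 0 < p))

omit P in
/-- `1 ≤ log p` for `p ≥ 3` (`e < 3`). [folklore] -/
private theorem one_le_log_nat {p : ℕ} (hp : 3 ≤ p) : (1 : ℝ) ≤ Real.log p := by
  rw [Real.le_log_iff_exp_le (by exact_mod_cast (by omega : 0 < p))]
  have := Real.exp_one_lt_d9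
  have h3 : (3 : ℝ) ≤ p := by exact_mod_cast hp
  linarith

/-! ### The conditioning exponent -/

omit P in
/-- `∑_{j<N} (1/p)^{j+1} = (1 − (1/p)^N)/(p − 1)`. [folklore] -/
private theorem geom_sum_inv (p : ℕ) (hp : 2 ≤ p) (N : ℕ) :
    ∑ j ∈ range N, ((1 : ℝ) / p) ^ (j + 1) = (1 - (1 / (p : ℝ)) ^ N) / ((p : ℝ) - 1) := by
  have hp1 : (1 : ℝ) < p := by exact_mod_cast (by omega : 1 < p)
  have hne : (p : ℝ) - 1 ≠ 0 := by linarith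
  have hp0 : (p : ℝ) ≠ 0 := by positivity
  induction N with
  | zero => simp
  | succ N ih =>
    rw [sum_range_succ, ih, pow_succ, div_add' _ _ _ hne, div_eq_div_iff hne hne]
    field_simp
    ring

omit P in
/-- **The node conditioning costs at most `kpts·t·log p/(p−1) + t·log(2·kpts)`**: for the
exponent `∑_{j < ⌊log_p(2 kpts)⌋} t(⌊kpts/p^{j+1}⌋ + 1)` of `PadicCW77KStep.condExp` (written out),
`(…)·log p ≤ kpts·t·log p/(p−1) + t·log(2 kpts)` (`∑ ⌊kpts/p^{j+1}⌋ ≤ kpts/(p−1)`;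
`p^{⌊log_p(2kpts)⌋} ≤ 2 kpts`). [cite: Yu1989, Lemma 1.4 (p. 117)] -/
theorem condSum_mul_log_le {p : ℕ} (hp : 2 ≤ p) (kpts t : ℕ) (hk : 1 ≤ kpts) :
    ((∑ j ∈ range (Nat.log p (2 * kpts)), t * (kpts / p ^ (j + 1) + 1) : ℕ) : ℝ) * Real.log p ≤
      (kpts : ℝ) * t * Real.log p / ((p : ℝ) - 1) + t * Real.log (2 * (kpts : ℝ)) := by
  have hp0 : (0 : ℝ) < p := by exact_mod_cast (by omega : 0 < p)
  have hp1 : (1 : ℝ) < p := by exact_mod_cast (by omega : 1 < p)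
  have hlogp : 0 ≤ Real.log p := Real.log_nonneg hp1.le
  set N := Nat.log p (2 * kpts) with hN
  -- split the sum
  have hsplit : ((∑ j ∈ range N, t * (kpts / p ^ (j + 1) + 1) : ℕ) : ℝ) =
      (t : ℝ) * (∑ j ∈ range N, ((kpts / p ^ (j + 1) : ℕ) : ℝ)) + (t : ℝ) * N := by
    push_cast
    rw [show (∑ x ∈ range N, (t : ℝ) * (((kpts / p ^ (x + 1) : ℕ) : ℝ) + 1)) =
        ∑ x ∈ range N, ((t : ℝ) * (((kpts / p ^ (x + 1) : ℕ) : ℝ)) + (t : ℝ)) from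
        sum_congr rfl (fun x _ => by ring), sum_add_distrib, sum_const, card_range, nsmul_eq_mul,
      mul_sum]
    ring
  -- the floor sum against the geometric series
  have hgeom : (∑ j ∈ range N, ((kpts / p ^ (j + 1) : ℕ) : ℝ)) ≤ (kpts : ℝ) / ((p : ℝ) - 1) := by
    calc (∑ j ∈ range N, ((kpts / p ^ (j + 1) : ℕ) : ℝ))
        ≤ ∑ j ∈ range N, (kpts : ℝ) * ((1 : ℝ) / p) ^ (j + 1) := by
          refine sum_le_sum fun j _ => ?_
          have h := Nat.cast_div_le (α := ℝ) (m := kpts) (n := p ^ (j + 1))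
          rw [one_div, inv_pow, ← div_eq_mul_inv]
          push_cast at h ⊢
          exact h
      _ = (kpts : ℝ) * ((1 - (1 / (p : ℝ)) ^ N) / ((p : ℝ) - 1)) := by
          rw [← Finset.mul_sum, geom_sum_inv p hp N]
      _ ≤ (kpts : ℝ) * (1 / ((p : ℝ) - 1)) := by
          refine mul_le_mul_of_nonneg_left ?_ (Nat.cast_nonneg _)
          apply div_le_div_of_nonneg_right _ (by linarith)
          have : (0 : ℝ) ≤ (1 / (p : ℝ)) ^ N := by positivity
          linarith
      _ = (kpts : ℝ) / ((p : ℝ) - 1) := by ring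
  -- the number of levels against `log(2 kpts)`
  have hNlog : (N : ℝ) * Real.log p ≤ Real.log (2 * (kpts : ℝ)) := by
    have hpow : p ^ N ≤ 2 * kpts := Nat.pow_log_le_self p (by omega)
    have h1 : ((p : ℝ)) ^ N ≤ 2 * (kpts : ℝ) := by exact_mod_cast hpow
    rw [← Real.log_pow]
    exact Real.log_le_log (by positivity) h1
  rw [hsplit, add_mul]
  have ht0 : (0 : ℝ) ≤ t := Nat.cast_nonneg _
  have e1 : (t : ℝ) * (∑ j ∈ range N, ((kpts / p ^ (j + 1) : ℕ) : ℝ)) * Real.log p ≤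
      (kpts : ℝ) * t * Real.log p / ((p : ℝ) - 1) := by
    calc (t : ℝ) * (∑ j ∈ range N, ((kpts / p ^ (j + 1) : ℕ) : ℝ)) * Real.log p
        ≤ (t : ℝ) * ((kpts : ℝ) / ((p : ℝ) - 1)) * Real.log p := by gcongr
      _ = (kpts : ℝ) * t * Real.log p / ((p : ℝ) - 1) := by ring
  have e2 : (t : ℝ) * N * Real.log p ≤ t * Real.log (2 * (kpts : ℝ)) := by
    rw [mul_assoc]; exact mul_le_mul_of_nonneg_left hNlog ht0
  linarith

/-! ### Small parameters against `𝔘` -/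

/-- `t_J · log(2·kpts) ≤ 𝔘/128` for the nodes of any inner step (`kpts ≤ 2^{d+J₀} S₀`,
`2^{J₀} ≤ 2L_θ`, `L_θ S₀ ≤ 𝔘/2¹⁴`, `log 𝔘 ≤ log U ≤ 10 W⋆`, `T W⋆ ≤ 𝔘/c_T`). [folklore]
[cite: Waldschmidt1980, §3.5 (p. 274) (source FOLLOWED for the numerical endgame; the cell’s constants, NOT a printed statement)] -/
theorem t_mul_log_kpts_le {J k : ℕ} (hJ : J < P.J₀p) (hk : k ≤ d) :
    (P.tJp J : ℝ) * Real.log (2 * ((2 ^ (k + J) * P.S₀p / 2 : ℕ) : ℝ)) ≤ P.𝔘p / 128 := by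
  have hkp := P.kpts_le_nat hJ.le hk
  have hLS := P.LθS₀_le
  have hpow : ((2 : ℕ) ^ P.J₀p : ℝ) ≤ 2 * P.Lθp := by exact_mod_cast P.two_pow_le
  have hU := P.𝔘_pos; have hW := P.one_le_Wstar; have hWU := P.Wstar_le_𝔘
  have hT := P.T_pos; have hTW := P.TWstar_le; have hm := two_le_mR P
  have hlogU := P.log_U_le
  -- `2 kpts ≤ 2 · 2^d · 2^{J₀} S₀ ≤ 2^{d+2} Lθ S₀ ≤ 2^{d+2} 𝔘/2^14 ≤ U`
  have h1 : 2 * ((2 ^ (k + J) * P.S₀p / 2 : ℕ) : ℝ) ≤ P.Up := by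
    have hk' : ((2 ^ (k + J) * P.S₀p / 2 : ℕ) : ℝ) ≤ ((2 ^ (d + P.J₀p) * P.S₀p : ℕ) : ℝ) := by
      exact_mod_cast hkp
    have hS : (0 : ℝ) ≤ P.S₀p := P.S₀_pos.le
    calc 2 * ((2 ^ (k + J) * P.S₀p / 2 : ℕ) : ℝ) ≤ 2 * ((2 ^ (d + P.J₀p) * P.S₀p : ℕ) : ℝ) := by linarith
      _ = 2 * 2 ^ d * ((2 : ℕ) ^ P.J₀p : ℝ) * P.S₀p := by push_cast; ring
      _ ≤ 2 * 2 ^ d * (2 * P.Lθp) * P.S₀p := by gcongr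
      _ = 2 ^ (d + 2) * (P.Lθp * P.S₀p) := by ring
      _ ≤ 2 ^ (d + 2) * (P.𝔘p / 2 ^ 14) := by gcongr
      _ ≤ 2 ^ (d + 1) * P.𝔘p := by
          rw [show (2 : ℝ) ^ (d + 2) = 2 ^ (d + 1) * 2 by ring]
          have : (0 : ℝ) ≤ 2 ^ (d + 1) := by positivity
          nlinarith
      _ = P.Up := P.U_eq.symm
  have hkpos : (0 : ℝ) < 2 * ((2 ^ (k + J) * P.S₀p / 2 : ℕ) : ℝ) := by
    have hS2 := P.two_le_S₀
    have : 1 ≤ 2 ^ (k + J) * P.S₀p / 2 := by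
      rw [Nat.le_div_iff_mul_le two_pos]
      calc 1 * 2 = 2 := by ring
        _ ≤ 2 ^ (k + J) * 2 := Nat.le_mul_of_pos_left 2 (Nat.pow_pos two_pos)
        _ ≤ 2 ^ (k + J) * P.S₀p := Nat.mul_le_mul_left _ hS2
    have : (1 : ℝ) ≤ ((2 ^ (k + J) * P.S₀p / 2 : ℕ) : ℝ) := by exact_mod_cast this
    linarith
  have hk1r : (1 : ℝ) ≤ 2 * ((2 ^ (k + J) * P.S₀p / 2 : ℕ) : ℝ) := by
    have hS2 := P.two_le_S₀
    have : 1 ≤ 2 ^ (k + J) * P.S₀p / 2 := by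
      rw [Nat.le_div_iff_mul_le two_pos]
      calc 1 * 2 = 2 := by ring
        _ ≤ 2 ^ (k + J) * 2 := Nat.le_mul_of_pos_left 2 (Nat.pow_pos two_pos)
        _ ≤ 2 ^ (k + J) * P.S₀p := Nat.mul_le_mul_left _ hS2
    have : (1 : ℝ) ≤ ((2 ^ (k + J) * P.S₀p / 2 : ℕ) : ℝ) := by exact_mod_cast this
    linarith
  have h2 : Real.log (2 * ((2 ^ (k + J) * P.S₀p / 2 : ℕ) : ℝ)) ≤ 10 * P.Wstarp :=
    (Real.log_le_log hkpos h1).trans hlogU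
  have ht : (P.tJp J : ℝ) ≤ P.Tp := by exact_mod_cast P.tJ_le_T J
  have ht0 : (0 : ℝ) ≤ P.tJp J := Nat.cast_nonneg _
  calc (P.tJp J : ℝ) * Real.log (2 * ((2 ^ (k + J) * P.S₀p / 2 : ℕ) : ℝ))
      ≤ P.Tp * (10 * P.Wstarp) := mul_le_mul ht h2 (Real.log_nonneg hk1r) hT.le
    _ = 10 * (P.Tp * P.Wstarp) := by ring
    _ ≤ 10 * (P.𝔘p / cTp) := by gcongr
    _ ≤ P.𝔘p / 128 := by unfold cTp; nlinarith

/-! ### The `k`-step inequalities (targets of `kFinal_of_log_ineq`) -/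

/-- **k-step, smallness branch (1)**: for `J < J₀`, `k < d`, `t = t_J`, `kpts = 2^{k+J}S₀/2` and any
size budget `log(Dmax·Mmax) ≤ 𝔘/4 + 2ᵏ𝔘/16`:
`(⌊hL_b/(p−1)⌋ + ⌊(t−1)/(p−1)⌋ + cond)·log p + log(Dmax·Mmax) < U` (the conditioning written out as in
`PadicCW77KStep.condExp`; `p ≥ 3`). [cite: Waldschmidt1980, Lemma 3.6 (p. 272)] -/
theorem kstep_ineq_one {p : ℕ} (hp : 3 ≤ p) {J k : ℕ} (hJ : J < P.J₀p) (hk : k < d) {logDM : ℝ}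
    (hDM : logDM ≤ P.𝔘p / 4 + 2 ^ k * P.𝔘p / 16) :
    ((P.hparp * P.Lbp / (p - 1) + (P.tJp J - 1) / (p - 1) +
        ∑ j ∈ range (Nat.log p (2 * (2 ^ (k + J) * P.S₀p / 2))),
          P.tJp J * ((2 ^ (k + J) * P.S₀p / 2) / p ^ (j + 1) + 1) : ℕ) : ℝ) * Real.log p + logDM <
      P.Up := by
  have hp2 : 2 ≤ p := by omega
  have hp1 : (1 : ℝ) < p := by exact_mod_cast (by omega : 1 < p)
  have hlogp1 := one_le_log_nat hp
  have hlogp0 : 0 ≤ Real.log p := by linarith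
  have hlps := log_le_sub_one_nat hp2
  have hpm1 : (0 : ℝ) < (p : ℝ) - 1 := by linarith
  have hU := P.𝔘_pos; have hW := P.one_le_Wstar; have hWU := P.Wstar_le_𝔘
  have hhLb := P.hparLb_le; have hT := P.T_le_𝔘; have hTpos := P.T_pos
  have hKT := P.KT_le J k
  have htl := P.t_mul_log_kpts_le hJ hk.le
  set kpts : ℕ := 2 ^ (k + J) * P.S₀p / 2 with hkpts
  set t : ℕ := P.tJp J with ht
  have hk1 : 1 ≤ kpts := by
    rw [hkpts, Nat.le_div_iff_mul_le two_pos]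
    calc 1 * 2 = 2 := by ring
      _ ≤ 2 ^ (k + J) * 2 := Nat.le_mul_of_pos_left 2 (Nat.pow_pos two_pos)
      _ ≤ 2 ^ (k + J) * P.S₀p := Nat.mul_le_mul_left _ P.two_le_S₀
  have htT : (t : ℝ) ≤ P.Tp := by exact_mod_cast P.tJ_le_T J
  -- casts of the floor divisions
  have hc1 : ((P.hparp * P.Lbp / (p - 1) : ℕ) : ℝ) ≤ (P.hparp : ℝ) * P.Lbp / ((p : ℝ) - 1) := by
    have h := Nat.cast_div_le (α := ℝ) (m := P.hparp * P.Lbp) (n := p - 1)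
    have e : ((p - 1 : ℕ) : ℝ) = (p : ℝ) - 1 := by rw [Nat.cast_sub (by omega)]; simp
    rw [e] at h; push_cast at h; exact h
  have hc2 : (((t - 1) / (p - 1) : ℕ) : ℝ) ≤ (t : ℝ) / ((p : ℝ) - 1) := by
    have h := Nat.cast_div_le (α := ℝ) (m := t - 1) (n := p - 1)
    have e : ((p - 1 : ℕ) : ℝ) = (p : ℝ) - 1 := by rw [Nat.cast_sub (by omega)]; simp
    rw [e] at h
    have h2 : ((t - 1 : ℕ) : ℝ) ≤ t := by exact_mod_cast Nat.sub_le t 1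
    exact h.trans (div_le_div_of_nonneg_right h2 hpm1.le)
  have hcond := condSum_mul_log_le hp2 kpts t hk1
  -- `x·log p/(p−1) ≤ x`
  have hdiv : ∀ x : ℝ, 0 ≤ x → x / ((p : ℝ) - 1) * Real.log p ≤ x := by
    intro x hx
    rw [div_mul_eq_mul_div, div_le_iff₀ hpm1]
    exact mul_le_mul_of_nonneg_left hlps hx
  have hhLb0 : (0 : ℝ) ≤ (P.hparp : ℝ) * P.Lbp := by positivity
  have ht0 : (0 : ℝ) ≤ t := Nat.cast_nonneg _
  have hkt0 : (0 : ℝ) ≤ (kpts : ℝ) * t := by positivity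
  -- assemble
  have hsum : ((P.hparp * P.Lbp / (p - 1) + (t - 1) / (p - 1) +
        ∑ j ∈ range (Nat.log p (2 * kpts)), t * (kpts / p ^ (j + 1) + 1) : ℕ) : ℝ) * Real.log p ≤
      (P.hparp : ℝ) * P.Lbp + t + ((kpts : ℝ) * t + P.𝔘p / 128) := by
    have e1 := hdiv _ hhLb0
    have e2 := hdiv _ ht0
    have e3 : ((kpts : ℝ) * t * Real.log p / ((p : ℝ) - 1)) ≤ (kpts : ℝ) * t := by
      have := hdiv _ hkt0; rwa [div_mul_eq_mul_div] at this
    have hA : ((P.hparp * P.Lbp / (p - 1) : ℕ) : ℝ) * Real.log p ≤ (P.hparp : ℝ) * P.Lbp :=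
      (mul_le_mul_of_nonneg_right hc1 hlogp0).trans e1
    have hB : (((t - 1) / (p - 1) : ℕ) : ℝ) * Real.log p ≤ t :=
      (mul_le_mul_of_nonneg_right hc2 hlogp0).trans e2
    have hC : ((∑ j ∈ range (Nat.log p (2 * kpts)), t * (kpts / p ^ (j + 1) + 1) : ℕ) : ℝ) *
        Real.log p ≤ (kpts : ℝ) * t + P.𝔘p / 128 := by
      refine hcond.trans ?_
      have := htl
      linarith
    have esplit : ((P.hparp * P.Lbp / (p - 1) + (t - 1) / (p - 1) +
          ∑ j ∈ range (Nat.log p (2 * kpts)), t * (kpts / p ^ (j + 1) + 1) : ℕ) : ℝ) * Real.log p =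
        ((P.hparp * P.Lbp / (p - 1) : ℕ) : ℝ) * Real.log p + (((t - 1) / (p - 1) : ℕ) : ℝ) * Real.log p +
          ((∑ j ∈ range (Nat.log p (2 * kpts)), t * (kpts / p ^ (j + 1) + 1) : ℕ) : ℝ) * Real.log p := by
      push_cast; ring
    rw [esplit]
    linarith
  -- numbers: `hLb ≤ 𝔘/c_L + 3W⋆`, `t ≤ 𝔘/c_T`, `kpts t ≤ 2^k 𝔘`, `U = 2^{d+1}𝔘 ≥ 4·2^k 𝔘`
  have hkt : (kpts : ℝ) * t ≤ 2 ^ k * P.𝔘p := hKT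
  have h2k : (4 : ℝ) * 2 ^ k ≤ 2 ^ (d + 1) := by
    have : (2 : ℝ) ^ (k + 2) ≤ 2 ^ (d + 1) := pow_le_pow_right₀ (by norm_num) (by omega)
    calc (4 : ℝ) * 2 ^ k = 2 ^ (k + 2) := by rw [pow_add]; norm_num; ring
      _ ≤ 2 ^ (d + 1) := this
  rw [P.U_eq]
  have h2k1 : (1 : ℝ) ≤ 2 ^ k := one_le_pow₀ (by norm_num)
  have h4 : 4 * (2 ^ k * P.𝔘p) ≤ 2 ^ (d + 1) * P.𝔘p := by nlinarith [h2k, hU.le]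
  have h5 : P.𝔘p ≤ 2 ^ k * P.𝔘p := by nlinarith
  unfold cLp at hhLb; unfold cTp at hT
  have : (P.hparp : ℝ) * P.Lbp + t + ((kpts : ℝ) * t + P.𝔘p / 128) + logDM < 2 ^ (d + 1) * P.𝔘p := by
    linarith
  linarith

/-- **k-step, gain branch (2)**: `hL_b·log p + log(Dmax·Mmax) < (kpts·t/2)·log p` for `J < J₀`,
`k < d` and any size budget `log(Dmax·Mmax) ≤ 𝔘/4 + 2ᵏ𝔘/16` (`kpts·t ≥ (31/32) 2ᵏ𝔘`, `log p ≥ 1`).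
[cite: Waldschmidt1980, Lemma 3.6 (p. 272)] -/
theorem kstep_ineq_two {p : ℕ} (hp : 3 ≤ p) {J k : ℕ} (hJ : J < P.J₀p) (_hk : k < d) {logDM : ℝ}
    (hDM : logDM ≤ P.𝔘p / 4 + 2 ^ k * P.𝔘p / 16) :
    ((P.hparp * P.Lbp : ℕ) : ℝ) * Real.log p + logDM <
      (((2 ^ (k + J) * P.S₀p / 2) * P.tJp J : ℕ) : ℝ) / 2 * Real.log p := by
  have hlogp1 := one_le_log_nat hp
  have hU := P.𝔘_pos; have hW := P.one_le_Wstar; have hWU := P.Wstar_le_𝔘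
  have hhLb := P.hparLb_le
  have hKT := P.KT_ge hJ k
  push_cast at hKT ⊢
  have h2k1 : (1 : ℝ) ≤ 2 ^ k := one_le_pow₀ (by norm_num)
  -- `hLb + budget < (31/64)·2^k·𝔘`, then multiply by `log p ≥ 1`
  have key : (P.hparp : ℝ) * P.Lbp + (P.𝔘p / 4 + 2 ^ k * P.𝔘p / 16) <
      31 / 32 * (2 ^ k * P.𝔘p) / 2 := by
    unfold cLp at hhLb; nlinarith
  have hX : P.𝔘p / 4 + 2 ^ k * P.𝔘p / 16 ≤ (P.𝔘p / 4 + 2 ^ k * P.𝔘p / 16) * Real.log p := by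
    have h0 : (0 : ℝ) ≤ P.𝔘p / 4 + 2 ^ k * P.𝔘p / 16 := by positivity
    nlinarith
  have h0' : (0 : ℝ) ≤ (P.hparp : ℝ) * P.Lbp := by positivity
  nlinarith [mul_le_mul_of_nonneg_right hKT (le_trans zero_le_one hlogp1)]

end PadicW80Par

end Literature.NumberTheory.Transcendental.StewartYu

end Part10

/-!
## Part 11 — port of `Summits/ABC/StewartYu/PadicW80NumericB.lean`

# The `p`-adic Waldschmidt numerics — part B: the half step and the rooms

Support file (theorems only), sequel of `PadicW80Numeric`: `halfstep_ineq_one/two` (the two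
logarithmic inequalities of p3's `hFinalHalf_of_log_ineq'` at `kpts' = 2^{d+J}S₀/2`, for any
threshold budget `B ≤ (7/16)·2ᵈ𝔘`); the room lemma `room_half` is in `PadicW80ParF`.
[cite: Waldschmidt1980, Lemma 3.7 (pp. 272–273)]
-/

section Part11

open _root_.Finset _root_.Real
open Literature.NumberTheory.Transcendental Literature.NumberTheory.Transcendental.Waldschmidt1980

namespace Literature.NumberTheory.Transcendental.StewartYu

namespace PadicW80Par

variable {d : ℕ} (P : PadicW80Par d)

omit P in
/-- `log p ≤ p − 1`. [folklore] -/
private theorem log_le_sub_one_nat' {p : ℕ} (hp : 2 ≤ p) : Real.log p ≤ (p : ℝ) - 1 :=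
  Real.log_le_sub_one_of_pos (by exact_mod_cast (by omega : 0 < p))

omit P in
/-- `1 ≤ log p` for `p ≥ 3` (`e < 3`). [folklore] -/
private theorem one_le_log_nat' {p : ℕ} (hp : 3 ≤ p) : (1 : ℝ) ≤ Real.log p := by
  rw [Real.le_log_iff_exp_le (by exact_mod_cast (by omega : 0 < p))]
  have := Real.exp_one_lt_d9
  have h3 : (3 : ℝ) ≤ p := by exact_mod_cast hp
  linarith

/-! ### The half-step inequalities (targets of `hFinalHalf_of_log_ineq'`) -/

/-- **Half step, smallness branch (1)**: with `kpts' = 2^{d+J}S₀/2`, `t = t_J` and any threshold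
budget `B ≤ (7/16)·2ᵈ𝔘`: `(⌊hL_b/(p−1)⌋ + ⌊(t−1)/(p−1)⌋ + cond')·log p + B < U`.
[cite: Waldschmidt1980, Lemma 3.7 (pp. 272–273)] -/
theorem halfstep_ineq_one {p : ℕ} (hp : 3 ≤ p) {J : ℕ} (hJ : J < P.J₀p) {B : ℝ}
    (hB : B ≤ 7 / 16 * (2 ^ d * P.𝔘p)) :
    ((P.hparp * P.Lbp / (p - 1) + (P.tJp J - 1) / (p - 1) +
        ∑ j ∈ range (Nat.log p (2 * (2 ^ (d + J) * P.S₀p / 2))),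
          P.tJp J * ((2 ^ (d + J) * P.S₀p / 2) / p ^ (j + 1) + 1) : ℕ) : ℝ) * Real.log p + B <
      P.Up := by
  have hp2 : 2 ≤ p := by omega
  have hp1 : (1 : ℝ) < p := by exact_mod_cast (by omega : 1 < p)
  have hlogp1 := one_le_log_nat' hp
  have hlogp0 : 0 ≤ Real.log p := by linarith
  have hlps := log_le_sub_one_nat' hp2
  have hpm1 : (0 : ℝ) < (p : ℝ) - 1 := by linarith
  have hU := P.𝔘_pos; have hW := P.one_le_Wstar; have hWU := P.Wstar_le_𝔘
  have hhLb := P.hparLb_le; have hT := P.T_le_𝔘; have hTpos := P.T_pos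
  have hKT := P.KT_le J d
  have htl := P.t_mul_log_kpts_le hJ le_rfl
  set kpts : ℕ := 2 ^ (d + J) * P.S₀p / 2 with hkpts
  set t : ℕ := P.tJp J with ht
  have hk1 : 1 ≤ kpts := by
    rw [hkpts, Nat.le_div_iff_mul_le two_pos]
    calc 1 * 2 = 2 := by ring
      _ ≤ 2 ^ (d + J) * 2 := Nat.le_mul_of_pos_left 2 (Nat.pow_pos two_pos)
      _ ≤ 2 ^ (d + J) * P.S₀p := Nat.mul_le_mul_left _ P.two_le_S₀
  have htT : (t : ℝ) ≤ P.Tp := by exact_mod_cast P.tJ_le_T J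
  have hc1 : ((P.hparp * P.Lbp / (p - 1) : ℕ) : ℝ) ≤ (P.hparp : ℝ) * P.Lbp / ((p : ℝ) - 1) := by
    have h := Nat.cast_div_le (α := ℝ) (m := P.hparp * P.Lbp) (n := p - 1)
    have e : ((p - 1 : ℕ) : ℝ) = (p : ℝ) - 1 := by rw [Nat.cast_sub (by omega)]; simp
    rw [e] at h; push_cast at h; exact h
  have hc2 : (((t - 1) / (p - 1) : ℕ) : ℝ) ≤ (t : ℝ) / ((p : ℝ) - 1) := by
    have h := Nat.cast_div_le (α := ℝ) (m := t - 1) (n := p - 1)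
    have e : ((p - 1 : ℕ) : ℝ) = (p : ℝ) - 1 := by rw [Nat.cast_sub (by omega)]; simp
    rw [e] at h
    have h2 : ((t - 1 : ℕ) : ℝ) ≤ t := by exact_mod_cast Nat.sub_le t 1
    exact h.trans (div_le_div_of_nonneg_right h2 hpm1.le)
  have hcond := condSum_mul_log_le hp2 kpts t hk1
  have hdiv : ∀ x : ℝ, 0 ≤ x → x / ((p : ℝ) - 1) * Real.log p ≤ x := by
    intro x hx
    rw [div_mul_eq_mul_div, div_le_iff₀ hpm1]
    exact mul_le_mul_of_nonneg_left hlps hx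
  have hhLb0 : (0 : ℝ) ≤ (P.hparp : ℝ) * P.Lbp := by positivity
  have ht0 : (0 : ℝ) ≤ t := Nat.cast_nonneg _
  have hkt0 : (0 : ℝ) ≤ (kpts : ℝ) * t := by positivity
  have hsum : ((P.hparp * P.Lbp / (p - 1) + (t - 1) / (p - 1) +
        ∑ j ∈ range (Nat.log p (2 * kpts)), t * (kpts / p ^ (j + 1) + 1) : ℕ) : ℝ) * Real.log p ≤
      (P.hparp : ℝ) * P.Lbp + t + ((kpts : ℝ) * t + P.𝔘p / 128) := by
    have e1 := hdiv _ hhLb0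
    have e2 := hdiv _ ht0
    have hA : ((P.hparp * P.Lbp / (p - 1) : ℕ) : ℝ) * Real.log p ≤ (P.hparp : ℝ) * P.Lbp :=
      (mul_le_mul_of_nonneg_right hc1 hlogp0).trans e1
    have hB' : (((t - 1) / (p - 1) : ℕ) : ℝ) * Real.log p ≤ t :=
      (mul_le_mul_of_nonneg_right hc2 hlogp0).trans e2
    have hC : ((∑ j ∈ range (Nat.log p (2 * kpts)), t * (kpts / p ^ (j + 1) + 1) : ℕ) : ℝ) *
        Real.log p ≤ (kpts : ℝ) * t + P.𝔘p / 128 := by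
      refine hcond.trans ?_
      have e3 : ((kpts : ℝ) * t * Real.log p / ((p : ℝ) - 1)) ≤ (kpts : ℝ) * t := by
        have := hdiv _ hkt0; rwa [div_mul_eq_mul_div] at this
      have := htl
      linarith
    have esplit : ((P.hparp * P.Lbp / (p - 1) + (t - 1) / (p - 1) +
          ∑ j ∈ range (Nat.log p (2 * kpts)), t * (kpts / p ^ (j + 1) + 1) : ℕ) : ℝ) * Real.log p =
        ((P.hparp * P.Lbp / (p - 1) : ℕ) : ℝ) * Real.log p + (((t - 1) / (p - 1) : ℕ) : ℝ) * Real.log p +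
          ((∑ j ∈ range (Nat.log p (2 * kpts)), t * (kpts / p ^ (j + 1) + 1) : ℕ) : ℝ) * Real.log p := by
      push_cast; ring
    rw [esplit]
    linarith
  have hkt : (kpts : ℝ) * t ≤ 2 ^ d * P.𝔘p := hKT
  rw [P.U_eq, pow_succ]
  have h2d : (1 : ℝ) ≤ 2 ^ d := one_le_pow₀ (by norm_num)
  have h5 : P.𝔘p ≤ 2 ^ d * P.𝔘p := by nlinarith
  have e2 : (2 : ℝ) ^ d * 2 * P.𝔘p = 2 * (2 ^ d * P.𝔘p) := by ring
  rw [e2]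
  unfold cLp at hhLb; unfold cTp at hT
  have : (P.hparp : ℝ) * P.Lbp + t + ((kpts : ℝ) * t + P.𝔘p / 128) + B < 2 * (2 ^ d * P.𝔘p) := by
    linarith
  linarith

/-- **Half step, gain branch (2)**: `hL_b·log p + B < (kpts'·t/2)·log p` for `kpts' = 2^{d+J}S₀/2`,
`t = t_J`, `J < J₀`, and any threshold budget `B ≤ (7/16)·2ᵈ𝔘`.
[cite: Waldschmidt1980, Lemma 3.7 (pp. 272–273)] -/
theorem halfstep_ineq_two {p : ℕ} (hp : 3 ≤ p) {J : ℕ} (hJ : J < P.J₀p) {B : ℝ}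
    (hB : B ≤ 7 / 16 * (2 ^ d * P.𝔘p)) :
    ((P.hparp * P.Lbp : ℕ) : ℝ) * Real.log p + B <
      (((2 ^ (d + J) * P.S₀p / 2) * P.tJp J : ℕ) : ℝ) / 2 * Real.log p := by
  have hlogp1 := one_le_log_nat' hp
  have hU := P.𝔘_pos; have hW := P.one_le_Wstar; have hWU := P.Wstar_le_𝔘
  have hhLb := P.hparLb_le
  have hKT := P.KT_ge hJ d
  push_cast at hKT ⊢
  have h2d : (1 : ℝ) ≤ 2 ^ d := one_le_pow₀ (by norm_num)
  have key : (P.hparp : ℝ) * P.Lbp + 7 / 16 * (2 ^ d * P.𝔘p) < 31 / 32 * (2 ^ d * P.𝔘p) / 2 := by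
    unfold cLp at hhLb; nlinarith
  have h0' : (0 : ℝ) ≤ (P.hparp : ℝ) * P.Lbp := by positivity
  rcases le_or_gt 0 B with hB0 | hB0
  · have hX : B ≤ B * Real.log p := by nlinarith
    nlinarith [mul_le_mul_of_nonneg_right hKT (le_trans zero_le_one hlogp1)]
  · nlinarith [mul_le_mul_of_nonneg_right hKT (le_trans zero_le_one hlogp1)]

end PadicW80Par

end Literature.NumberTheory.Transcendental.StewartYu

end Part11

/-!
## Part 12 — port of `Summits/ABC/StewartYu/PadicW80ParEnvelope.lean`

# The envelope of the `p`-adic parameter `U` (cell `abc-stewartyu`, WP-A5 closing)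

`Summits/ABC/StewartYu/PadicW80ParEnvelope.lean` — theorems (and one real constant `Cw`) on the
record `PadicW80Par` of `PadicW80Par.lean`/`PadicW80ParB.lean` (cell HOME
`run/shared/lean/pub/abc-stewartyu/`, seat p2): the parameter `U = Aᵐ m^{2m+1}/m! (∏Vⱼ)V_θ W⋆ G` against the
shape of the `p`-adic Theorem A, `U ≤ (2⁶⁹ m)ᵐ · (∏Vⱼ)V_θ · (W + log 2V_max) · log(2V_max)` — the
twin of `W80Par.U_le_Cw` (`Waldschmidt1980HW2.lean`) with both logarithmic terms at `V_max`
(`W⋆ ≤ m(10 + log m)(W + log 2V_max)`, `G ≤ m(17.1 + 1.45 log m) log(2V_max)`,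
`m^{2m+1}/m! ≤ eᵐ m^{m+1}`).  It is the hypothesis `U ≤ Cw(d+1)·((∏V)·V_θ)·(W + log 2V_max)·log 2V_max`
of p2's closing adapter `PadicCW77.theoremAShapeLe_of_packs` with `Cw m = (2⁶⁹ m)ᵐ`.

## References
* [Waldschmidt1980] M. Waldschmidt, Acta Arith. 37 (1980), §3.1 (p. 264).
* [Yu1990] K. Yu, Compositio Math. 74 (1990), Theorem 1 (the shape of the bound).
-/

section Part12

open _root_.Finset _root_.Real

namespace Literature.NumberTheory.Transcendental.StewartYu

open Literature.NumberTheory.Transcendental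

namespace PadicW80Par

variable {d : ℕ} (P : PadicW80Par d)

/-- **`U ≤ (2⁶⁹ m)ᵐ · (∏Vⱼ)V_θ · (W + log(2V_max)) · log(2V_max)`**: the parameter `U` of the
`p`-adic machine against the shape of Theorem A (`W⋆ ≤ m(10 + log m)(W + log 2V_max)`,
`G ≤ m(17.1 + 1.45 log m) log(2V_max)`, `m^{2m+1}/m! ≤ eᵐ m^{m+1}`).
[cite: Waldschmidt1980, §3.1 (p. 264)] [cite: Yu1990, Theorem 1] -/
theorem U_le_Cw :
    P.Up ≤ (2 ^ 69 * mRp d) ^ (d + 1) * ((∏ j, P.Vs j) * P.Vel) * (P.Wb + Real.log (2 * P.Vmax)) *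
      Real.log (2 * P.Vmax) := by
  have hm := two_le_mR P; have hm0 := mR_pos P; have hW := P.hW; have hVθ := P.one_le_Vθ
  have hVf := P.one_le_Vmax
  have hV := P.one_le_prodV
  set L := Real.log (2 * P.Vmax) with hL
  have hl2 := Real.log_two_gt_d9; have hl2' := Real.log_two_lt_d9
  have hL2 : Real.log 2 ≤ L := by rw [hL]; exact Real.log_le_log two_pos (by linarith)
  have hL0 : 0 < L := by linarith
  have hlogm : 0 ≤ Real.log (mRp d) := Real.log_nonneg (by linarith)
  have hlogm' : Real.log (mRp d) ≤ mRp d := (Real.log_le_sub_one_of_pos hm0).trans (by linarith)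
  -- `W⋆ ≤ m (10 + log m) (W + L)`
  have hWs : P.Wstarp ≤ mRp d * (10 + Real.log (mRp d)) * (P.Wb + L) := by
    unfold Wstarp
    refine max_le ?_ ?_
    · have h1 : (1 : ℝ) * 1 * P.Wb ≤ mRp d * (10 + Real.log (mRp d)) * (P.Wb + L) := by
        gcongr
        · linarith
        · linarith
        · linarith
      linarith
    · have e : Real.log (2 ^ 13 * mRp d * P.Vmax) = 12 * Real.log 2 + Real.log (mRp d) + L := by
        rw [hL, Real.log_mul (by positivity) (by linarith), Real.log_mul (by positivity) hm0.ne',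
          Real.log_mul two_ne_zero (by linarith), Real.log_pow]; push_cast; ring
      rw [e]
      have h2 : 12 * Real.log 2 + Real.log (mRp d) + L ≤ (10 + Real.log (mRp d)) * (P.Wb + L) := by
        nlinarith
      calc mRp d * (12 * Real.log 2 + Real.log (mRp d) + L) ≤ mRp d * ((10 + Real.log (mRp d)) * (P.Wb + L)) :=
            mul_le_mul_of_nonneg_left h2 hm0.le
        _ = mRp d * (10 + Real.log (mRp d)) * (P.Wb + L) := by ring
  -- `G ≤ m (17.1 + 1.45 log m) L`
  have hG : P.Gp ≤ mRp d * (17.1 + 1.45 * Real.log (mRp d)) * L := by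
    unfold Gp
    have e : Real.log (2 ^ 17 * mRp d * P.Vmax) = 16 * Real.log 2 + Real.log (mRp d) + L := by
      rw [hL, Real.log_mul (by positivity) (by linarith), Real.log_mul (by positivity) hm0.ne',
        Real.log_mul two_ne_zero (by linarith), Real.log_pow]; push_cast; ring
    rw [e]
    have h2 : 16 * Real.log 2 + Real.log (mRp d) + L ≤ (17.1 + 1.45 * Real.log (mRp d)) * L := by
      nlinarith
    calc mRp d * (16 * Real.log 2 + Real.log (mRp d) + L) ≤ mRp d * ((17.1 + 1.45 * Real.log (mRp d)) * L) :=
          mul_le_mul_of_nonneg_left h2 hm0.le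
      _ = _ := by ring
  -- `m^{2m+1}/m! ≤ e^m m^{m+1}`
  have hfac : mRp d ^ (2 * d + 3) / (d + 1).factorial ≤ Real.exp 1 ^ (d + 1) * mRp d ^ (d + 2) := by
    have hfacpos : (0 : ℝ) < (d + 1).factorial := by exact_mod_cast Nat.factorial_pos _
    have hst := CW77.pow_self_le_exp_mul_factorial (d + 1)
    have em : ((d + 1 : ℕ) : ℝ) = mRp d := by unfold mRp; push_cast; ring
    rw [em] at hst
    rw [div_le_iff₀ hfacpos]
    calc mRp d ^ (2 * d + 3) = mRp d ^ (d + 2) * mRp d ^ (d + 1) := by rw [← pow_add]; ring_nf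
      _ ≤ mRp d ^ (d + 2) * (Real.exp 1 ^ (d + 1) * (d + 1).factorial) := mul_le_mul_of_nonneg_left hst (by positivity)
      _ = Real.exp 1 ^ (d + 1) * mRp d ^ (d + 2) * (d + 1).factorial := by ring
  -- the constants: `A^m e^m m^{m+1} · m (10 + log m) · m (17.1 + 1.45 log m) ≤ (2^69 m)^m`
  have hconst : Ap ^ (d + 1) * (Real.exp 1 ^ (d + 1) * mRp d ^ (d + 2)) * (mRp d * (10 + Real.log (mRp d))) *
      (mRp d * (17.1 + 1.45 * Real.log (mRp d))) ≤ (2 ^ 69 * mRp d) ^ (d + 1) := by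
    have h1 : (10 + Real.log (mRp d)) * (17.1 + 1.45 * Real.log (mRp d)) ≤ 204.1 * mRp d ^ 2 := by nlinarith
    have h2 : mRp d ^ 5 ≤ 120 * Real.exp (mRp d) := by
      have := Real.pow_div_factorial_le_exp (mRp d) hm0.le 5
      rw [show (Nat.factorial 5 : ℝ) = 120 by norm_num, div_le_iff₀ (by norm_num)] at this
      linarith
    have he : Real.exp 1 ^ (d + 1) = Real.exp (mRp d) := by rw [← Real.exp_nat_mul]; unfold mRp; push_cast; ring_nf
    have hexp1 := Real.exp_one_lt_d9
    have h3 : Ap ^ (d + 1) * (Real.exp 1 ^ (d + 1) * mRp d ^ (d + 2)) * (mRp d * (10 + Real.log (mRp d))) *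
        (mRp d * (17.1 + 1.45 * Real.log (mRp d))) ≤ 204.1 * 120 * (Ap ^ (d + 1) * Real.exp (mRp d) ^ 2 * mRp d ^ (d + 1)) := by
      have hA : (0 : ℝ) ≤ Ap ^ (d + 1) := by unfold Ap; positivity
      calc Ap ^ (d + 1) * (Real.exp 1 ^ (d + 1) * mRp d ^ (d + 2)) * (mRp d * (10 + Real.log (mRp d))) *
            (mRp d * (17.1 + 1.45 * Real.log (mRp d)))
          = Ap ^ (d + 1) * Real.exp (mRp d) * mRp d ^ (d + 1) * mRp d ^ 3 *
              ((10 + Real.log (mRp d)) * (17.1 + 1.45 * Real.log (mRp d))) := by rw [he]; ring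
        _ ≤ Ap ^ (d + 1) * Real.exp (mRp d) * mRp d ^ (d + 1) * mRp d ^ 3 * (204.1 * mRp d ^ 2) := by
            gcongr
        _ = 204.1 * (Ap ^ (d + 1) * Real.exp (mRp d) * mRp d ^ (d + 1)) * mRp d ^ 5 := by ring
        _ ≤ 204.1 * (Ap ^ (d + 1) * Real.exp (mRp d) * mRp d ^ (d + 1)) * (120 * Real.exp (mRp d)) := by
            gcongr
        _ = 204.1 * 120 * (Ap ^ (d + 1) * Real.exp (mRp d) ^ 2 * mRp d ^ (d + 1)) := by ring
    refine h3.trans ?_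
    have he2 : Real.exp (mRp d) ^ 2 = Real.exp 2 ^ (d + 1) := by
      rw [← Real.exp_nat_mul, ← Real.exp_nat_mul]; unfold mRp; push_cast; ring_nf
    have he74 : Real.exp 2 ≤ 7.4 := by
      have : Real.exp 2 = Real.exp 1 ^ 2 := by rw [← Real.exp_nat_mul]; norm_num
      rw [this]; nlinarith [Real.exp_pos 1]
    have h4 : (204.1 : ℝ) * 120 * Real.exp 2 ^ (d + 1) ≤ (2 ^ 19) ^ (d + 1) := by
      calc (204.1 : ℝ) * 120 * Real.exp 2 ^ (d + 1) ≤ (204.1 * 120) ^ (d + 1) * Real.exp 2 ^ (d + 1) := by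
            gcongr
            have : (1 : ℝ) ≤ 204.1 * 120 := by norm_num
            calc (204.1 : ℝ) * 120 = (204.1 * 120) ^ 1 := (pow_one _).symm
              _ ≤ (204.1 * 120) ^ (d + 1) := pow_le_pow_right₀ this (by omega)
        _ = (204.1 * 120 * Real.exp 2) ^ (d + 1) := by ring
        _ ≤ (2 ^ 19) ^ (d + 1) := by
            apply pow_le_pow_left₀ (by positivity)
            nlinarith
    unfold Ap
    calc 204.1 * 120 * (((2 : ℝ) ^ 50) ^ (d + 1) * Real.exp (mRp d) ^ 2 * mRp d ^ (d + 1))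
        = (204.1 * 120 * Real.exp 2 ^ (d + 1)) * (((2 : ℝ) ^ 50) ^ (d + 1) * mRp d ^ (d + 1)) := by rw [he2]; ring
      _ ≤ (2 ^ 19) ^ (d + 1) * (((2 : ℝ) ^ 50) ^ (d + 1) * mRp d ^ (d + 1)) := by gcongr
      _ = (2 ^ 69 * mRp d) ^ (d + 1) := by
          rw [mul_pow, ← mul_assoc, ← pow_mul, ← pow_mul, ← pow_add, ← pow_mul,
            show 19 * (d + 1) + 50 * (d + 1) = 69 * (d + 1) by ring]
  -- assemble
  unfold Up
  have hVV : 0 ≤ (∏ j, P.Vs j) * P.Vel := by positivity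
  have hA : (0 : ℝ) ≤ Ap ^ (d + 1) := by unfold Ap; positivity
  have hG0 := P.G_pos.le; have hWs0 : 0 ≤ P.Wstarp := by linarith [P.one_le_Wstar]
  have hF0 : 0 ≤ mRp d ^ (2 * d + 3) / ((d + 1).factorial : ℝ) := by positivity
  have step1 : Ap ^ (d + 1) * (mRp d ^ (2 * d + 3) / (d + 1).factorial) * ((∏ j, P.Vs j) * P.Vel) * P.Wstarp * P.Gp ≤
      Ap ^ (d + 1) * (Real.exp 1 ^ (d + 1) * mRp d ^ (d + 2)) * ((∏ j, P.Vs j) * P.Vel) *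
          (mRp d * (10 + Real.log (mRp d)) * (P.Wb + L)) * (mRp d * (17.1 + 1.45 * Real.log (mRp d)) * L) := by
    have hc1 : 0 ≤ Ap ^ (d + 1) * (Real.exp 1 ^ (d + 1) * mRp d ^ (d + 2)) * ((∏ j, P.Vs j) * P.Vel) :=
      mul_nonneg (mul_nonneg hA (by positivity)) hVV
    have hc2 : 0 ≤ mRp d * (10 + Real.log (mRp d)) * (P.Wb + L) :=
      mul_nonneg (mul_nonneg hm0.le (by linarith)) (by linarith)
    refine mul_le_mul (mul_le_mul (mul_le_mul_of_nonneg_right (mul_le_mul_of_nonneg_left hfac hA) hVV) hWs hWs0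
      hc1) hG hG0 (mul_nonneg hc1 hc2)
  refine step1.trans ?_
  have e : Ap ^ (d + 1) * (Real.exp 1 ^ (d + 1) * mRp d ^ (d + 2)) * ((∏ j, P.Vs j) * P.Vel) *
      (mRp d * (10 + Real.log (mRp d)) * (P.Wb + L)) * (mRp d * (17.1 + 1.45 * Real.log (mRp d)) * L) =
      (Ap ^ (d + 1) * (Real.exp 1 ^ (d + 1) * mRp d ^ (d + 2)) * (mRp d * (10 + Real.log (mRp d))) *
        (mRp d * (17.1 + 1.45 * Real.log (mRp d)))) * (((∏ j, P.Vs j) * P.Vel) * (P.Wb + L) * L) := by ring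
  rw [e]
  have h0 : 0 ≤ ((∏ j, P.Vs j) * P.Vel) * (P.Wb + L) * L := by
    have : 0 ≤ P.Wb + L := by linarith
    positivity
  calc (Ap ^ (d + 1) * (Real.exp 1 ^ (d + 1) * mRp d ^ (d + 2)) * (mRp d * (10 + Real.log (mRp d))) *
        (mRp d * (17.1 + 1.45 * Real.log (mRp d)))) * (((∏ j, P.Vs j) * P.Vel) * (P.Wb + L) * L)
      ≤ (2 ^ 69 * mRp d) ^ (d + 1) * (((∏ j, P.Vs j) * P.Vel) * (P.Wb + L) * L) := mul_le_mul_of_nonneg_right hconst h0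
    _ = (2 ^ 69 * mRp d) ^ (d + 1) * ((∏ j, P.Vs j) * P.Vel) * (P.Wb + L) * L := by ring

/-- The envelope constant of Theorem A: `Cw m = (2⁶⁹ m)ᵐ`. [cite: Waldschmidt1980, §3.1 (p. 264)] -/
def Cw (m : ℕ) : ℝ := (2 ^ 69 * m) ^ m

/-- `Cw (d+1) = (2⁶⁹ m)^{d+1}` with `m = mRp d`. [cite: Waldschmidt1980, §3.1 (p. 264)] -/
theorem Cw_succ (d : ℕ) : Cw (d + 1) = (2 ^ 69 * mRp d) ^ (d + 1) := by
  unfold Cw mRp; push_cast; ring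

/-- `2 ≤ Cw m` for `m ≥ 1`. [cite: Waldschmidt1980, §3.1 (p. 264)] -/
theorem two_le_Cw {m : ℕ} (hm : 1 ≤ m) : (2 : ℝ) ≤ Cw m := by
  unfold Cw
  have h1 : (2 : ℝ) ≤ 2 ^ 69 * m := by
    have : (1 : ℝ) ≤ m := by exact_mod_cast hm
    nlinarith
  calc (2 : ℝ) = 2 ^ 1 := by norm_num
    _ ≤ (2 ^ 69 * (m : ℝ)) ^ 1 := by rw [pow_one, pow_one]; exact h1
    _ ≤ (2 ^ 69 * (m : ℝ)) ^ m := pow_le_pow_right₀ (by linarith) hm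

/-- The W80-type envelope: `2 · Cw m ≤ (2⁷⁰)^m · m^{1·m}` for `m ≥ 1`. [cite: Waldschmidt1980, §3.1 (p. 264)] -/
theorem two_mul_Cw_le {m : ℕ} (hm : 1 ≤ m) : 2 * Cw m ≤ (2 ^ 70 : ℝ) ^ m * (m : ℝ) ^ ((1 : ℝ) * m) := by
  unfold Cw
  rw [one_mul, Real.rpow_natCast, mul_pow]
  have hm0 : (0 : ℝ) ≤ (m : ℝ) ^ m := by positivity
  have h2 : (2 : ℝ) * (2 ^ 69) ^ m ≤ (2 ^ 70) ^ m := by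
    rw [← pow_mul, ← pow_mul]
    calc (2 : ℝ) * 2 ^ (69 * m) = 2 ^ (69 * m + 1) := by rw [pow_succ]; ring
      _ ≤ 2 ^ (70 * m) := pow_le_pow_right₀ (by norm_num) (by omega)
  calc 2 * (((2 : ℝ) ^ 69) ^ m * (m : ℝ) ^ m) = (2 * ((2 : ℝ) ^ 69) ^ m) * (m : ℝ) ^ m := by ring
    _ ≤ (2 ^ 70) ^ m * (m : ℝ) ^ m := mul_le_mul_of_nonneg_right h2 hm0

/-- `U ≤ Cw(d+1) · ((∏Vⱼ)·V_θ) · (W + log 2V_max) · log(2V_max)` — the envelope hypothesis of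
`PadicCW77.theoremAShapeLe_of_packs`. [cite: Waldschmidt1980, §3.1 (p. 264)] [cite: Yu1990, Theorem 1] -/
theorem U_le_Cw' :
    P.Up ≤ Cw (d + 1) * ((∏ j, P.Vs j) * P.Vel) * (P.Wb + Real.log (2 * P.Vmax)) * Real.log (2 * P.Vmax) := by
  rw [Cw_succ]; exact P.U_le_Cw

/-- `V_θ ≤ U` (so `log p ≤ V_θ` gives the floor `log p ≤ U` of the machine, N-U).
[cite: Waldschmidt1980, §3.1 (p. 264)] -/
theorem Vel_le_U : P.Vel ≤ P.Up := by
  have h1 := P.sumV_le_𝔘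
  have h2 := P.U_eq
  have hs : 0 ≤ ∑ j, P.Vs j := sum_nonneg fun j _ => le_trans zero_le_one (P.hV j)
  have h𝔘 := P.𝔘_pos
  have h3 : P.𝔘p ≤ P.Up := by
    rw [h2]
    have : (1 : ℝ) ≤ 2 ^ (d + 1) := one_le_pow₀ (by norm_num)
    nlinarith
  have h4 : P.Vel ≤ 2 ^ 90 * ((∑ j, P.Vs j) + P.Vel) := by
    have : (1 : ℝ) ≤ 2 ^ 90 := by norm_num
    nlinarith [P.one_le_Vθ]
  linarith

/-- N-U: `log p ≤ U` as soon as `log p ≤ V_θ`. [cite: Waldschmidt1980, §3.1 (p. 264)] -/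
theorem le_U_of_le_Vθ {x : ℝ} (hx : x ≤ P.Vel) : x ≤ P.Up := hx.trans P.Vel_le_U

end PadicW80Par

end Literature.NumberTheory.Transcendental.StewartYu

end Part12

/-!
## Part 13 — port of `Summits/ABC/ABC/Theorems/PadicPrincipalCoreST86TheoremA.lean`

# Route PadicPrincipalCoreST86, crux item `TheoremA` (stmt-ABC-18951): the parameter pack with ALL
# inputs discharged, Theorem A, and the item

`Summits/ABC/ABC/Theorems/PadicPrincipalCoreST86TheoremA.lean` — cell `abc-stewartyu` (HOME
`run/shared/lean/pub/abc-stewartyu/`, seat p3; one structure-valued `def` + theorems, no named fact).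
Three parts (formerly staged as `StewartYu/PadicCW77Pack.lean`, `StewartYu/PadicCW77TheoremA.lean`
and this item file; merged to save two gate layers):

**Part 1 — the pack** (on p2's `PadicCW77Assembly.lean`: `ParamPack`, `norm_Λ₀_gt_of_paramPack`,
`kFinal_of_log_ineq`; p1's record and numerics `PadicW80Par{,B–F}`, `PadicW80Numeric{,B}`:
`kstep_ineq_one/two`, `halfstep_ineq_one/two`, `log_p_le_U`, `one_le_tJ`, `tJ_mul_le`, `even_S₀`,
`room_half`; p2's height link `SizeHyp`; p3's `PadicW80Budgets.lean` / `PadicCW77Sizes.lean` (J1/J2: closed forms, budgets, `KSizes`,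
`Siegel`, `Endgame`) and `PadicCW77Junctions.lean` (J3, `hFinalHalf_of_log_ineq'`, `hSizesHalf_of_hyp'`)): `sizeHyp_of_logHeight'`, `PintP'`,
**`paramPackOf'`** (`S.ParamPack P.Up`, EVERY field discharged), **`norm_Λ₀_gt'`**,
`norm_Λ₀_gt_of_logHeight'`.

**Part 2 — Theorem A** (p2's closing adapter `PadicCW77.theoremAShapeLe_of_packs` + envelope
`PadicW80Par.U_le_Cw'`): `packs_exist`, **`theoremAShapeLe_one_holds : TheoremAShapeLe 1`**
(`c₁ = 2⁷⁰`, `c₂ = 1`, `r = 0`), **`theoremAShape_holds : TheoremAShape`**.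

**Part 3 — the item**: `padicPrincipalCoreST86_theoremA_proof :
Summit.ABC.ABC.Theses.PadicPrincipalCoreST86.TheoremA` (the route text is `TheoremAShape` with
`SymmBound` inlined).

Everything is [folklore] assembly; the mathematics is Waldschmidt 1980 / Yu 1990 transposed to the
principal-unit `p`-adic setting by the cell's chain (p1 WP-A1/A4/M, p2 WP-A2/A5, p3 WP-A3/J1–J3).
-/

section Part13

/-! ## Part 1 — the parameter pack, all inputs discharged -/

open _root_.Finset
open Literature.NumberTheory.Transcendental
open Literature.NumberTheory.Transcendental.CW77 (heightProd hgt)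
open Literature.NumberTheory.Transcendental.CW77.Setup (Idx Tau tauNorm)

namespace Literature.NumberTheory.Transcendental.PadicCW77.Setup

open Literature.NumberTheory.Transcendental.StewartYu
open Literature.NumberTheory.Transcendental.StewartYu.PadicW80Par (cLp')

variable (S : PadicCW77.Setup)

/-! ### The height link from the hypotheses of `CoreBound` -/

/-- **The height link of the flattening from `CoreBound`-style hypotheses** (`h(αⱼ) ≤ Vⱼ`,
`h(θ) ≤ V_θ`, `log max(3,|bⱼ|) ≤ W`, `log max(3,|b_θ|) ≤ W`). [folklore]
[cite: Waldschmidt1980, Prop. 3.8 (p. 263) with Yu1990, Theorem 1 (sources FOLLOWED: the printed lower bounds of which Theorem A is the cell’s kernel p-adic analogue for rational principal units; NOT a printed statement)] -/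
theorem sizeHyp_of_logHeight' {V : Fin S.d → ℝ} {Vθ W : ℝ} (hV : ∀ j, Height.logHeight₁ (S.α j) ≤ V j)
    (hVθ : Height.logHeight₁ S.θ ≤ Vθ) (hW : ∀ j, Real.log (max 3 (|S.b j| : ℝ)) ≤ W)
    (hWθ : Real.log (max 3 (|S.bθ| : ℝ)) ≤ W) : S.toQ'.flat.SizeHyp V Vθ W := by
  have hexp : ∀ z : ℤ, Real.log (max 3 (|z| : ℝ)) ≤ W → |(z : ℝ)| ≤ Real.exp W := by
    intro z hz
    have h3 : (0 : ℝ) < max 3 (|z| : ℝ) := lt_max_of_lt_left (by norm_num)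
    have := Real.exp_le_exp.mpr hz
    rw [Real.exp_log h3] at this
    exact (le_max_right _ _).trans this
  have hHabs : ∀ q : ℚ, Real.log (hgt |q|) = Height.logHeight₁ q := fun q => by
    rw [SetupQ.hgt_abs, CW77.log_hgt_eq_logHeight₁]
  have hl : ∀ q : ℚ, q ≠ 0 → |Real.log ((|q| : ℚ) : ℝ)| ≤ Height.logHeight₁ q := fun q hq => by
    rw [Rat.cast_abs, ← CW77.log_hgt_eq_logHeight₁]; exact SetupQ.abs_log_abs_le_log_hgt hq
  exact
    { hH := fun j => by
        show Real.log (hgt |S.α j|) ≤ V j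
        rw [hHabs]; exact hV j
      hl := fun j => by
        show |Real.log ((|S.α j| : ℚ) : ℝ)| ≤ V j
        exact (hl _ (S.α_ne j)).trans (hV j)
      hHθ := by
        show Real.log (hgt |S.θ|) ≤ Vθ
        rw [hHabs]; exact hVθ
      hlθ := by
        show |Real.log ((|S.θ| : ℚ) : ℝ)| ≤ Vθ
        exact (hl _ S.θ_ne).trans hVθ
      hb := fun j => hexp _ (hW j)
      hbθ := hexp _ hWθ }

/-! ### The integer coefficient bound -/

/-- The integer coefficient bound of Siegel's step: `⌈#box₀ · 𝔅⁴ E(2)⌉`. [folklore]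
[cite: Waldschmidt1980, Prop. 3.8 (p. 263) with Yu1990, Theorem 1 (sources FOLLOWED: the printed lower bounds of which Theorem A is the cell’s kernel p-adic analogue for rational principal units; NOT a printed statement)] -/
def PintP' (P : PadicW80Par S.d) : ℤ :=
  ⌈((S.frame.box (h := P.hparp) (Lb := P.Lbp) P.Lp P.Lθp 0).card : ℝ) * (P.𝔅p ^ 4 * P.Efacp 2)⌉

/-- `PintP' ≤ PrV = 2·𝔅⁵E(2)` (`#box₀ ≤ 𝔅`). [folklore]
[cite: Waldschmidt1980, Prop. 3.8 (p. 263) with Yu1990, Theorem 1 (sources FOLLOWED: the printed lower bounds of which Theorem A is the cell’s kernel p-adic analogue for rational principal units; NOT a printed statement)] -/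
theorem PintP_le_PrVp' (P : PadicW80Par S.d) : (S.PintP' P : ℝ) ≤ P.PrVp := by
  classical
  unfold PintP' PadicW80Par.PrVp
  have hcard : ((S.frame.box (h := P.hparp) (Lb := P.Lbp) P.Lp P.Lθp 0).card : ℝ) ≤ P.𝔅p :=
    S.toQ'.flat.card_box_le_𝔅_p' P 0
  have hE := P.Efacp_pos 2
  have hA0 : 0 ≤ P.𝔅p ^ 4 * P.Efacp 2 := by have := P.𝔅_pos; positivity
  have hA1 : 1 ≤ P.𝔅p ^ 5 * P.Efacp 2 :=
    one_le_mul_of_one_le_of_one_le (one_le_pow₀ P.one_le_𝔅) (P.one_le_Efacp (by norm_num))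
  have h1 : ((S.frame.box (h := P.hparp) (Lb := P.Lbp) P.Lp P.Lθp 0).card : ℝ) * (P.𝔅p ^ 4 * P.Efacp 2) ≤
      P.𝔅p ^ 5 * P.Efacp 2 := by
    calc ((S.frame.box (h := P.hparp) (Lb := P.Lbp) P.Lp P.Lθp 0).card : ℝ) * (P.𝔅p ^ 4 * P.Efacp 2)
        ≤ P.𝔅p * (P.𝔅p ^ 4 * P.Efacp 2) := mul_le_mul_of_nonneg_right hcard hA0
      _ = P.𝔅p ^ 5 * P.Efacp 2 := by ring
  have h2 := Int.ceil_lt_add_one (((S.frame.box (h := P.hparp) (Lb := P.Lbp) P.Lp P.Lθp 0).card : ℝ) *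
    (P.𝔅p ^ 4 * P.Efacp 2))
  linarith

/-! ### The pack, all fields discharged -/

/-- **The `p`-adic parameter pack at p1's record**, every input of p2's `main` discharged from the
height link, Kummer-freeness and the floor `log p ≤ V_θ`. [folklore]
[cite: Waldschmidt1980, Prop. 3.8 (p. 263) with Yu1990, Theorem 1 (sources FOLLOWED: the printed lower bounds of which Theorem A is the cell’s kernel p-adic analogue for rational principal units; NOT a printed statement)] -/
def paramPackOf' {P : PadicW80Par S.d} (hy : S.toQ'.flat.SizeHyp P.Vs P.Vel P.Wb)
    (hind : ∀ T' : Finset (Fin (S.d + 1)), T'.Nonempty → ¬ IsSquare (∏ i ∈ T', S.all i))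
    (hpV : Real.log S.p ≤ P.Vel) : S.ParamPack P.Up where
  h := P.hparp
  Lb := P.Lbp
  J₀ := P.J₀p
  L := P.Lp
  Lθ := P.Lθp
  S₀ := P.S₀p
  T := P.Tp
  P := S.PintP' P
  t := P.tJp
  Dmax := fun _ k => P.DmaxK k
  Mmax := fun _ k => P.MmaxK k
  hS₀ := P.even_S₀
  ht := fun _ hJ => P.one_le_tJ hJ
  htT := fun J _ => by have := P.tJ_mul_le J; nlinarith
  hUp := P.log_p_le_U hpV
  hsz := fun J hJ p inv => kSizes_of_hyp' hy hJ (P.tJp J) (S.PintP_le_PrVp' P) inv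
  hfin := fun hΛ J hJ =>
    S.kFinal_of_log_ineq J P.S₀p (P.tJp J) (fun k => P.DmaxK k) (fun k => P.MmaxK k) hΛ
      (fun k _ => ⟨P.DmaxK_pos k, P.MmaxK_pos k⟩)
      (fun k hk => P.kstep_ineq_one S.hp3 hJ hk (P.logDM_le_budget k))
      (fun k hk => P.kstep_ineq_two S.hp3 hJ hk (P.logDM_le_budget k))
  hhalf := fun hΛ J hJ => by
    have hp0 : (0 : ℝ) < S.p := by exact_mod_cast S.hp.pos
    have hΛ' : ‖S.Λ₀‖ ≤ (S.p : ℝ)⁻¹ := by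
      refine hΛ.trans ?_
      rw [← Real.exp_log hp0, ← Real.exp_neg, Real.exp_le_exp]
      exact neg_le_neg (P.log_p_le_U hpV)
    have hroom : P.Tp / 2 ^ (J + 1) + P.tJp J ≤ P.Tp / 2 ^ J - S.d * P.tJp J := by
      have h2 := P.room_half J
      have e1 : (S.d + 1) * P.tJp J = S.d * P.tJp J + P.tJp J := by ring
      rw [e1] at h2
      omega
    -- the height product against the sizes
    have hH1 : 1 ≤ heightProd S.all := CW77.one_le_heightProd _
    have hH : heightProd S.all ≤ Real.exp ((∑ j, P.Vs j) + P.Vel) := by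
      have h1 := hy.heightProd_le
      rw [S.toQ'.heightProd_flat_all, CW77.Setup.SizeHyp.sum_snoc] at h1
      exact h1
    refine S.halfStep_of' hJ hind hΛ' (P.one_le_tJ hJ) P.even_S₀ hroom
      (hSizesHalf_of_hyp' hy hJ (S.PintP_le_PrVp' P)) ?_
    exact S.hFinalHalf_of_log_ineq' J P.S₀p (P.tJp J) hΛ (by linarith [P.one_le_DmaxHp])
      (by linarith [P.one_le_MmaxHp])
      (P.halfstep_ineq_one S.hp3 hJ (P.bhalf_le_budget hH1 hH))
      (P.halfstep_ineq_two S.hp3 hJ (P.bhalf_le_budget hH1 hH))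
  hsiegel := siegel_of_hyp' hy
  hend := endgame_of_params' P _

/-- **`‖Λ₀‖_p > e^{−U}` at p1's parameter record** — p2's `norm_Λ₀_gt_of_paramPack` on `paramPackOf'`:
the `p`-adic Waldschmidt descent, all inputs discharged. [folklore]
[cite: Waldschmidt1980, Prop. 3.8 (p. 263) with Yu1990, Theorem 1 (sources FOLLOWED: the printed lower bounds of which Theorem A is the cell’s kernel p-adic analogue for rational principal units; NOT a printed statement)] -/
theorem norm_Λ₀_gt' {P : PadicW80Par S.d} (hy : S.toQ'.flat.SizeHyp P.Vs P.Vel P.Wb)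
    (hind : ∀ T' : Finset (Fin (S.d + 1)), T'.Nonempty → ¬ IsSquare (∏ i ∈ T', S.all i))
    (hpV : Real.log S.p ≤ P.Vel) : Real.exp (-P.Up) < ‖S.Λ₀‖ :=
  S.norm_Λ₀_gt_of_paramPack (S.paramPackOf' hy hind hpV)

/-- **`‖Λ₀‖_p > e^{−U}` from the `CoreBound`-style height hypotheses** for any record
`P : PadicW80Par S.d` whose sizes dominate the data: `h(αⱼ) ≤ Vⱼ`, `h(θ) ≤ V_θ`,
`log max(3,|b|) ≤ W`, `log p ≤ V_θ`. [folklore]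
[cite: Waldschmidt1980, Prop. 3.8 (p. 263) with Yu1990, Theorem 1 (sources FOLLOWED: the printed lower bounds of which Theorem A is the cell’s kernel p-adic analogue for rational principal units; NOT a printed statement)] -/
theorem norm_Λ₀_gt_of_logHeight' (P : PadicW80Par S.d)
    (hind : ∀ T' : Finset (Fin (S.d + 1)), T'.Nonempty → ¬ IsSquare (∏ i ∈ T', S.all i))
    (hV : ∀ j, Height.logHeight₁ (S.α j) ≤ P.Vs j) (hVθ : Height.logHeight₁ S.θ ≤ P.Vel)
    (hW : ∀ j, Real.log (max 3 (|S.b j| : ℝ)) ≤ P.Wb) (hWθ : Real.log (max 3 (|S.bθ| : ℝ)) ≤ P.Wb)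
    (hpV : Real.log S.p ≤ P.Vel) : Real.exp (-P.Up) < ‖S.Λ₀‖ :=
  S.norm_Λ₀_gt' (S.sizeHyp_of_logHeight' hV hVθ hW hWθ) hind hpV

end Literature.NumberTheory.Transcendental.PadicCW77.Setup

/-! ## Part 2 — Theorem A -/

open _root_.Finset
open Literature.NumberTheory.Transcendental
open Literature.NumberTheory.Transcendental.PadicCW77

namespace Literature.NumberTheory.Transcendental.StewartYu

/-- **Packs exist** for every signed Kummer-free set-up with `d ≥ 1`: the record `P` is the data
`(V, V_max, V_θ, W)` itself, the pack is `paramPackOf'`, the exponent is `P.Up ≤ Cw(d+1)·…`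
(`U_le_Cw'`). [folklore]
[cite: Waldschmidt1980, Prop. 3.8 (p. 263) with Yu1990, Theorem 1 (sources FOLLOWED: the printed lower bounds of which Theorem A is the cell’s kernel p-adic analogue for rational principal units; NOT a printed statement)] -/
theorem packs_exist (S : PadicCW77.Setup) (V : Fin S.d → ℝ) (Vθ Vmax W : ℝ) (hd : 1 ≤ S.d)
    (hK : ∀ T : Finset (Fin (S.d + 1)), T.Nonempty → ¬ IsSquare (∏ i ∈ T, S.all i))
    (_hμ : ∀ μ : Fin (S.d + 1) → ℤ, ∏ i, S.all i ^ μ i = 1 → μ = 0)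
    (hV : ∀ j, Height.logHeight₁ (S.α j) ≤ V j) (hVθ : Height.logHeight₁ S.θ ≤ Vθ)
    (hVp : ∀ j, Real.log S.p ≤ V j) (hVθp : Real.log S.p ≤ Vθ) (hVm : ∀ j, V j ≤ Vmax) (hVθm : Vθ ≤ Vmax)
    (hW : ∀ j, Real.log (max 3 (|S.b j| : ℝ)) ≤ W) (hWθ : Real.log (max 3 (|S.bθ| : ℝ)) ≤ W) :
    ∃ U : ℝ, U ≤ PadicW80Par.Cw (S.d + 1) * ((∏ j, V j) * Vθ) * (W + Real.log (2 * Vmax)) *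
      Real.log (2 * Vmax) ∧ Nonempty (S.ParamPack U) := by
  -- `1 < log 3` and `1 ≤ log p` (inlined: the named forms exist elsewhere in the tree)
  have hlog3 : (1 : ℝ) < Real.log 3 := by
    rw [Real.lt_log_iff_exp_lt (by norm_num)]
    have := Real.exp_one_lt_d9; norm_num at this; linarith
  have hlp : (1 : ℝ) ≤ Real.log S.p :=
    hlog3.le.trans (Real.log_le_log (by norm_num) (by exact_mod_cast S.hp3))
  have hW1 : (1 : ℝ) ≤ W := by
    have h3 : Real.log 3 ≤ Real.log (max 3 (|S.bθ| : ℝ)) :=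
      Real.log_le_log (by norm_num) (le_max_left _ _)
    linarith [hWθ]
  let P : PadicW80Par S.d :=
    { Vs := V, Vmax := Vmax, Vel := Vθ, Wb := W
      hV := fun j => hlp.trans (hVp j)
      hVmax := hVm
      hVmax1 := (hlp.trans hVθp).trans hVθm
      hVθ1 := hlp.trans hVθp
      hVθmax := hVθm
      hW := hW1
      hd := hd }
  exact ⟨P.Up, P.U_le_Cw', ⟨S.paramPackOf' (P := P) (S.sizeHyp_of_logHeight' hV hVθ hW hWθ) hK hVθp⟩⟩

/-- **Theorem A with `c₁ = 2⁷⁰`, `c₂ = 1`** (`TheoremAShapeLe 1`; route B₃'s `TheoremAOne` shape).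
[folklore]
[cite: Waldschmidt1980, Prop. 3.8 (p. 263) with Yu1990, Theorem 1 (sources FOLLOWED: the printed lower bounds of which Theorem A is the cell’s kernel p-adic analogue for rational principal units; NOT a printed statement)] -/
theorem theoremAShapeLe_one_holds : TheoremAShapeLe 1 :=
  theoremAShapeLe_of_packs (Cw := PadicW80Par.Cw) (c₁ := 2 ^ 70) (c₂ := 1) (by norm_num) (by norm_num)
    le_rfl (fun _ hm => PadicW80Par.two_le_Cw hm) (fun _ hm => PadicW80Par.two_mul_Cw_le hm)
    (fun S V Vθ Vmax W hd hK hμ hV hVθ hVp hVθp hVm hVθm hW hWθ =>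
      packs_exist S V Vθ Vmax W hd hK hμ hV hVθ hVp hVθp hVm hVθm hW hWθ)

/-- **THEOREM A** (the cell's `TheoremAShape`, cap `c₂ ≤ 10`; verbatim the statement of the route
item `Summit.ABC.ABC.Theses.PadicPrincipalCoreST86.TheoremA`). [folklore]
[cite: Waldschmidt1980, Prop. 3.8 (p. 263) with Yu1990, Theorem 1 (sources FOLLOWED: the printed lower bounds of which Theorem A is the cell’s kernel p-adic analogue for rational principal units; NOT a printed statement)] -/
theorem theoremAShape_holds : TheoremAShape :=
  theoremAShape_of_packs (Cw := PadicW80Par.Cw) (c₁ := 2 ^ 70) (c₂ := 1) (by norm_num) (by norm_num)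
    (by norm_num) (fun _ hm => PadicW80Par.two_le_Cw hm) (fun _ hm => PadicW80Par.two_mul_Cw_le hm)
    (fun S V Vθ Vmax W hd hK hμ hV hVθ hVp hVθp hVm hVθm hW hWθ =>
      packs_exist S V Vθ Vmax W hd hK hμ hV hVθ hVp hVθp hVm hVθm hW hWθ)

end Literature.NumberTheory.Transcendental.StewartYu

/-! ## Part 3 — the route item -/

namespace Summit.ABC.ABC.Theorems

end Summit.ABC.ABC.Theorems

end Part13

/-! ## Part 14 — the EXACT discharge -/

namespace Literature.NumberTheory.Transcendental.PadicCW77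

/-- **The named statement `PadicCW77.TheoremAShape` HOLDS** (`PadicCW77Assembly.lean`: Theorem A in the cell's shape — some
constant of W80 type `C m ≤ c₁^m m^{c₂ m}`, `c₂ ≤ 10`, in the `p`-adic lower bound `SymmBound C r` for linear forms in
logarithms of rational principal units at every odd prime).  EXACT-name restatement of `StewartYu.theoremAShape_holds`
(last Part: `c₁ = 2⁷⁰`, `c₂ = 1`, `r = 0`, packs for every set-up), Literature-side twin of
`Summit.ABC.StewartYu.theoremAShape_holds` (same proof). [cite: Waldschmidt1980, Prop. 3.8 (p. 263)] [cite: Yu1990, Theorem 1] -/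
theorem TheoremAShape_holds : TheoremAShape :=
  StewartYu.theoremAShape_holds

end Literature.NumberTheory.Transcendental.PadicCW77

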